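import Summits.HubbardSuperconductivity.HubbardSuperconductivity.Theses.ThermalWedge
import Summits.HubbardSuperconductivity.HubbardSuperconductivity.Theorems.ThermalWedgeTwSourcedInertnessReduction
import Literature.MathematicalPhysics.QuantumLattice.ApproximatingHamiltonianProofs
import Literature.MathematicalPhysics.QuantumLattice.DWaveSourceFreePressure
import Literature.MathematicalPhysics.QuantumLattice.GibbsEntropy
import Literature.MathematicalPhysics.QuantumLattice.TorusCooperSum
import Literature.MathematicalPhysics.QuantumLattice.TorusCooperSumRowWalk
import Literature.MathematicalPhysics.QuantumLattice.TorusCooperSumLogBound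
import Literature.MathematicalPhysics.QuantumLattice.LiebFluxPhaseProofs
import Literature.MathematicalPhysics.QuantumLattice.PatchPairOperator
import Literature.MathematicalPhysics.QuantumLattice.HubbardAtomicLimit
import Literature.MathematicalPhysics.QuantumLattice.HubbardWave0RayleighProofs
import Literature.MathematicalPhysics.QuantumLattice.PairCorrelationsODLROSupRayleighProofs
import Literature.MathematicalPhysics.QuantumLattice.HubbardCommutatorBound

/-!
# Disproof of `TwSourcedInertness` (stmt-HubbardSuperconductivity-1696) — findings

Standing adversary's work file (refuter, cdisprove mode; route `ThermalWedge`, rank-2 crux).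
CRUX (verbatim shape): `∀ [μ₁,μ₂] ⊂ (-4,0) ∃ U₀ a C > 0 ∀ U ∈ (0,U₀] ∀ β ∈ [1, e^{a/U}] ∀ μ ∈ [μ₁,μ₂]
∃ L₀ ∀ L ≥ L₀ ∀ h ∈ ℝ: p̃_L(β,μ,U,h) − p̃_L(β,μ,U,0) ≤ C(1+log β)h²`,
`p̃_L(h) = log Z_β(hubbardTorusWith 2 L 1 U μ − h(Δ_d+Δ_dᴴ))/(βL²)` (`sourcedPressure` below).

VERDICT SO FAR (cycle 2, 2026-08-16): NOT REFUTED; no cheap kill exists (see §E for why). Everything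
below is `lean check` rc 0, sorry-free (the file has NO `sorry`); cycle 2 added §H–§J (exact free
gain; the lead's two registered stubs as TARGETS; `log β` LOAD-BEARING: `tw1696_false_without_log`).
LANDED AS IMPORTABLE THEOREMS (namespace `…Theorems.TwSourcedInertness.Negative`, statements spelled
out, no definitions; `import Summits.HubbardSuperconductivity.HubbardSuperconductivity.Theorems.
TwSourcedInertness.Negative.<File>`): `FreeGain` (p74279, §H + the `ε = −1` level of the `3j`-torus +
bookkeeping), `StubThresholds` (p74735, §I), `ThermalRowWalk` (p74887, §J.1–J.2),
`ThermalCooperLog` (p75178, §J.3–J.5: `free_gain_thermal_lower_bound`, `tw1696_noLog_false`,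
`tw1696_noLog_disc_false`). Also new in Literature (not by this seat): `DWaveSourceFreeGainBound`
PROVES hypothesis (F) of the route's reduction (free inertness `≤ C₀(1+log β)s²` for `L ≥ max(3,⌈β⌉)`),
so the crux's entire remaining content is the interacting window (W) `h²(1+log β) ≲ κU`.

## Findings (indexed by section)

* §A ABSTRACT THERMAL LEMMAS (sorry-free, general Hermitian `H`, `O` on `ℂⁿ`):
  `gain_le_mul_norm`      `log Z(H−hO) − log Z(H) ≤ β|h|‖O‖` (large sources are automatic);
  `gain_ge_linear`        ENTROPY SANDWICH `log Z(H−hO) − log Z(H) ≥ β(E−⟨v,Hv⟩) + βh⟨v,Ov⟩ − log dim`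
                          for `H ≥ E`, unit `v` (the route's own wedge, pointed at the crux);
  `sq_le_of_gain_le_quadratic`  quadratic gain `≤ βKh²` ⇒ `⟨v,Ov⟩² ≤ 4K(⟨v,Hv⟩ − E + log dim/β)`;
  `not_gain_le_quadratic_of_degenerate`  a ground vector with `⟨v,Ov⟩ = m ≠ 0` violates any
                          quadratic bound once `β > 4K log dim / m²` (THE finite-size obstruction).
* §B THE CRUX'S OBJECTS: `sourcedPressure`, `pairSource = Δ_d + Δ_dᴴ`, `‖Δ_d+Δ_dᴴ‖ ≤ 8√2 L²`
  (`norm_pairSource_le`, confirming the docstring's constant), hence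
  `sourcedPressure_sub_le_linear`: `p̃_L(h) − p̃_L(0) ≤ 8√2|h|` for ALL `L, U, μ, β>0, h` and
  `sourcedPressure_sub_le_of_large_h`: the crux is AUTOMATIC for `|h| ≥ 8√2/(C(1+log β))` —
  its content is the window `|h| < 8√2/(C(1+log β))` (three IR regimes `|h| ≲ T`, `T ≪ |h|`, nodal).
* §C `towerBound_of_inertness : TwSourcedInertness → TwGcTowerBound` — the crux's `T = 0` SHADOW:
  for every energy floor `E ≤ H_L(U,μ)` and unit `v`,
  `(Re⟨v,(Δ_d+Δ_dᴴ)v⟩/L²)² ≤ 4C(1+log β)((Re⟨v,Hv⟩−E)/L² + log4/β)`; at `β = e^{a/U}` every state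
  within `o(1)` energy density of the GC ground energy has `d`-wave pair amplitude density
  `≤ 2√(C(1+a/U)·log 4)·e^{−a/(2U)}`. This needs NO approximating-Hamiltonian theorem and NO ensemble
  equivalence (cf. TwCeilingGlue): planners may want it as the cheap half of the ceiling. As a
  refutation target it would need a GC low-energy state with pair amplitude ≫ e^{−a/(2U)} at weak
  `U` — Kohn–Luttinger order is `e^{−c/U²}`, far below: NO KILL from this side.
* §D LOAD-BEARING HYPOTHESIS, PROVED (sorry-free, axioms = {propext, Classical.choice, Quot.sound}):
  `tw1696_false_without_eventually : ¬ TwSourcedInertnessAllL` — the crux with `∃ L₀ ∀ L ≥ L₀`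
  replaced by `∀ L ≥ 3` is FALSE (cycle 1 proved it on the 3×3 torus with the explicit shell
  superposition `v = (c†_{0↑}c†_{0↓}|∅⟩ + c†_{q↑}c†_{−q↓}c†_{0↑}c†_{0↓}|∅⟩)/√2`, `q = (1,0)`, amplitude
  `3√2`, energy `≤ −6 + 9U`; since cycle 2 it is the corollary `AllL → UniformL0` of §D.11, and the
  3×3-specific sections §D.3–§D.7 were removed for the size cap). MESSAGE TO PROVERS: the threshold `L₀(β, μ)` is
  load-bearing and must grow with `β` (shell degeneracy gives `χ_L ~ β m²/L²` whenever `μ` is a level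
  of the `L`-torus; for `μ = −1` that is every `L ≡ 0 mod 3`), so no proof can be uniform in `L ≥ L₀`
  with `L₀` independent of `β`; `L ≫ β` (thermal length) is the safe regime. Infrastructure of
  independent value: §D.1 `momentumAnnihilation = annihilate (modeFun k σ)` + orthonormality of
  plane-wave modes from the two CARs; §D.2 abstract two-level shell states over any orthonormal
  smeared modes; §D.3 the 3×3 band (`ε ∈ {−4,−1,2}`); §D.5 `0 ≤ ⟨W⟩ ≤ |Λ|` for the Hubbard
  interaction via doublon projectors (no `Matrix.diagonal`, no identity matrix: quadratic forms only,
  to dodge the two `DecidableEq` paths on `Orb (FermionTorus 2 L)`).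
  STRONGER FORM, ALSO PROVED (§D.9–§D.11): `tw1696_false_uniform_threshold :
  ¬ TwSourcedInertnessUniformL0` — even a threshold `L₀` chosen AFTER `(U₀, a, C)` but before
  `(U, β, μ)` is impossible: given `L₀` the refuter takes `L = 3·max(L₀,1)` (level `ε = −1` through
  `q = (L/3, 0)`) and the free FERMI-SEA shell state (`slater` determinants over the orthonormal
  plane-wave family, §D.9; amplitude `3√2`, energy within `U L²` of the floor `E_F`, §D.10), then
  `β = (C log4 · L⁴ + 1)²`, `U = min(U₀, a/log β, 2/(L⁴ C(1+log β)))`. Hence `L₀(β, μ) → ∞` as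
  `β → ∞` is FORCED (quantitatively `L₀(β, −1) ≳ (β/(C(1+log β)))^{1/4}`; exponent sharpened to
  `1/2` in §I). Dropping `log β`: DONE in §J (cycle 2). Letting `μ₂ → 0`: open (§E).
* §F CONSEQUENCE II (sorry-free): `kls_trial_state` (abstract Kennedy–Lieb–Shastry trial state:
  a unit global ground vector `ψ` and a charge-lowering `A` give a unit `v` with
  `Re⟨v,(A+Aᴴ)v⟩² = ‖Aψ‖²` and excess energy `≤ ‖Aᴴ[H,A]−[H,A]Aᴴ‖/(2‖Aψ‖²)`), and
  `gcLRO_bound_of_inertness : TwSourcedInertness → TwGcGroundStateLROBound`: for every `N ≥ 4`-particle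
  unit global ground vector of `hubbardTorusWith 2 L 1 U μ` (GC-exposed sector),
  `P² ≤ 2K‖[Δ_dᴴ,[H,Δ_d]]‖ + 4K(L² log4/β)P`, `P = ⟨ψ,Δ_dᴴΔ_dψ⟩`, `K = C(1+log β)L²`. With the
  folklore `‖[Δ_dᴴ,[H,Δ_d]]‖ = O(L²)` (graded locality; NOT formalised here) this is the exponential
  ceiling `limsup P/L⁴ ≤ 4C(1+a/U) log4 · e^{−a/U}` — the route's ceiling for GC-exposed sectors
  WITHOUT `TwApproximatingHamiltonian` and without ensemble equivalence (planner: the AHM port is only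
  needed for the rungs; for the ceiling the remaining gap is canonical-vs-GC exposure = convexity of
  `N ↦ E₀(N)`, which is exactly what `TwPureThermalBound` buys at `T > 0`).
* §G (sorry-free): `norm_dWaveDoubleCommutator_le : ‖[Δ_dᴴ,[H,Δ_d]]‖ ≤ κ(U,μ)·L²` with the explicit
  `κ = dcConst U μ = 125·8√2·54·2(2+|U|+2|μ|)·4√2` (graded locality: `P_x` even in the CAR algebra of
  its ≤ 6 sites, `[H,P_x]` localised in the closed neighbourhood, ≤ 125 partners `y`; memberships
  proved GENERICALLY over `Λ` to dodge the instance diamond), hence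
  `gcExplicitCeiling_of_inertness : TwSourcedInertness → TwGcExplicitCeiling`:
  `(P/L⁴)² ≤ 2C(1+log β)κ(U,μ)/L⁴ + 4C(1+log β)(log4/β)(P/L⁴)` for every `N ≥ 4`-particle global GC
  ground vector — a COMPLETE proof that the crux alone yields the exponential ceiling on GC-exposed
  ground-state `d`-wave LRO (`limsup_L P/L⁴ ≤ 4C(1+a/U)·log 4·e^{−a/U}` at `β = e^{a/U}`).
* §H (cycle 2, sorry-free) EXACT FREE GAIN. The tree now PROVES the `U = 0` BdG formula
  (`Literature…DWaveSourceFreePressure`, 2026-08-15T23:37Z):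
  `p̃_L(β,μ,0,s) − p̃_L(β,μ,0,0) = (βL²)⁻¹ Σ_k [F(βE_k(s)) − F(βξ_k)]`, `F(y) = log((1+cosh y)/2)`,
  `E_k² = ξ_k² + 8s²ĝ_d(k)²` (`free_gain_eq`, per-mode `modeGain ≥ 0`, `modeGain_of_level`); with the
  route's `|p̃(U) − p̃(0)| ≤ |U|` (Theorems/ThermalWedgeTwSourcedInertnessReduction) every free LOWER
  bound transfers: `level_gain_lower_bound : F(β·2√2|h ĝ_d(q)|)/(βL²) − 2|U| ≤ G_U(h)` on any torus
  with a free level at `μ` through `q`. This replaces the trial-state route of §D by two lines.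
* §I (cycle 2, sorry-free) TARGETS = the lead's registered stubs (skeleton `e54a28ee`):
  `StubThermalDisc` (crux restricted to `|h| ≤ 1/β`) and `StubEntropyDensity`
  (`S_L(β) = log Z + β⟨H⟩ ≤ C L²/β`). BOTH SURVIVE as stated (true thermodynamic-limit Fermi-liquid
  statements); their `L₀`-uniform and `∀ L ≥ 3` variants are FALSE:
  `stub_thermalDisc_false_uniformL0`, `stub_thermalDisc_false_allL` (witness `μ = −1`, `L = 3j`,
  zero mode `q = (j,0)`, `h = 1/β`, `β = (4CL²+1)²`: zero-mode Curie gain `F(3√2)/(βL²) ≥ 1/(βL²)`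
  beats `C(1+log β)/β² + 2U`), `stub_entropyDensity_false_uniformL0`, `stub_entropyDensity_false_allL`
  (same torus, `β = 2CL²+2`: dyadic sandwich `S(β) ≥ 2 log Z(β) − log Z(2β)` + exact free `Z` ⇒
  `S_L(β) ≥ 2 log 2 − 4βUL² ≥ log 2 > CL²/β`). MESSAGE TO THE LEAD: in both stubs `L₀` must grow with
  `β`: thermal disc `L₀(β,−1)² ≳ β/(C(1+log β))`, entropy `L₀(β,−1)² ≳ β/C` (every exact zero mode
  keeps entropy `2 log 2` down to `T = 0`); `L ≫ √β` (not only `L ≫` thermal length `β`) is where the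
  entropy-density law can start to hold on tori with levels at `μ`.
* §J (cycle 2, sorry-free, axioms standard) `log β` IS LOAD-BEARING:
  `tw1696_false_without_log : ¬ TwSourcedInertnessNoLog` (the crux with bound `C·h²`) and the
  thermal-disc form `tw1696_false_without_log_disc : ¬ TwThermalDiscNoLog`. Witness `μ = −2`,
  `h = 1/β`, `β = 128·e^{2736π(C+2)}`, `U = min(U₀, a/(1+log β), 1/(2β²))`, ANY `L ≥ max(L₀,400,2β)`:
  the FREE gain carries the thermal Cooper logarithm
  `free_gain_thermal_lower_bound : (log β − log 128)/(2736π β²) ≤ p̃_L(β,−2,0,1/β) − p̃_L(β,−2,0,0)`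
  (`L ≥ 400`, `β ≥ 128`, `L ≥ 2β`; row walk of the tree with the temperature as infrared cutoff on the
  `≥ L/9` rows `cos k₂ ≥ 3/4`, where `ĝ_d ≤ −1/2` on the positive-`ξ` side, plus the per-level
  convexity bound `modeGain_thermal_lower_bound : ĝ_d²/(19β|ξ|) ≤ F(βE) − F(βξ)` for `|ξ| ≥ 1/β`).
  MESSAGE TO PROVERS: the `β`-dependence of the crux's constant is SHARP — `C(1 + log β)` cannot be
  improved to `C`; any proof must exhibit the Cooper logarithm `χ_d ≍ ρ_d log β`, already at `U → 0`,
  and already inside the thermal disc `|h| ≤ 1/β` (so `stub_thermalDisc` inherits it). This is also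
  the `U = 0`, `|h| = T` corner of the sibling crux 1697 (`TwSourcedCondensation`) with explicit constants.
* §E WHY IT RESISTS (prose + near-misses): the refuter controls `(U, β)` only with `U log β ≤ a`
  (prover's `a`); in that regime every channel's ladder parameter is `O(a)` (`d`-wave: `U²·log β ≤ aU`),
  the free `d`-wave susceptibility at fixed `μ ∈ (−4,0)` is `ρ_d(μ) log β + O(1)` (log², the only
  cheap super-log mechanism, needs `μ = 0`: van Hove × Cooper, excluded by `μ₂ < 0`), and finite-size
  shell degeneracies (§D) are evaded by `L₀(β, μ)`. A refutation therefore needs a genuinely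
  non-perturbative `T ≥ e^{−a/U}` phenomenon of the 2D Hubbard model at generic filling — none is
  known or conjectured. The crux is "true but unproved" (BGM 2006 Thm 1.1 + Nambu source at general μ).
-/

noncomputable section

set_option linter.dupNamespace false

namespace Summit.HubbardSuperconductivity.HubbardSuperconductivity.Cruxes.TwSourcedInertness.Disproof

open Matrix Finset Literature.MathematicalPhysics.QuantumLattice Literature.Probability.LatticeModels
open Literature.MathematicalPhysics.QuantumLattice.RayleighBound

/-! ## §A Abstract thermal lemmas: pressure gain of a sourced Hamiltonian `H - h O` -/

section Abstract

open scoped Matrix.Norms.L2Operator ComplexOrder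

variable {n : Type*} [Fintype n] [DecidableEq n] [Nonempty n]

/-- The (extensive) pressure gain `log Z_β(H - hO) - log Z_β(H)`. -/
def gain (β : ℝ) (H O : Matrix n n ℂ) (h : ℝ) : ℝ :=
  Real.log (partitionFn β (H - (h : ℂ) • O)).re - Real.log (partitionFn β H).re

omit [Fintype n] [DecidableEq n] [Nonempty n] in
theorem isHermitian_sub_smul {H O : Matrix n n ℂ} (hH : H.IsHermitian) (hO : O.IsHermitian)
    (h : ℝ) : (H - (h : ℂ) • O).IsHermitian := by
  refine hH.sub (IsHermitian.smul hO ?_)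
  rw [isSelfAdjoint_iff, Complex.star_def, Complex.conj_ofReal]

/-- **Large sources are automatic**: `log Z(H - hO) - log Z(H) ≤ β |h| ‖O‖`
(Lipschitz bound for the free energy). -/
theorem gain_le_mul_norm {H O : Matrix n n ℂ} (hH : H.IsHermitian) (hO : O.IsHermitian)
    {β : ℝ} (hβ : 0 ≤ β) (h : ℝ) : gain β H O h ≤ β * (|h| * ‖O‖) := by
  have key := log_partitionFn_sub_log_partitionFn_le (isHermitian_sub_smul hH hO h) hH hβ
  have hnorm : ‖H - (H - (h : ℂ) • O)‖ = |h| * ‖O‖ := by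
    rw [sub_sub_cancel, norm_smul, Complex.norm_real, Real.norm_eq_abs]
  rw [hnorm] at key
  exact key

/-- `log Z_β(E • 1) = log (card n) - β E`. -/
theorem log_partitionFn_smul_one (β E : ℝ) :
    Real.log (partitionFn β ((E : ℂ) • (1 : Matrix n n ℂ))).re =
      Real.log (Fintype.card n) - β * E := by
  have h0 : (0 : Matrix n n ℂ).IsHermitian := isHermitian_zero
  have h := log_partitionFn_add_smul_one h0 β E
  rw [zero_add] at h
  rw [h]
  congr 1
  simp [partitionFn, gibbsWeight]

/-- `H ≥ E` (as an operator) bounds the free energy: `log Z_β(H) ≤ log (card n) - β E`. -/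
theorem log_partitionFn_le_of_ge {H : Matrix n n ℂ} (hH : H.IsHermitian) {β : ℝ} (hβ : 0 ≤ β)
    {E : ℝ} (hE : (H - (E : ℂ) • (1 : Matrix n n ℂ)).PosSemidef) :
    Real.log (partitionFn β H).re ≤ Real.log (Fintype.card n) - β * E := by
  have h1 : ((E : ℂ) • (1 : Matrix n n ℂ)).IsHermitian := by
    refine IsHermitian.smul isHermitian_one ?_
    rw [isSelfAdjoint_iff, Complex.star_def, Complex.conj_ofReal]
  rw [← log_partitionFn_smul_one β E]
  exact log_partitionFn_le_of_posSemidef h1 hH hβ hE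

/-- Variational lower bound: `log Z_β(H) ≥ -β Re⟨v, H v⟩` for every unit vector `v`. -/
theorem neg_mul_rayleigh_le_log_partitionFn {H : Matrix n n ℂ} (hH : H.IsHermitian) {β : ℝ}
    (hβ : 0 ≤ β) {v : n → ℂ} (hv : star v ⬝ᵥ v = 1) :
    -(β * (star v ⬝ᵥ H *ᵥ v).re) ≤ Real.log (partitionFn β H).re := by
  have h1 := exp_neg_mul_groundEnergy_le_partitionFn hH β
  have h2 : H.groundEnergy ≤ (star v ⬝ᵥ H *ᵥ v).re := groundEnergy_le_rayleigh_holds hH v hv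
  have h3 : Real.exp (-(β * (star v ⬝ᵥ H *ᵥ v).re)) ≤ (partitionFn β H).re :=
    le_trans (Real.exp_le_exp.2 (by nlinarith)) h1
  have h4 := Real.log_le_log (Real.exp_pos _) h3
  rwa [Real.log_exp] at h4

/-- **Entropy-sandwich lower bound on the pressure gain.** For Hermitian `H ≥ E`, Hermitian `O`,
a unit vector `v`, `β ≥ 0` and real `h`:
`log Z(H - hO) - log Z(H) ≥ β (E - Re⟨v,Hv⟩) + β h Re⟨v,Ov⟩ - log card`. -/
theorem gain_ge_linear {H O : Matrix n n ℂ} (hH : H.IsHermitian) (hO : O.IsHermitian) {β : ℝ}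
    (hβ : 0 ≤ β) {E : ℝ} (hE : (H - (E : ℂ) • (1 : Matrix n n ℂ)).PosSemidef) {v : n → ℂ}
    (hv : star v ⬝ᵥ v = 1) (h : ℝ) :
    β * (E - (star v ⬝ᵥ H *ᵥ v).re) + β * h * (star v ⬝ᵥ O *ᵥ v).re
        - Real.log (Fintype.card n) ≤ gain β H O h := by
  have hup := log_partitionFn_le_of_ge hH hβ hE
  have hlow := neg_mul_rayleigh_le_log_partitionFn (isHermitian_sub_smul hH hO h) hβ hv
  have hexp : (star v ⬝ᵥ (H - (h : ℂ) • O) *ᵥ v).re =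
      (star v ⬝ᵥ H *ᵥ v).re - h * (star v ⬝ᵥ O *ᵥ v).re := by
    rw [sub_mulVec, dotProduct_sub, smul_mulVec, dotProduct_smul, Complex.sub_re,
      smul_eq_mul, Complex.re_ofReal_mul]
  rw [hexp] at hlow
  unfold gain
  nlinarith

/-- **Quadratic pressure gain caps the order parameter of every low-energy state.** If
`log Z(H - hO) - log Z(H) ≤ β K h²` for all real `h` (`K > 0`, `β > 0`) and `H ≥ E`, then every
unit vector `v` has `(Re⟨v,Ov⟩)² ≤ 4K (Re⟨v,Hv⟩ - E + log card / β)`. -/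
theorem sq_le_of_gain_le_quadratic {H O : Matrix n n ℂ} (hH : H.IsHermitian) (hO : O.IsHermitian)
    {β K : ℝ} (hβ : 0 < β) (hK : 0 < K)
    (hgain : ∀ h : ℝ, gain β H O h ≤ β * K * h ^ 2) {E : ℝ}
    (hE : (H - (E : ℂ) • (1 : Matrix n n ℂ)).PosSemidef) {v : n → ℂ} (hv : star v ⬝ᵥ v = 1) :
    (star v ⬝ᵥ O *ᵥ v).re ^ 2 ≤
      4 * K * ((star v ⬝ᵥ H *ᵥ v).re - E + Real.log (Fintype.card n) / β) := by
  set m := (star v ⬝ᵥ O *ᵥ v).re with hm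
  set R := (star v ⬝ᵥ H *ᵥ v).re with hR
  have key := (gain_ge_linear hH hO hβ.le hE hv (m / (2 * K))).trans (hgain (m / (2 * K)))
  -- divide by β
  have h1 : β * (m / (2 * K) * m - K * (m / (2 * K)) ^ 2) ≤
      β * (R - E) + Real.log (Fintype.card n) := by linarith [key]
  have hD : m / (2 * K) * m - K * (m / (2 * K)) ^ 2 ≤ R - E + Real.log (Fintype.card n) / β := by
    have hrw : R - E + Real.log (Fintype.card n) / β = (β * (R - E) + Real.log (Fintype.card n)) / β := by
      field_simp
    rw [hrw, le_div_iff₀ hβ]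
    linarith [h1]
  have hcalc : m / (2 * K) * m - K * (m / (2 * K)) ^ 2 = m ^ 2 / (4 * K) := by
    field_simp
    ring
  rw [hcalc, div_le_iff₀ (by positivity)] at hD
  linarith

/-- **Degenerate ground vectors kill the quadratic bound.** If `v` is a unit vector with
`Re⟨v,Hv⟩ = E`, `H ≥ E`, and `Re⟨v,Ov⟩ = m ≠ 0`, then `log Z(H - hO) - log Z(H) ≤ β K h²`
fails for some `h` as soon as `β > 4 K log card / m²`. -/
theorem not_gain_le_quadratic_of_degenerate {H O : Matrix n n ℂ} (hH : H.IsHermitian)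
    (hO : O.IsHermitian) {β K : ℝ} (hβ : 0 < β) (hK : 0 < K) {E : ℝ}
    (hE : (H - (E : ℂ) • (1 : Matrix n n ℂ)).PosSemidef) {v : n → ℂ} (hv : star v ⬝ᵥ v = 1)
    (hvE : (star v ⬝ᵥ H *ᵥ v).re = E)
    (hβK : 4 * K * Real.log (Fintype.card n) < β * (star v ⬝ᵥ O *ᵥ v).re ^ 2) :
    ¬ ∀ h : ℝ, gain β H O h ≤ β * K * h ^ 2 := by
  intro hgain
  have h := sq_le_of_gain_le_quadratic hH hO hβ hK hgain hE hv
  rw [hvE, sub_self, zero_add] at h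
  have h2 : β * (star v ⬝ᵥ O *ᵥ v).re ^ 2 ≤ 4 * K * Real.log (Fintype.card n) := by
    calc β * (star v ⬝ᵥ O *ᵥ v).re ^ 2 ≤ β * (4 * K * (Real.log (Fintype.card n) / β)) :=
          mul_le_mul_of_nonneg_left h hβ.le
      _ = 4 * K * Real.log (Fintype.card n) := by field_simp
  linarith

omit [Nonempty n] in
/-- A quadratic-form floor `E ‖x‖² ≤ Re⟨x,Hx⟩` gives the operator floor `H ≥ E`. (Stated through
quadratic forms so that concrete models need not mention the identity matrix.) -/
theorem posSemidef_sub_smul_one_of_forall {H : Matrix n n ℂ} (hH : H.IsHermitian) {E : ℝ}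
    (h : ∀ x : n → ℂ, E * (star x ⬝ᵥ x).re ≤ (star x ⬝ᵥ H *ᵥ x).re) :
    (H - (E : ℂ) • (1 : Matrix n n ℂ)).PosSemidef := by
  have h1 : ((E : ℂ) • (1 : Matrix n n ℂ)).IsHermitian := by
    refine IsHermitian.smul isHermitian_one ?_
    rw [isSelfAdjoint_iff, Complex.star_def, Complex.conj_ofReal]
  refine PosSemidef.of_dotProduct_mulVec_nonneg (hH.sub h1) fun x => ?_
  refine Complex.nonneg_iff.2 ⟨?_, ((hH.sub h1).im_star_dotProduct_mulVec_self x).symm⟩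
  rw [sub_mulVec, dotProduct_sub, smul_mulVec, one_mulVec, dotProduct_smul, Complex.sub_re,
    smul_eq_mul, Complex.re_ofReal_mul]
  linarith [h x]

/-- `sq_le_of_gain_le_quadratic` with the floor given as a quadratic-form bound. -/
theorem sq_le_of_gain_le_quadratic' {H O : Matrix n n ℂ} (hH : H.IsHermitian) (hO : O.IsHermitian)
    {β K : ℝ} (hβ : 0 < β) (hK : 0 < K)
    (hgain : ∀ h : ℝ, gain β H O h ≤ β * K * h ^ 2) {E : ℝ}
    (hE : ∀ x : n → ℂ, E * (star x ⬝ᵥ x).re ≤ (star x ⬝ᵥ H *ᵥ x).re) {v : n → ℂ}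
    (hv : star v ⬝ᵥ v = 1) :
    (star v ⬝ᵥ O *ᵥ v).re ^ 2 ≤
      4 * K * ((star v ⬝ᵥ H *ᵥ v).re - E + Real.log (Fintype.card n) / β) :=
  sq_le_of_gain_le_quadratic hH hO hβ hK hgain (posSemidef_sub_smul_one_of_forall hH hE) hv

end Abstract

/-! ## §B The crux's objects: sourced pressure of the Hubbard torus, large-`h` bound -/

section Torus

open scoped Matrix.Norms.L2Operator ComplexOrder

variable (L : ℕ) [NeZero L]

/-- The Hermitian `d`-wave pair source `O_L = Δ_d + Δ_dᴴ`, `Δ_d = pairField dWaveFormFactor L`. -/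
def pairSource : Matrix (Finset (Orb (FermionTorus 2 L))) (Finset (Orb (FermionTorus 2 L))) ℂ :=
  pairField dWaveFormFactor L + (pairField dWaveFormFactor L)ᴴ

/-- The sourced torus pressure `p̃_L(β,μ,U,h) = log Z_β(dWaveSourceTorus L U μ h) / (β L²)` — the
quantity of the crux (verbatim sub-expression of `TwSourcedInertness`). -/
def sourcedPressure (β U μ h : ℝ) : ℝ :=
  Real.log (partitionFn β (dWaveSourceTorus L U μ h)).re / (β * (L : ℝ) ^ 2)

theorem isHermitian_pairSource : (pairSource L).IsHermitian :=
  isHermitian_pairField_add_conjTranspose L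

omit [NeZero L] in
theorem isHermitian_hubbardTorusWith (U μ : ℝ) : (hubbardTorusWith 2 L 1 U μ).IsHermitian :=
  isHermitian_hamiltonianWith (G := fermionTorusGraph 2 L) 1 U μ

theorem dWaveSourceTorus_eq (U μ h : ℝ) :
    dWaveSourceTorus L U μ h = hubbardTorusWith 2 L 1 U μ - (h : ℂ) • pairSource L := rfl

/-- The crux's left-hand side is the abstract pressure gain divided by `β L²`. -/
theorem sourcedPressure_sub (β U μ h : ℝ) :
    sourcedPressure L β U μ h - sourcedPressure L β U μ 0 =
      gain β (hubbardTorusWith 2 L 1 U μ) (pairSource L) h / (β * (L : ℝ) ^ 2) := by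
  rw [sourcedPressure, sourcedPressure, dWaveSourceTorus_zero, gain, dWaveSourceTorus_eq, sub_div]

/-! ### Operator norm of the source: `‖Δ_d + Δ_dᴴ‖ ≤ 8√2 L²` -/

omit [NeZero L] in
theorem abs_dWaveFormFactor_le_one (e : Site 2) :
    |dWaveFormFactor e| ≤ 1 := by
  unfold dWaveFormFactor
  split_ifs <;> norm_num

omit [NeZero L] in
theorem sum_abs_dWaveFormFactor_le :
    ∑ e ∈ insert (0 : Site 2) unitSteps, |dWaveFormFactor e| ≤ 4 := by
  have h0 : (0 : Site 2) ∉ unitSteps := by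
    simp only [unitSteps, Finset.mem_insert, Finset.mem_singleton]; decide
  rw [Finset.sum_insert h0, dWaveFormFactor_zero, abs_zero, zero_add]
  calc ∑ e ∈ unitSteps, |dWaveFormFactor e| ≤ ∑ _e ∈ unitSteps, (1 : ℝ) :=
        Finset.sum_le_sum fun e _ => abs_dWaveFormFactor_le_one e
    _ = unitSteps.card := by rw [Finset.sum_const, nsmul_eq_mul, mul_one]
    _ ≤ 4 := by
        have : unitSteps.card ≤ 4 := by
          unfold unitSteps
          refine (Finset.card_insert_le _ _).trans ?_
          refine (Nat.succ_le_succ (Finset.card_insert_le _ _)).trans ?_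
          refine (Nat.succ_le_succ (Nat.succ_le_succ (Finset.card_insert_le _ _))).trans ?_
          rw [Finset.card_singleton]
        exact_mod_cast this

omit [NeZero L] in
theorem two_div_sqrt_two : (2 : ℝ) / Real.sqrt 2 = Real.sqrt 2 := by
  have hsqrt : (0 : ℝ) < Real.sqrt 2 := by positivity
  have h : Real.sqrt 2 * Real.sqrt 2 = 2 := Real.mul_self_sqrt zero_le_two
  rw [div_eq_iff (ne_of_gt hsqrt)]
  linarith [h]

omit [NeZero L] in
/-- A product of two annihilation operators has norm `≤ 1`. -/
theorem norm_annihilation_mul_le (o o' : Orb (FermionTorus 2 L)) :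
    ‖(annihilation o : Matrix (Finset (Orb (FermionTorus 2 L))) (Finset (Orb (FermionTorus 2 L))) ℂ) *
        annihilation o'‖ ≤ 1 := by
  have h1 := norm_annihilation_le_one (ι := Orb (FermionTorus 2 L)) o
  have h2 := norm_annihilation_le_one (ι := Orb (FermionTorus 2 L)) o'
  exact (norm_mul_le _ _).trans (mul_le_one₀ h1 (norm_nonneg _) h2)

/-- `‖P_x‖ ≤ (Σ_e |g e|) · √2` for the local pair operator with form factor `g`. -/
theorem norm_localPair_le (g : Site 2 → ℝ) (x : TorusSite 2 L) :
    ‖localPair g L x‖ ≤ (∑ e ∈ insert (0 : Site 2) unitSteps, |g e|) * Real.sqrt 2 := by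
  have hsqrt : (0 : ℝ) < Real.sqrt 2 := by positivity
  unfold localPair
  refine (norm_sum_le _ _).trans ?_
  rw [Finset.sum_mul]
  refine Finset.sum_le_sum fun e _ => ?_
  set A := (annihilation (orb (FermionTorus.ofTorusSite x) 0) *
      annihilation (orb (FermionTorus.ofTorusSite (x + Torus.proj L e)) 1) :
    Matrix (Finset (Orb (FermionTorus 2 L))) (Finset (Orb (FermionTorus 2 L))) ℂ) with hA
  set B := (annihilation (orb (FermionTorus.ofTorusSite x) 1) *
      annihilation (orb (FermionTorus.ofTorusSite (x + Torus.proj L e)) 0) :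
    Matrix (Finset (Orb (FermionTorus 2 L))) (Finset (Orb (FermionTorus 2 L))) ℂ) with hB
  have hAB : ‖A - B‖ ≤ 2 := by
    refine (norm_sub_le _ _).trans ?_
    have h1 : ‖A‖ ≤ 1 := norm_annihilation_mul_le L _ _
    have h2 : ‖B‖ ≤ 1 := norm_annihilation_mul_le L _ _
    linarith
  refine (norm_smul_le _ _).trans ?_
  rw [Complex.norm_real, Real.norm_eq_abs, abs_div, abs_of_pos hsqrt]
  calc |g e| / Real.sqrt 2 * ‖A - B‖ ≤ |g e| / Real.sqrt 2 * 2 :=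
        mul_le_mul_of_nonneg_left hAB (div_nonneg (abs_nonneg _) hsqrt.le)
    _ = |g e| * Real.sqrt 2 := by
        rw [div_mul_eq_mul_div, mul_div_assoc, two_div_sqrt_two]

/-- `‖P_x‖ ≤ 4√2` for the local `d`-wave pair operator. -/
theorem norm_localPair_dWave_le (x : TorusSite 2 L) :
    ‖localPair dWaveFormFactor L x‖ ≤ 4 * Real.sqrt 2 := by
  refine (norm_localPair_le L dWaveFormFactor x).trans ?_
  have hsqrt : (0 : ℝ) ≤ Real.sqrt 2 := Real.sqrt_nonneg _
  exact mul_le_mul_of_nonneg_right sum_abs_dWaveFormFactor_le hsqrt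

theorem card_torusSite : (Fintype.card (TorusSite 2 L) : ℝ) = (L : ℝ) ^ 2 := by
  rw [Fintype.card_pi, prod_const, ZMod.card, card_univ, Fintype.card_fin]
  push_cast
  ring

/-- `‖Δ_d‖ ≤ 4√2 L²`. -/
theorem norm_pairField_dWave_le :
    ‖pairField dWaveFormFactor L‖ ≤ 4 * Real.sqrt 2 * (L : ℝ) ^ 2 := by
  unfold pairField
  refine (norm_sum_le _ _).trans ?_
  calc ∑ x : TorusSite 2 L, ‖localPair dWaveFormFactor L x‖
        ≤ ∑ _x : TorusSite 2 L, 4 * Real.sqrt 2 :=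
          Finset.sum_le_sum fun x _ => norm_localPair_dWave_le L x
    _ = 4 * Real.sqrt 2 * (L : ℝ) ^ 2 := by
          rw [Finset.sum_const, card_univ, nsmul_eq_mul, card_torusSite]; ring

/-- **`‖Δ_d + Δ_dᴴ‖ ≤ 8√2 L²`** — the constant `8√2` of the crux's docstring. -/
theorem norm_pairSource_le : ‖pairSource L‖ ≤ 8 * Real.sqrt 2 * (L : ℝ) ^ 2 := by
  unfold pairSource
  refine (norm_add_le _ _).trans ?_
  rw [Matrix.l2_opNorm_conjTranspose]
  have h := norm_pairField_dWave_le L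
  linarith

/-- **Large sources are automatic for the crux**: for every `L`, `U`, `μ`, `β > 0` and real `h`,
`p̃_L(β,μ,U,h) − p̃_L(β,μ,U,0) ≤ 8√2 |h|`. Hence the crux's bound `C(1+log β)h²` holds for free
whenever `|h| ≥ 8√2 / (C (1 + log β))`; its content is the window `|h| < 8√2/(C(1+log β))`. -/
theorem sourcedPressure_sub_le_linear (U μ : ℝ) {β : ℝ} (hβ : 0 < β) (h : ℝ) :
    sourcedPressure L β U μ h - sourcedPressure L β U μ 0 ≤ 8 * Real.sqrt 2 * |h| := by
  rw [sourcedPressure_sub]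
  have hL : (0 : ℝ) < (L : ℝ) ^ 2 := by
    have : (0 : ℝ) < (L : ℝ) := by exact_mod_cast Nat.pos_of_ne_zero (NeZero.ne L)
    positivity
  rw [div_le_iff₀ (mul_pos hβ hL)]
  have h1 := gain_le_mul_norm (isHermitian_hubbardTorusWith L U μ) (isHermitian_pairSource L) hβ.le h
  have h2 := norm_pairSource_le L
  calc gain β (hubbardTorusWith 2 L 1 U μ) (pairSource L) h ≤ β * (|h| * ‖pairSource L‖) := h1
    _ ≤ β * (|h| * (8 * Real.sqrt 2 * (L : ℝ) ^ 2)) := by gcongr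
    _ = 8 * Real.sqrt 2 * |h| * (β * (L : ℝ) ^ 2) := by ring

/-- The crux's bound is automatic outside the window `|h| < 8√2 / (C(1 + log β))`. -/
theorem sourcedPressure_sub_le_of_large_h (U μ : ℝ) {β C : ℝ} (hβ : 0 < β)
    {h : ℝ} (hh : 8 * Real.sqrt 2 ≤ C * (1 + Real.log β) * |h|) :
    sourcedPressure L β U μ h - sourcedPressure L β U μ 0 ≤ C * (1 + Real.log β) * h ^ 2 := by
  refine (sourcedPressure_sub_le_linear L U μ hβ h).trans ?_
  calc 8 * Real.sqrt 2 * |h| ≤ C * (1 + Real.log β) * |h| * |h| :=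
        mul_le_mul_of_nonneg_right hh (abs_nonneg h)
    _ = C * (1 + Real.log β) * h ^ 2 := by rw [mul_assoc, ← sq, sq_abs]

/-! ### Dimension bookkeeping: `log dim Fock = L² log 4` -/

omit [NeZero L] in
theorem card_fock : Fintype.card (Finset (Orb (FermionTorus 2 L))) = 2 ^ (2 * L ^ 2) := by
  rw [Fintype.card_finset, card_orb]
  congr 1
  simp [FermionTorus, Fintype.card_lex]

omit [NeZero L] in
theorem log_card_fock :
    Real.log (Fintype.card (Finset (Orb (FermionTorus 2 L)))) = (L : ℝ) ^ 2 * Real.log 4 := by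
  rw [card_fock]
  push_cast
  rw [Real.log_pow, show (4 : ℝ) = 2 ^ 2 by norm_num, Real.log_pow]
  push_cast
  ring

end Torus

/-! ## §C A `T = 0` shadow of the crux: inertness caps the pair amplitude of every low-energy
GC state (the tower bound). This is a CONSEQUENCE of `TwSourcedInertness`, recorded as the
cheapest refutation target: any low-energy state of `hubbardTorusWith 2 L 1 U μ` with `d`-wave
pair amplitude `|Re⟨v,(Δ+Δᴴ)v⟩|/L² ≫ √(C(1+a/U)) e^{-a/(2U)}` would kill the crux. -/

section Tower

open scoped Matrix.Norms.L2Operator ComplexOrder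

/-- **GC tower bound** (consequence of the crux): in the crux's regime, for every energy floor
`E ≤ H := hubbardTorusWith 2 L 1 U μ` and every unit vector `v`,
`(Re⟨v,(Δ_d+Δ_dᴴ)v⟩/L²)² ≤ 4C(1+log β)·((Re⟨v,Hv⟩ − E)/L² + log 4/β)`. -/
def TwGcTowerBound : Prop :=
  ∀ μ₁ μ₂ : ℝ, -4 < μ₁ → μ₁ ≤ μ₂ → μ₂ < 0 → ∃ U₀ a C : ℝ, 0 < U₀ ∧ 0 < a ∧ 0 < C ∧
    ∀ U : ℝ, 0 < U → U ≤ U₀ → ∀ β : ℝ, 1 ≤ β → β ≤ Real.exp (a / U) → ∀ μ ∈ Set.Icc μ₁ μ₂,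
      ∃ L₀ : ℕ, ∀ (L : ℕ) [NeZero L], L₀ ≤ L →
        ∀ E : ℝ, (hubbardTorusWith 2 L 1 U μ - (E : ℂ) • 1).PosSemidef →
        ∀ v : Fock (Orb (FermionTorus 2 L)), star v ⬝ᵥ v = 1 →
          ((star v ⬝ᵥ pairSource L *ᵥ v).re / (L : ℝ) ^ 2) ^ 2 ≤
            4 * (C * (1 + Real.log β)) *
              (((star v ⬝ᵥ hubbardTorusWith 2 L 1 U μ *ᵥ v).re - E) / (L : ℝ) ^ 2 +
                Real.log 4 / β)

/-- From the crux's inequality at one `(β, L, U, μ)` to the extensive quadratic gain bound. -/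
theorem gain_le_of_crux (L : ℕ) [NeZero L] {β U μ C : ℝ} (hβ : 0 < β)
    (hcrux : ∀ h : ℝ, sourcedPressure L β U μ h - sourcedPressure L β U μ 0 ≤
      C * (1 + Real.log β) * h ^ 2) (h : ℝ) :
    gain β (hubbardTorusWith 2 L 1 U μ) (pairSource L) h ≤
      β * (C * (1 + Real.log β) * (L : ℝ) ^ 2) * h ^ 2 := by
  have hL : (0 : ℝ) < (L : ℝ) ^ 2 := by
    have : (0 : ℝ) < (L : ℝ) := by exact_mod_cast Nat.pos_of_ne_zero (NeZero.ne L)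
    positivity
  have h1 := hcrux h
  rw [sourcedPressure_sub, div_le_iff₀ (mul_pos hβ hL)] at h1
  linarith

/-- **The crux implies the GC tower bound.** -/
theorem towerBound_of_inertness
    (hI : Summit.HubbardSuperconductivity.HubbardSuperconductivity.Theses.ThermalWedge.TwSourcedInertness) :
    TwGcTowerBound := by
  intro μ₁ μ₂ h1 h2 h3
  obtain ⟨U₀, a, C, hU₀, ha, hC, hmain⟩ := hI μ₁ μ₂ h1 h2 h3
  refine ⟨U₀, a, C, hU₀, ha, hC, ?_⟩
  intro U hU hUU₀ β hβ hβa μ hμ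
  obtain ⟨L₀, hL⟩ := hmain U hU hUU₀ β hβ hβa μ hμ
  refine ⟨L₀, fun L _ hLL E hE v hv => ?_⟩
  have hβ0 : 0 < β := by linarith
  have hL2 : (0 : ℝ) < (L : ℝ) ^ 2 := by
    have : (0 : ℝ) < (L : ℝ) := by exact_mod_cast Nat.pos_of_ne_zero (NeZero.ne L)
    positivity
  have hlog : 0 < 1 + Real.log β := by
    have := Real.log_nonneg hβ
    linarith
  have hK : 0 < C * (1 + Real.log β) * (L : ℝ) ^ 2 := by positivity
  have hcrux : ∀ h : ℝ, sourcedPressure L β U μ h - sourcedPressure L β U μ 0 ≤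
      C * (1 + Real.log β) * h ^ 2 := fun h => hL L hLL h
  have key := sq_le_of_gain_le_quadratic (isHermitian_hubbardTorusWith L U μ)
    (isHermitian_pairSource L) hβ0 hK (gain_le_of_crux L hβ0 hcrux) hE hv
  rw [log_card_fock] at key
  set m := (star v ⬝ᵥ pairSource L *ᵥ v).re
  set R := (star v ⬝ᵥ hubbardTorusWith 2 L 1 U μ *ᵥ v).re
  have hgoal : (m / (L : ℝ) ^ 2) ^ 2 =
      m ^ 2 / ((L : ℝ) ^ 2 * (L : ℝ) ^ 2) := by rw [div_pow]; ring
  rw [hgoal, div_le_iff₀ (mul_pos hL2 hL2)]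
  calc m ^ 2 ≤ 4 * (C * (1 + Real.log β) * (L : ℝ) ^ 2) *
        (R - E + (L : ℝ) ^ 2 * Real.log 4 / β) := key
    _ = 4 * (C * (1 + Real.log β)) * ((R - E) / (L : ℝ) ^ 2 + Real.log 4 / β) *
        ((L : ℝ) ^ 2 * (L : ℝ) ^ 2) := by
          have hL0 : (L : ℝ) ≠ 0 := by exact_mod_cast NeZero.ne L
          field_simp

end Tower



/-! ## §D.1 Bridge: momentum modes are smeared modes of an orthonormal family -/

section Bridge

open scoped Matrix.Norms.L2Operator ComplexOrder

variable {d L : ℕ} [NeZero L]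

/-- The normalised plane-wave mode function of `(k, σ)`. -/
def modeFun (k : TorusSite d L) (σ : Fin 2) : Orb (FermionTorus d L) → ℂ :=
  fun o => torusFourierWeight d L * planeWave k σ o

theorem momentumAnnihilation_eq_annihilate (k : TorusSite d L) (σ : Fin 2) :
    momentumAnnihilation k σ = annihilate (modeFun k σ) := by
  rw [momentumAnnihilation_eq_sum_planeWave, annihilate]
  refine Finset.sum_congr rfl fun o _ => ?_
  simp only [modeFun, star_mul', star_torusFourierWeight, Complex.star_def]

theorem momentumCreation_eq_create (k : TorusSite d L) (σ : Fin 2) :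
    momentumCreation k σ = create (modeFun k σ) := by
  rw [momentumCreation, momentumAnnihilation_eq_annihilate, annihilate_conjTranspose]

theorem momentumNumber_eq_numberMode (k : TorusSite d L) (σ : Fin 2) :
    momentumNumber k σ = numberMode (modeFun k σ) := by
  rw [momentumNumber, momentumCreation_eq_create, momentumAnnihilation_eq_annihilate, numberMode]

/-- Orthonormality of the plane-wave modes, read off from the two forms of the mixed CAR. -/
theorem modeFun_orthonormal (k k' : TorusSite d L) (σ σ' : Fin 2) :
    star (modeFun k σ) ⬝ᵥ modeFun k' σ' = if k = k' ∧ σ = σ' then 1 else 0 := by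
  have h1 := annihilate_mul_create_add (modeFun k σ) (modeFun k' σ')
  have h2 := momentumAnnihilation_mul_momentumCreation_add k k' σ σ'
  rw [momentumAnnihilation_eq_annihilate, momentumCreation_eq_create, h1] at h2
  have h3 := congrFun (congrFun h2 ∅) ∅
  simp only [Matrix.smul_apply, Matrix.one_apply_eq, smul_eq_mul, mul_one] at h3
  rw [h3]
  split_ifs <;> simp

theorem modeFun_unit (k : TorusSite d L) (σ : Fin 2) : star (modeFun k σ) ⬝ᵥ modeFun k σ = 1 := by
  rw [modeFun_orthonormal]; simp

theorem modeFun_orthogonal {k k' : TorusSite d L} {σ σ' : Fin 2} (h : k ≠ k' ∨ σ ≠ σ') :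
    star (modeFun k σ) ⬝ᵥ modeFun k' σ' = 0 := by
  rw [modeFun_orthonormal, if_neg]
  rintro ⟨rfl, rfl⟩
  rcases h with h | h <;> exact h rfl

end Bridge

/-! ## §D.2 Abstract two-level shell states built from orthonormal smeared modes -/

section ShellStates

open scoped Matrix.Norms.L2Operator ComplexOrder

variable {ι : Type*} [LinearOrder ι] [Fintype ι]

omit [Fintype ι] in
theorem isNParticle_vacuum' : IsNParticle 0 (vacuum : Fock ι) := by
  intro s hs
  have hne : s ≠ ∅ := fun h => hs (by rw [h, Finset.card_empty])
  simp [vacuum, hne]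

theorem star_vacuum_dotProduct_vacuum : star (vacuum : Fock ι) ⬝ᵥ vacuum = 1 := by
  simp [vacuum, dotProduct, Pi.single_apply]

theorem annihilate_mulVec_vacuum (g : ι → ℂ) : annihilate g *ᵥ (vacuum : Fock ι) = 0 :=
  isNParticle_vacuum'.annihilate_mulVec_zero g

theorem numberMode_mulVec_vacuum (g : ι → ℂ) : numberMode g *ᵥ (vacuum : Fock ι) = 0 := by
  rw [numberMode, ← mulVec_mulVec, annihilate_mulVec_vacuum, mulVec_zero]

/-- `c†(f) c†(f) = 0`. -/
theorem create_mul_self (f : ι → ℂ) : create f * create f = 0 := by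
  rw [← annihilate_conjTranspose, ← conjTranspose_mul, annihilate_mul_self, conjTranspose_zero]

/-- `n(f) c†(f) = c†(f)` for a unit mode. -/
theorem numberMode_mul_create_self {f : ι → ℂ} (h : star f ⬝ᵥ f = 1) :
    numberMode f * create f = create f := by
  rw [numberMode, mul_assoc, annihilate_mul_create_of_unit h, mul_sub, mul_one, ← mul_assoc,
    create_mul_self, zero_mul, sub_zero]

/-- `n(g) c†(f) = c†(f) n(g)` for `f ⊥ g`. -/
theorem numberMode_mul_create_of_orthogonal {f g : ι → ℂ} (h : star f ⬝ᵥ g = 0) :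
    numberMode g * create f = create f * numberMode g :=
  (create_mul_numberMode_of_orthogonal h).symm

theorem numberMode_mulVec_create_self {f : ι → ℂ} (h : star f ⬝ᵥ f = 1) (w : Fock ι) :
    numberMode f *ᵥ (create f *ᵥ w) = create f *ᵥ w := by
  rw [mulVec_mulVec, numberMode_mul_create_self h]

theorem numberMode_mulVec_create_of_orthogonal {f g : ι → ℂ} (h : star f ⬝ᵥ g = 0) (w : Fock ι) :
    numberMode g *ᵥ (create f *ᵥ w) = create f *ᵥ (numberMode g *ᵥ w) := by
  rw [mulVec_mulVec, numberMode_mul_create_of_orthogonal h, ← mulVec_mulVec]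

/-- `c(g) c†(f) v = - c†(f) c(g) v` for `g ⊥ f`. -/
theorem annihilate_mulVec_create_mulVec {f g : ι → ℂ} (h : star g ⬝ᵥ f = 0) (v : Fock ι) :
    annihilate g *ᵥ (create f *ᵥ v) = -(create f *ᵥ (annihilate g *ᵥ v)) := by
  rw [mulVec_mulVec, annihilate_mul_create_of_orthogonal h, neg_mulVec, ← mulVec_mulVec]

omit [LinearOrder ι] in
/-- Orthogonality of different particle-number sectors. -/
theorem IsNParticle.dotProduct_eq_zero {m n : ℕ} {φ ψ : Fock ι} (hφ : IsNParticle m φ)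
    (hψ : IsNParticle n ψ) (hmn : m ≠ n) : star φ ⬝ᵥ ψ = 0 := by
  unfold dotProduct
  refine Finset.sum_eq_zero fun s _ => ?_
  by_cases hs : s.card = m
  · rw [hψ s (by rw [hs]; exact hmn), mul_zero]
  · rw [Pi.star_apply, hφ s hs, star_zero, zero_mul]

omit [LinearOrder ι] in
/-- `⟨A x, y⟩ = ⟨x, Aᴴ y⟩` (re-export for convenience). -/
theorem star_dotProduct_conjTranspose_mulVec (A : Matrix (Finset ι) (Finset ι) ℂ) (x y : Fock ι) :
    star x ⬝ᵥ (Aᴴ *ᵥ y) = star (star y ⬝ᵥ (A *ᵥ x)) := by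
  rw [← star_mulVec_dotProduct, ← star_dotProduct_star, star_star]

end ShellStates

/-! ## §D.3–§D.7 (cycle 1, REMOVED in cycle 2 except for the fragments below): the explicit `3 × 3`
shell state `v = (c†_{0↑}c†_{0↓}|∅⟩ + c†_{q↑}c†_{−q↓}c†_{0↑}c†_{0↓}|∅⟩)/√2`, its energy `−6 + 9U` and
pair amplitude `3√2` — superseded by the general-`L` Fermi-sea witness (§D.9–§D.11) and by the exact
free formula (§H–§I); removed to respect the 200 kB work-file cap. Kept: `cos(2π/3)`, the generic
quadratic-form lemmas for number operators, the generic interaction bounds (§D.5), `Δ_d` lowers `N`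
by two, `(√2)⁻¹(√2)⁻¹ = 1/2`. -/

theorem cos_two_pi_div_three : Real.cos (2 * Real.pi * 1 / 3) = -1 / 2 := by
  rw [show 2 * Real.pi * 1 / 3 = Real.pi - Real.pi / 3 by ring, Real.cos_pi_sub, Real.cos_pi_div_three]
  ring


/-! ### The floor `K⁰ ≥ -6` as a quadratic-form bound (no identity matrix is mentioned, to
stay clear of the two `DecidableEq` instance paths on the concrete orbital type) -/

section QuadraticForms

open scoped Matrix.Norms.L2Operator ComplexOrder

variable {ι : Type*} [LinearOrder ι] [Fintype ι]

/-- `⟨y, n(f) y⟩ = ‖c(f) y‖²` is real and nonnegative. -/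
theorem star_dotProduct_numberMode_mulVec (f : ι → ℂ) (y : Fock ι) :
    star y ⬝ᵥ (numberMode f *ᵥ y) = ((normSq (annihilate f *ᵥ y) : ℝ) : ℂ) := by
  rw [numberMode, ← mulVec_mulVec, ← star_dotProduct_self_eq_normSq, star_mulVec_dotProduct,
    annihilate_conjTranspose]

theorem re_numberMode_nonneg (f : ι → ℂ) (y : Fock ι) :
    0 ≤ (star y ⬝ᵥ (numberMode f *ᵥ y)).re := by
  rw [star_dotProduct_numberMode_mulVec, Complex.ofReal_re]; exact normSq_nonneg _

/-- `⟨y, n(f) y⟩ ≤ ⟨y, y⟩` for a unit mode (`1 - n(f) = c(f) c†(f) ≥ 0`). -/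
theorem re_numberMode_le {f : ι → ℂ} (hf : star f ⬝ᵥ f = 1) (y : Fock ι) :
    (star y ⬝ᵥ (numberMode f *ᵥ y)).re ≤ (star y ⬝ᵥ y).re := by
  have h1 : star y ⬝ᵥ ((annihilate f * create f) *ᵥ y) =
      ((normSq (create f *ᵥ y) : ℝ) : ℂ) := by
    rw [← mulVec_mulVec, ← star_dotProduct_self_eq_normSq, star_mulVec_dotProduct,
      create_conjTranspose]
  have h2 : star y ⬝ᵥ ((annihilate f * create f) *ᵥ y) =
      star y ⬝ᵥ y - star y ⬝ᵥ (numberMode f *ᵥ y) := by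
    rw [annihilate_mul_create_of_unit hf, sub_mulVec, one_mulVec, dotProduct_sub, numberMode]
  have h3 : 0 ≤ (star y ⬝ᵥ y - star y ⬝ᵥ (numberMode f *ᵥ y)).re := by
    rw [← h2, h1, Complex.ofReal_re]; exact normSq_nonneg _
  rw [Complex.sub_re] at h3
  linarith

end QuadraticForms


/-! ## §D.5 The Hubbard interaction on the `3 × 3` torus: `0 ≤ ⟨y, W y⟩ ≤ 9 ⟨y, y⟩` -/

section Interaction

open scoped Matrix.Norms.L2Operator ComplexOrder

variable {Λ : Type*} [LinearOrder Λ] [Fintype Λ]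

/-- The on-site basis mode `e_o`. -/
def basisMode (o : Orb Λ) : Orb Λ → ℂ := Pi.single o 1

theorem annihilate_basisMode (o : Orb Λ) : annihilate (basisMode o) = annihilation o := by
  rw [annihilate, Finset.sum_eq_single o]
  · simp [basisMode]
  · intro i _ hi
    simp [basisMode, Pi.single_eq_of_ne hi]
  · exact fun h => absurd (Finset.mem_univ o) h

theorem numberOp_eq_numberMode (x : Λ) (σ : Fin 2) :
    numberOp x σ = numberMode (basisMode (orb x σ)) := by
  rw [numberOp, numberMode, ← annihilate_conjTranspose, annihilate_basisMode, creation]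

theorem basisMode_unit (o : Orb Λ) : star (basisMode o) ⬝ᵥ basisMode o = 1 := by
  simp [basisMode, dotProduct, Pi.single_apply]

theorem basisMode_orthogonal {o o' : Orb Λ} (h : o ≠ o') :
    star (basisMode o) ⬝ᵥ basisMode o' = 0 := by
  have h' : o' ≠ o := fun e => h e.symm
  simp [basisMode, dotProduct, Pi.single_apply, h']

/-- The doublon projector `P_x = n_{x↑} n_{x↓}` satisfies `P_xᴴ P_x = P_x`. -/
theorem doublon_conjTranspose_mul_self (x : Λ) :
    (numberOp x 0 * numberOp x 1)ᴴ * (numberOp x 0 * numberOp x 1) = numberOp x 0 * numberOp x 1 := by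
  have hne : orb x (0 : Fin 2) ≠ orb x 1 := by simp [orb]
  have horth : star (basisMode (orb x (0 : Fin 2))) ⬝ᵥ basisMode (orb x 1) = 0 :=
    basisMode_orthogonal hne
  rw [numberOp_eq_numberMode, numberOp_eq_numberMode]
  set n0 := numberMode (basisMode (orb x (0 : Fin 2)))
  set n1 := numberMode (basisMode (orb x (1 : Fin 2)))
  have hcomm : n0 * n1 = n1 * n0 := numberMode_mul_numberMode_of_orthogonal horth
  have h0 : n0 * n0 = n0 := numberMode_mul_self (basisMode_unit _)
  have h1 : n1 * n1 = n1 := numberMode_mul_self (basisMode_unit _)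
  rw [conjTranspose_mul, numberMode_conjTranspose, numberMode_conjTranspose, ← hcomm, mul_assoc,
    ← mul_assoc n1 n0 n1, ← hcomm, mul_assoc, h1, ← mul_assoc, h0]

/-- `0 ≤ ⟨y, n_{x↑} n_{x↓} y⟩`. -/
theorem re_doublon_nonneg (x : Λ) (y : Fock (Orb Λ)) :
    0 ≤ (star y ⬝ᵥ ((numberOp x 0 * numberOp x 1) *ᵥ y)).re := by
  rw [← doublon_conjTranspose_mul_self, ← mulVec_mulVec, ← star_mulVec_dotProduct,
    star_dotProduct_self_eq_normSq, Complex.ofReal_re]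
  exact normSq_nonneg _

/-- `⟨y, n_{x↑} n_{x↓} y⟩ ≤ ⟨y, n_{x↑} y⟩ ≤ ⟨y, y⟩`. -/
theorem re_doublon_le (x : Λ) (y : Fock (Orb Λ)) :
    (star y ⬝ᵥ ((numberOp x 0 * numberOp x 1) *ᵥ y)).re ≤ (star y ⬝ᵥ y).re := by
  -- ⟨y, n0 n1 y⟩ = ⟨y, n1 n0 n1 y⟩ = ⟨n1 y, n0 (n1 y)⟩ ≤ ⟨n1 y, n1 y⟩ = ⟨y, n1 y⟩ ≤ ⟨y, y⟩
  have hne : orb x (0 : Fin 2) ≠ orb x 1 := by simp [orb]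
  have horth : star (basisMode (orb x (0 : Fin 2))) ⬝ᵥ basisMode (orb x 1) = 0 :=
    basisMode_orthogonal hne
  rw [numberOp_eq_numberMode, numberOp_eq_numberMode]
  set n0 := numberMode (basisMode (orb x (0 : Fin 2)))
  set n1 := numberMode (basisMode (orb x (1 : Fin 2)))
  have hcomm : n0 * n1 = n1 * n0 := numberMode_mul_numberMode_of_orthogonal horth
  have h1 : n1 * n1 = n1 := numberMode_mul_self (basisMode_unit _)
  have hn1 : n1ᴴ = n1 := numberMode_conjTranspose _
  have key : n0 * n1 = n1ᴴ * (n0 * n1) := by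
    rw [hn1, ← mul_assoc, ← hcomm, mul_assoc, h1]
  have step1 : (star y ⬝ᵥ ((n0 * n1) *ᵥ y)).re ≤ (star (n1 *ᵥ y) ⬝ᵥ (n1 *ᵥ y)).re := by
    rw [key, ← mulVec_mulVec, ← star_mulVec_dotProduct, ← mulVec_mulVec]
    exact re_numberMode_le (basisMode_unit _) _
  have step2 : (star (n1 *ᵥ y) ⬝ᵥ (n1 *ᵥ y)).re ≤ (star y ⬝ᵥ y).re := by
    rw [star_mulVec_dotProduct, hn1, mulVec_mulVec, h1]
    exact re_numberMode_le (basisMode_unit _) _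
  exact step1.trans step2

/-- The Hubbard interaction `W = Σ_x n_{x↑} n_{x↓}`. -/
def interactionW (Λ : Type*) [LinearOrder Λ] [Fintype Λ] : Matrix (Finset (Orb Λ)) (Finset (Orb Λ)) ℂ :=
  ∑ x : Λ, numberOp x 0 * numberOp x 1

theorem re_interactionW_nonneg (y : Fock (Orb Λ)) :
    0 ≤ (star y ⬝ᵥ (interactionW Λ *ᵥ y)).re := by
  rw [interactionW, sum_mulVec, dotProduct_sum, Complex.re_sum]
  exact Finset.sum_nonneg fun x _ => re_doublon_nonneg x y

theorem re_interactionW_le (y : Fock (Orb Λ)) :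
    (star y ⬝ᵥ (interactionW Λ *ᵥ y)).re ≤ Fintype.card Λ * (star y ⬝ᵥ y).re := by
  rw [interactionW, sum_mulVec, dotProduct_sum, Complex.re_sum]
  calc ∑ x : Λ, (star y ⬝ᵥ ((numberOp x 0 * numberOp x 1) *ᵥ y)).re
      ≤ ∑ _x : Λ, (star y ⬝ᵥ y).re := Finset.sum_le_sum fun x _ => re_doublon_le x y
    _ = Fintype.card Λ * (star y ⬝ᵥ y).re := by
        rw [Finset.sum_const, Finset.card_univ, nsmul_eq_mul]

/-- `H(t,U) − μN = (H(t,0) − μN) + U · W`. -/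
theorem hamiltonianWith_eq_add_interaction (G : SimpleGraph Λ) [DecidableRel G.Adj] (t U μ : ℝ) :
    hamiltonianWith G t U μ = hamiltonianWith G t 0 μ + (U : ℂ) • interactionW Λ := by
  simp only [hamiltonianWith_eq, hamiltonian, interactionW, Complex.ofReal_zero, zero_smul, add_zero]
  abel

end Interaction

/-! ## §D.6 The `d`-wave pair amplitude of the shell state: `Re⟨v, (Δ_d + Δ_dᴴ) v⟩ = 3√2` -/

section PairAmplitude

open scoped Matrix.Norms.L2Operator ComplexOrder

/-- `Δ_d` lowers the particle number by two (any `L`). -/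
theorem isNParticle_pairField_dWave_mulVec {L : ℕ} [NeZero L] {N : ℕ}
    {ψ : Fock (Orb (FermionTorus 2 L))} (hψ : IsNParticle (N + 2) ψ) :
    IsNParticle N (pairField dWaveFormFactor L *ᵥ ψ) := by
  rw [pairField_dWave_eq_smul_pairOperator, neg_mulVec, smul_mulVec, pairOperator, sum_mulVec]
  refine (nParticleSubmodule N).neg_mem ((nParticleSubmodule N).smul_mem _
    ((nParticleSubmodule N).sum_mem fun k _ => ?_))
  rw [smul_mulVec]
  exact (nParticleSubmodule N).smul_mem _ (hψ.pairMode_mulVec k)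

end PairAmplitude

theorem sqrt_two_inv_mul_self : (Real.sqrt 2)⁻¹ * (Real.sqrt 2)⁻¹ = (1 / 2 : ℝ) := by
  rw [← mul_inv, Real.mul_self_sqrt zero_le_two, one_div]


/-! ## §D.8 LOAD-BEARING: "eventually in `L`" cannot be dropped from the crux

`TwSourcedInertnessAllL` is the crux with `∃ L₀, ∀ L ≥ L₀` replaced by `∀ L ≥ 3` (every
non-degenerate torus). It is FALSE: at `L = 3`, `μ = -1 ∈ (-4,0)` the free torus has the open shell
`ε = -1` (`k = (±1,0), (0,±1)`), the shell superposition `v = (v_A + b_q† v_A)/√2` is a ground vector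
of `H⁰ − μN` with `d`-wave pair amplitude `Re⟨v,(Δ_d+Δ_dᴴ)v⟩ = 3√2`, so by the entropy sandwich
`p̃_3(h) − p̃_3(0) ≥ (√2/3)h − U − log 4/β`, which beats `C(1+log β)h²` at `h* = √2/(6C(1+log β))`
once `β` is large and `U` small (both allowed: the refuter picks `β := (72 C log 4 + 1)²`, then
`U := min(U₀, a/log β, 1/(72 C(1+log β)))`). Any proof of the crux must therefore USE the freedom
`L₀ = L₀(β, μ)`: finite-size shell degeneracies make `χ_L(β) ≳ β·m²/L²` whenever `μ` sits on a
level of the `L`-torus (for `μ = -1`: every `L ≡ 0 mod 3`), so `L₀(β,μ)` must grow with `β`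
(numerics: job j005055, `free_chi.py`). -/

section LoadBearing

open scoped Matrix.Norms.L2Operator ComplexOrder

/-- The crux with the finite-size threshold `L₀` dropped (all tori of side `≥ 3`). -/
def TwSourcedInertnessAllL : Prop :=
  ∀ μ₁ μ₂ : ℝ, -4 < μ₁ → μ₁ ≤ μ₂ → μ₂ < 0 → ∃ U₀ a C : ℝ, 0 < U₀ ∧ 0 < a ∧ 0 < C ∧
    ∀ U : ℝ, 0 < U → U ≤ U₀ → ∀ β : ℝ, 1 ≤ β → β ≤ Real.exp (a / U) → ∀ μ ∈ Set.Icc μ₁ μ₂,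
      ∀ (L : ℕ) [NeZero L], 3 ≤ L → ∀ h : ℝ,
        (Real.log (Matrix.partitionFn β (dWaveSourceTorus L U μ h)).re / (β * (L : ℝ) ^ 2)) -
          (Real.log (Matrix.partitionFn β (dWaveSourceTorus L U μ 0)).re / (β * (L : ℝ) ^ 2)) ≤
          C * (1 + Real.log β) * h ^ 2

/-- The crux trivially implies nothing about `TwSourcedInertnessAllL`; conversely
`TwSourcedInertnessAllL → TwSourcedInertness` (take `L₀ = 3`), recorded for orientation. -/
theorem twSourcedInertness_of_allL (H : TwSourcedInertnessAllL) :
    Summit.HubbardSuperconductivity.HubbardSuperconductivity.Theses.ThermalWedge.TwSourcedInertness := by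
  intro μ₁ μ₂ h1 h2 h3
  obtain ⟨U₀, a, C, hU₀, ha, hC, hmain⟩ := H μ₁ μ₂ h1 h2 h3
  refine ⟨U₀, a, C, hU₀, ha, hC, fun U hU hUU₀ β hβ hβa μ hμ => ⟨3, fun L _ hL h => ?_⟩⟩
  exact hmain U hU hUU₀ β hβ hβa μ hμ L hL h

end LoadBearing

/-! ## §D.9 Slater determinants (Fermi seas) over an orthonormal family of smeared modes

Generalises §D.2 from two to any number of filled modes: `slater φ l = c†(φ l₁) ⋯ c†(φ lₙ) |∅⟩` for a
duplicate-free list `l` of indices of an orthonormal family `φ`. Number operators act as indicators,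
the state is normalised and lives in the `|l|`-particle sector. -/

section Slater

open scoped Matrix.Norms.L2Operator ComplexOrder

variable {ι : Type*} [LinearOrder ι] [Fintype ι] {α : Type*} [DecidableEq α]
variable (φ : α → ι → ℂ)

/-- The Slater determinant `c†(φ a₁) c†(φ a₂) ⋯ c†(φ aₙ) |∅⟩` of the list `[a₁, …, aₙ]`. -/
def slater : List α → Fock ι
  | [] => vacuum
  | a :: l => create (φ a) *ᵥ slater l

omit [DecidableEq α] in
@[simp] theorem slater_nil : slater φ [] = (vacuum : Fock ι) := rfl

omit [DecidableEq α] in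
@[simp] theorem slater_cons (a : α) (l : List α) :
    slater φ (a :: l) = create (φ a) *ᵥ slater φ l := rfl

variable {φ}
variable (hφ : ∀ a b : α, star (φ a) ⬝ᵥ φ b = if a = b then 1 else 0)
include hφ

omit [LinearOrder ι] in
theorem orthonormalFamily_unit (a : α) : star (φ a) ⬝ᵥ φ a = 1 := by rw [hφ, if_pos rfl]

omit [LinearOrder ι] in
theorem orthonormalFamily_orthogonal {a b : α} (h : a ≠ b) : star (φ a) ⬝ᵥ φ b = 0 := by
  rw [hφ, if_neg h]

/-- A mode outside the list annihilates the Slater state. -/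
theorem annihilate_mulVec_slater {a : α} {l : List α} (ha : a ∉ l) :
    annihilate (φ a) *ᵥ slater φ l = 0 := by
  induction l with
  | nil => exact annihilate_mulVec_vacuum _
  | cons b l ih =>
    rw [List.mem_cons, not_or] at ha
    rw [slater_cons, annihilate_mulVec_create_mulVec (orthonormalFamily_orthogonal hφ ha.1), ih ha.2,
      mulVec_zero, neg_zero]

/-- The number operator of a listed mode fixes the (duplicate-free) Slater state. -/
theorem numberMode_mulVec_slater_of_mem {a : α} {l : List α} (hl : l.Nodup) (ha : a ∈ l) :
    numberMode (φ a) *ᵥ slater φ l = slater φ l := by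
  induction l with
  | nil => exact absurd ha List.not_mem_nil
  | cons b l ih =>
    rw [List.nodup_cons] at hl
    rw [slater_cons]
    by_cases hab : a = b
    · subst hab
      exact numberMode_mulVec_create_self (orthonormalFamily_unit hφ a) _
    · have ha' : a ∈ l := (List.mem_cons.mp ha).resolve_left hab
      rw [numberMode_mulVec_create_of_orthogonal (orthonormalFamily_orthogonal hφ (Ne.symm hab)),
        ih hl.2 ha']

/-- The number operator of an unlisted mode kills the Slater state. -/
theorem numberMode_mulVec_slater_of_not_mem {a : α} {l : List α} (ha : a ∉ l) :
    numberMode (φ a) *ᵥ slater φ l = 0 := by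
  rw [numberMode, ← mulVec_mulVec, annihilate_mulVec_slater hφ ha, mulVec_zero]

/-- Indicator form. -/
theorem numberMode_mulVec_slater {a : α} {l : List α} (hl : l.Nodup) :
    numberMode (φ a) *ᵥ slater φ l = if a ∈ l then slater φ l else 0 := by
  split_ifs with h
  · exact numberMode_mulVec_slater_of_mem hφ hl h
  · exact numberMode_mulVec_slater_of_not_mem hφ h

/-- Slater states of duplicate-free lists are normalised. -/
theorem star_slater_dotProduct_slater {l : List α} (hl : l.Nodup) :
    star (slater φ l) ⬝ᵥ slater φ l = 1 := by
  induction l with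
  | nil => exact star_vacuum_dotProduct_vacuum
  | cons b l ih =>
    rw [List.nodup_cons] at hl
    have h1 : star (slater φ (b :: l)) ⬝ᵥ slater φ (b :: l) =
        star (slater φ l) ⬝ᵥ ((annihilate (φ b) * create (φ b)) *ᵥ slater φ l) := by
      rw [slater_cons, star_mulVec_dotProduct, create_conjTranspose, mulVec_mulVec]
    rw [h1, annihilate_mul_create_of_unit (orthonormalFamily_unit hφ b), sub_mulVec, one_mulVec,
      dotProduct_sub, ← numberMode, numberMode_mulVec_slater_of_not_mem hφ hl.1, dotProduct_zero,
      sub_zero, ih hl.2]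

omit [DecidableEq α] hφ in
/-- Slater states of `n` modes lie in the `n`-particle sector. -/
theorem isNParticle_slater (l : List α) : IsNParticle l.length (slater φ l) := by
  induction l with
  | nil => exact isNParticle_vacuum'
  | cons b l ih => exact ih.create_mulVec _

/-- **A weighted number operator acts on a Slater state by the sum of the listed weights.** -/
theorem sum_smul_numberMode_mulVec_slater [Fintype α] (c : α → ℂ) {l : List α} (hl : l.Nodup) :
    (∑ a : α, c a • numberMode (φ a)) *ᵥ slater φ l = (∑ a ∈ l.toFinset, c a) • slater φ l := by
  rw [sum_mulVec]
  simp_rw [smul_mulVec, numberMode_mulVec_slater hφ hl, smul_ite, smul_zero]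
  rw [← Finset.sum_filter, Finset.sum_smul]
  congr 1
  ext a
  simp [List.mem_toFinset]

/-- Pair insertion: `c(φ b) c(φ a) c†(φ a) c†(φ b) v = v` for a Slater state `v` missing `a ≠ b`. -/
theorem pair_mulVec_slater {a b : α} {l : List α} (hab : a ≠ b) (ha : a ∉ l) (hb : b ∉ l) :
    (annihilate (φ b) * annihilate (φ a)) *ᵥ slater φ (a :: b :: l) = slater φ l := by
  have step1 : annihilate (φ a) *ᵥ slater φ (a :: b :: l) = slater φ (b :: l) := by
    rw [slater_cons, mulVec_mulVec, annihilate_mul_create_of_unit (orthonormalFamily_unit hφ a),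
      sub_mulVec, one_mulVec, ← mulVec_mulVec, slater_cons,
      annihilate_mulVec_create_mulVec (orthonormalFamily_orthogonal hφ hab),
      annihilate_mulVec_slater hφ ha, mulVec_zero, neg_zero, mulVec_zero, sub_zero]
  rw [← mulVec_mulVec, step1, slater_cons, mulVec_mulVec,
    annihilate_mul_create_of_unit (orthonormalFamily_unit hφ b), sub_mulVec, one_mulVec,
    ← mulVec_mulVec, annihilate_mulVec_slater hφ hb, mulVec_zero, sub_zero]

end Slater

/-! ## §D.10 The Fermi-sea shell witness on a general torus with a level at `μ = -1` -/

section FermiSea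

open scoped Matrix.Norms.L2Operator ComplexOrder

variable (L : ℕ) [NeZero L]

/-- Mode index type `(k, σ)` of the `L`-torus. -/
abbrev ModeIdx (L : ℕ) : Type := TorusSite 2 L × Fin 2

/-- The plane-wave family indexed by `(k, σ)`. -/
def φL (x : ModeIdx L) : Orb (FermionTorus 2 L) → ℂ := modeFun x.1 x.2

theorem φL_orthonormal (x y : ModeIdx L) :
    star (φL L x) ⬝ᵥ φL L y = if x = y then 1 else 0 := by
  rw [φL, φL, modeFun_orthonormal]
  congr 1
  simp [Prod.ext_iff]

/-- The free Fermi sea at `μ = -1`: all modes with `ε_L(k) + 1 < 0`, as a duplicate-free list. -/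
def seaList : List (ModeIdx L) :=
  (Finset.univ.filter fun x : ModeIdx L => torusBand L x.1 + 1 < 0).toList

theorem seaList_nodup : (seaList L).Nodup := Finset.nodup_toList _

theorem mem_seaList {x : ModeIdx L} : x ∈ seaList L ↔ torusBand L x.1 + 1 < 0 := by
  simp [seaList]

theorem seaList_toFinset :
    (seaList L).toFinset = Finset.univ.filter fun x : ModeIdx L => torusBand L x.1 + 1 < 0 := by
  simp [seaList, Finset.toList_toFinset]

/-- The Fermi-sea energy `E_F = Σ_{ε_k < -1, σ} (ε_k + 1)`. -/
def seaEnergy : ℝ := ∑ x ∈ Finset.univ.filter (fun x : ModeIdx L => torusBand L x.1 + 1 < 0),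
  (torusBand L x.1 + 1)

/-- The free grand-canonical Hamiltonian of the `L`-torus at `μ = -1`, in smeared-mode form. -/
theorem hubbardTorusWith_zero_eq_sum_numberMode (hL : 3 ≤ L) :
    hubbardTorusWith 2 L 1 0 (-1) =
      ∑ x : ModeIdx L, ((torusBand L x.1 + 1 : ℝ) : ℂ) • numberMode (φL L x) := by
  rw [hubbardTorusWith_zero_eq_sum_momentumNumber (d := 2) hL (-1), ← Finset.univ_product_univ,
    Finset.sum_product]
  refine Finset.sum_congr rfl fun k _ => Finset.sum_congr rfl fun σ _ => ?_
  rw [momentumNumber_eq_numberMode, sub_neg_eq_add]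
  rfl

/-- **Quadratic-form floor**: `H⁰_L − (−1)N ≥ E_F` on the `L`-torus (`L ≥ 3`). -/
theorem free_floor (hL : 3 ≤ L) (y : Fock (Orb (FermionTorus 2 L))) :
    seaEnergy L * (star y ⬝ᵥ y).re ≤ (star y ⬝ᵥ (hubbardTorusWith 2 L 1 0 (-1) *ᵥ y)).re := by
  rw [hubbardTorusWith_zero_eq_sum_numberMode L hL, sum_mulVec, dotProduct_sum, Complex.re_sum]
  have hterm : ∀ x : ModeIdx L,
      (if torusBand L x.1 + 1 < 0 then (torusBand L x.1 + 1) * (star y ⬝ᵥ y).re else 0) ≤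
        (star y ⬝ᵥ ((((torusBand L x.1 + 1 : ℝ) : ℂ) • numberMode (φL L x)) *ᵥ y)).re := by
    intro x
    rw [smul_mulVec, dotProduct_smul, smul_eq_mul, Complex.re_ofReal_mul]
    have hunit : star (φL L x) ⬝ᵥ φL L x = 1 := by rw [φL_orthonormal, if_pos rfl]
    have h1 := re_numberMode_le hunit y
    have h2 := re_numberMode_nonneg (φL L x) y
    split_ifs with h
    · nlinarith
    · exact mul_nonneg (not_lt.mp h) h2
  calc seaEnergy L * (star y ⬝ᵥ y).re
      = ∑ x : ModeIdx L, (if torusBand L x.1 + 1 < 0 then (torusBand L x.1 + 1) * (star y ⬝ᵥ y).re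
          else 0) := by
        rw [seaEnergy, Finset.sum_mul, Finset.sum_filter]
    _ ≤ _ := Finset.sum_le_sum fun x _ => hterm x

variable (q : TorusSite 2 L)

/-- The Fermi sea `v_A` and the sea with the extra `d`-wave pair `(q↑, −q↓)`, `v_B = b_q† v_A`. -/
def seaA : Fock (Orb (FermionTorus 2 L)) := slater (φL L) (seaList L)

/-- `v_B = c†_{q↑} c†_{−q↓} v_A`. -/
def seaB : Fock (Orb (FermionTorus 2 L)) := slater (φL L) ((q, 0) :: (-q, 1) :: seaList L)

/-- Momentum reflection keeps the cosines (`cos(2π(−k)ᵢ/L) = cos(2πkᵢ/L)`). -/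
theorem cos_latticeMomentum_neg' (k : TorusSite 2 L) (i : Fin 2) :
    Real.cos (latticeMomentum L (-k) i) = Real.cos (latticeMomentum L k i) := by
  simp only [latticeMomentum, Pi.neg_apply, ZMod.neg_val]
  split_ifs with h
  · rw [h, ZMod.val_zero]
  · have hLr : (L : ℝ) ≠ 0 := by exact_mod_cast NeZero.ne L
    rw [Nat.cast_sub (ZMod.val_lt _).le,
      show 2 * Real.pi * ((L : ℝ) - ((k i).val : ℕ)) / L = 2 * Real.pi - 2 * Real.pi * ((k i).val : ℕ) / L by
        field_simp,
      Real.cos_two_pi_sub]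

theorem torusBand_neg' (k : TorusSite 2 L) : torusBand L (-k) = torusBand L k := by
  simp only [torusBand, cos_latticeMomentum_neg']

variable {L q}
variable (hq : torusBand L q = -1)
include hq

theorem q_not_mem_seaList : ((q, (0 : Fin 2)) : ModeIdx L) ∉ seaList L := by
  rw [mem_seaList, hq]; norm_num

theorem negq_not_mem_seaList : ((-q, (1 : Fin 2)) : ModeIdx L) ∉ seaList L := by
  rw [mem_seaList, torusBand_neg', hq]; norm_num

theorem seaB_list_nodup : (((q, (0 : Fin 2)) : ModeIdx L) :: (-q, 1) :: seaList L).Nodup := by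
  rw [List.nodup_cons, List.nodup_cons, List.mem_cons, not_or]
  refine ⟨⟨?_, q_not_mem_seaList hq⟩, negq_not_mem_seaList hq, seaList_nodup L⟩
  simp

omit hq in
theorem star_seaA_seaA : star (seaA L) ⬝ᵥ seaA L = 1 :=
  star_slater_dotProduct_slater (φL_orthonormal L) (seaList_nodup L)

theorem star_seaB_seaB : star (seaB L q) ⬝ᵥ seaB L q = 1 :=
  star_slater_dotProduct_slater (φL_orthonormal L) (seaB_list_nodup hq)

omit hq in
theorem isNParticle_seaA : IsNParticle (seaList L).length (seaA L) := isNParticle_slater _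

omit hq in
theorem isNParticle_seaB : IsNParticle ((seaList L).length + 2) (seaB L q) := by
  have h := isNParticle_slater (φ := φL L) (((q, (0 : Fin 2)) : ModeIdx L) :: (-q, 1) :: seaList L)
  simp only [List.length_cons] at h
  exact h

omit hq in
theorem star_seaA_seaB : star (seaA L) ⬝ᵥ seaB L q = 0 :=
  IsNParticle.dotProduct_eq_zero (isNParticle_seaA) (isNParticle_seaB) (by omega)

omit hq in
theorem star_seaB_seaA : star (seaB L q) ⬝ᵥ seaA L = 0 :=
  IsNParticle.dotProduct_eq_zero (isNParticle_seaB) (isNParticle_seaA) (by omega)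

omit hq in
/-- `K⁰ v_A = E_F v_A`. -/
theorem free_mulVec_seaA (hL : 3 ≤ L) :
    hubbardTorusWith 2 L 1 0 (-1) *ᵥ seaA L = ((seaEnergy L : ℝ) : ℂ) • seaA L := by
  rw [hubbardTorusWith_zero_eq_sum_numberMode L hL, seaA,
    sum_smul_numberMode_mulVec_slater (φL_orthonormal L) _ (seaList_nodup L), seaList_toFinset,
    seaEnergy, Complex.ofReal_sum]

/-- `K⁰ v_B = E_F v_B` (the added pair sits on the level `ε = −1`: `ε_{±q} + 1 = 0`). -/
theorem free_mulVec_seaB (hL : 3 ≤ L) :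
    hubbardTorusWith 2 L 1 0 (-1) *ᵥ seaB L q = ((seaEnergy L : ℝ) : ℂ) • seaB L q := by
  rw [hubbardTorusWith_zero_eq_sum_numberMode L hL, seaB,
    sum_smul_numberMode_mulVec_slater (φL_orthonormal L) _ (seaB_list_nodup hq), List.toFinset_cons,
    List.toFinset_cons, Finset.sum_insert, Finset.sum_insert, seaList_toFinset, seaEnergy,
    Complex.ofReal_sum, torusBand_neg', hq]
  · push_cast; ring
  · rw [List.mem_toFinset]; exact negq_not_mem_seaList hq
  · rw [Finset.mem_insert, List.mem_toFinset, not_or]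
    exact ⟨by simp, q_not_mem_seaList hq⟩

/-- The pair mode `b_q` maps `v_B` back to `v_A`. -/
theorem pairMode_q_mulVec_seaB : pairMode q *ᵥ seaB L q = seaA L := by
  rw [pairMode, momentumAnnihilation_eq_annihilate, momentumAnnihilation_eq_annihilate, seaB, seaA]
  exact pair_mulVec_slater (φL_orthonormal L) (a := (q, 0)) (b := (-q, 1)) (by simp)
    (q_not_mem_seaList hq) (negq_not_mem_seaList hq)

/-- For `k ≠ q` the amplitude `⟨v_A, b_k v_B⟩` vanishes (insert `n_{q↑}`: it fixes `v_B`, commutes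
with `b_k`, and kills `v_A`). -/
theorem star_seaA_pairMode_seaB_of_ne {k : TorusSite 2 L} (hk : k ≠ q) :
    star (seaA L) ⬝ᵥ (pairMode k *ᵥ seaB L q) = 0 := by
  set n := numberMode (φL L (q, 0)) with hn
  have hnB : n *ᵥ seaB L q = seaB L q :=
    numberMode_mulVec_slater_of_mem (φL_orthonormal L) (seaB_list_nodup hq) (by simp)
  have hnA : n *ᵥ seaA L = 0 :=
    numberMode_mulVec_slater_of_not_mem (φL_orthonormal L) (q_not_mem_seaList hq)
  have h1 : star (φL L (k, 0)) ⬝ᵥ φL L (q, 0) = 0 := by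
    rw [φL_orthonormal, if_neg]; simp [hk]
  have h2 : star (φL L (-k, 1)) ⬝ᵥ φL L (q, 0) = 0 := by
    rw [φL_orthonormal, if_neg]; simp
  have hcomm : pairMode k * n = n * pairMode k := by
    rw [pairMode, momentumAnnihilation_eq_annihilate, momentumAnnihilation_eq_annihilate,
      show modeFun (-k) 1 = φL L (-k, 1) from rfl, show modeFun k 0 = φL L (k, 0) from rfl,
      mul_assoc, annihilate_mul_numberMode_of_orthogonal h1, ← mul_assoc,
      annihilate_mul_numberMode_of_orthogonal h2, mul_assoc]
  have hnH : nᴴ = n := numberMode_conjTranspose _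
  calc star (seaA L) ⬝ᵥ (pairMode k *ᵥ seaB L q)
      = star (seaA L) ⬝ᵥ ((pairMode k * n) *ᵥ seaB L q) := by rw [← mulVec_mulVec, hnB]
    _ = star (nᴴ *ᵥ seaA L) ⬝ᵥ (pairMode k *ᵥ seaB L q) := by
        rw [hcomm, ← mulVec_mulVec, star_mulVec_dotProduct, conjTranspose_conjTranspose]
    _ = 0 := by rw [hnH, hnA, star_zero, zero_dotProduct]

/-- **`⟨v_A, Δ_d v_B⟩ = −2√2 ĝ_d(q)`** on any torus with a level at `−1` through `q`. -/
theorem star_seaA_pairField_seaB :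
    star (seaA L) ⬝ᵥ (pairField dWaveFormFactor L *ᵥ seaB L q) =
      ((-(2 * Real.sqrt 2) * dWaveGap q : ℝ) : ℂ) := by
  rw [pairField_dWave_eq_smul_pairOperator, neg_mulVec, smul_mulVec, pairOperator, sum_mulVec,
    dotProduct_neg, dotProduct_smul, dotProduct_sum]
  simp_rw [smul_mulVec, dotProduct_smul]
  rw [Finset.sum_eq_single q]
  · rw [pairMode_q_mulVec_seaB hq, star_seaA_seaA]
    simp only [smul_eq_mul, mul_one]
    push_cast
    ring
  · intro k _ hk
    rw [star_seaA_pairMode_seaB_of_ne hq hk, smul_zero]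
  · exact fun h => absurd (Finset.mem_univ q) h

omit [NeZero L] hq in
/-- `Δ_dᴴ` raises the particle number by two (any `L`). -/
theorem isNParticle_pairField_dWave_conjTranspose_mulVec [NeZero L] {N : ℕ}
    {ψ : Fock (Orb (FermionTorus 2 L))} (hψ : IsNParticle N ψ) :
    IsNParticle (N + 2) ((pairField dWaveFormFactor L)ᴴ *ᵥ ψ) := by
  rw [pairField_dWave_eq_smul_pairOperator, conjTranspose_neg, conjTranspose_smul,
    pairOperator_conjTranspose, neg_mulVec, smul_mulVec, sum_mulVec]
  refine (nParticleSubmodule (N + 2)).neg_mem ((nParticleSubmodule (N + 2)).smul_mem _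
    ((nParticleSubmodule (N + 2)).sum_mem fun k _ => ?_))
  rw [smul_mulVec, ← mulVec_mulVec, momentumCreation_eq_create, momentumCreation_eq_create]
  exact (nParticleSubmodule (N + 2)).smul_mem _ ((hψ.create_mulVec _).create_mulVec _)

omit hq in
/-- Pair expectations vanish inside a fixed sector: `⟨ψ, Δ_d ψ⟩ = 0` for an `N`-particle `ψ`. -/
theorem star_dotProduct_pairField_mulVec_self_eq_zero {N : ℕ} {ψ : Fock (Orb (FermionTorus 2 L))}
    (hψ : IsNParticle N ψ) : star ψ ⬝ᵥ (pairField dWaveFormFactor L *ᵥ ψ) = 0 := by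
  rw [show star ψ ⬝ᵥ (pairField dWaveFormFactor L *ᵥ ψ) =
      star ((pairField dWaveFormFactor L)ᴴ *ᵥ ψ) ⬝ᵥ ψ by
    rw [star_mulVec_dotProduct, conjTranspose_conjTranspose]]
  exact IsNParticle.dotProduct_eq_zero (isNParticle_pairField_dWave_conjTranspose_mulVec hψ) hψ
    (by omega)

omit hq in
theorem star_seaA_pairField_seaA : star (seaA L) ⬝ᵥ (pairField dWaveFormFactor L *ᵥ seaA L) = 0 :=
  star_dotProduct_pairField_mulVec_self_eq_zero isNParticle_seaA

omit hq in
theorem star_seaB_pairField_seaB :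
    star (seaB L q) ⬝ᵥ (pairField dWaveFormFactor L *ᵥ seaB L q) = 0 :=
  star_dotProduct_pairField_mulVec_self_eq_zero isNParticle_seaB

omit hq in
theorem star_seaB_pairField_seaA :
    star (seaB L q) ⬝ᵥ (pairField dWaveFormFactor L *ᵥ seaA L) = 0 := by
  rw [show star (seaB L q) ⬝ᵥ (pairField dWaveFormFactor L *ᵥ seaA L) =
      star ((pairField dWaveFormFactor L)ᴴ *ᵥ seaB L q) ⬝ᵥ seaA L by
    rw [star_mulVec_dotProduct, conjTranspose_conjTranspose]]
  exact IsNParticle.dotProduct_eq_zero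
    (isNParticle_pairField_dWave_conjTranspose_mulVec isNParticle_seaB) isNParticle_seaA (by omega)

/-- The (norm² `= 2`) shell superposition `w = v_A + v_B` on the `L`-torus. -/
def seaW (L : ℕ) [NeZero L] (q : TorusSite 2 L) : Fock (Orb (FermionTorus 2 L)) := seaA L + seaB L q

theorem star_seaW_seaW : star (seaW L q) ⬝ᵥ seaW L q = 2 := by
  rw [seaW, star_add, add_dotProduct, dotProduct_add, dotProduct_add, star_seaA_seaA, star_seaA_seaB,
    star_seaB_seaA, star_seaB_seaB hq]
  norm_num

theorem star_seaW_free_seaW (hL : 3 ≤ L) :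
    star (seaW L q) ⬝ᵥ (hubbardTorusWith 2 L 1 0 (-1) *ᵥ seaW L q) = 2 * ((seaEnergy L : ℝ) : ℂ) := by
  rw [seaW, mulVec_add, free_mulVec_seaA hL, free_mulVec_seaB hq hL, ← smul_add, dotProduct_smul,
    ← seaW, star_seaW_seaW hq, smul_eq_mul]
  ring

theorem star_seaW_pairField_seaW (hg : dWaveGap q = -3 / 2) :
    star (seaW L q) ⬝ᵥ (pairField dWaveFormFactor L *ᵥ seaW L q) = ((3 * Real.sqrt 2 : ℝ) : ℂ) := by
  rw [seaW, mulVec_add, star_add, add_dotProduct, dotProduct_add, dotProduct_add, star_seaA_pairField_seaA,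
    star_seaA_pairField_seaB hq, star_seaB_pairField_seaA, star_seaB_pairField_seaB, hg]
  push_cast
  ring

theorem re_star_seaW_pairSource_seaW (hg : dWaveGap q = -3 / 2) :
    (star (seaW L q) ⬝ᵥ ((pairField dWaveFormFactor L + (pairField dWaveFormFactor L)ᴴ) *ᵥ seaW L q)).re =
      6 * Real.sqrt 2 := by
  rw [add_mulVec, dotProduct_add, star_dotProduct_conjTranspose_mulVec, star_seaW_pairField_seaW hq hg,
    Complex.add_re, Complex.star_def, Complex.conj_re, Complex.ofReal_re]
  ring

/-- The normalised shell superposition `v = (v_A + v_B)/√2` on the `L`-torus. -/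
def seaV (L : ℕ) [NeZero L] (q : TorusSite 2 L) : Fock (Orb (FermionTorus 2 L)) :=
  (((Real.sqrt 2)⁻¹ : ℝ) : ℂ) • seaW L q

omit [NeZero L] hq in
theorem star_smul_dotProduct_smul' (r : ℝ) (w z : Fock (Orb (FermionTorus 2 L))) :
    star (((r : ℝ) : ℂ) • w) ⬝ᵥ (((r : ℝ) : ℂ) • z) = ((r * r : ℝ) : ℂ) * (star w ⬝ᵥ z) := by
  rw [star_smul, smul_dotProduct, dotProduct_smul, smul_eq_mul, smul_eq_mul, Complex.star_def,
    Complex.conj_ofReal]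
  push_cast
  ring

theorem star_seaV_seaV : star (seaV L q) ⬝ᵥ seaV L q = 1 := by
  rw [seaV, star_smul_dotProduct_smul', sqrt_two_inv_mul_self, star_seaW_seaW hq]
  push_cast
  ring

omit hq in
theorem star_seaV_mulVec_seaV (M : Matrix (Finset (Orb (FermionTorus 2 L))) (Finset (Orb (FermionTorus 2 L))) ℂ) :
    star (seaV L q) ⬝ᵥ (M *ᵥ seaV L q) = ((1 / 2 : ℝ) : ℂ) * (star (seaW L q) ⬝ᵥ (M *ᵥ seaW L q)) := by
  rw [seaV, mulVec_smul, star_smul_dotProduct_smul', sqrt_two_inv_mul_self]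

/-- `Re⟨v, (Δ_d + Δ_dᴴ) v⟩² = 18` for the normalised shell state. -/
theorem re_star_seaV_pairSource_seaV_sq (hg : dWaveGap q = -3 / 2) :
    (star (seaV L q) ⬝ᵥ ((pairField dWaveFormFactor L + (pairField dWaveFormFactor L)ᴴ) *ᵥ seaV L q)).re ^ 2
      = 18 := by
  rw [star_seaV_mulVec_seaV, Complex.re_ofReal_mul, re_star_seaW_pairSource_seaW hq hg,
    show (1 / 2 : ℝ) * (6 * Real.sqrt 2) = 3 * Real.sqrt 2 by ring, mul_pow, Real.sq_sqrt zero_le_two]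
  norm_num

omit [NeZero L] hq in
/-- The interacting `L`-torus at `μ = -1` is the free one plus `U · W`. -/
theorem hubbardTorusWith_eq_free_add (U : ℝ) :
    hubbardTorusWith 2 L 1 U (-1) = hubbardTorusWith 2 L 1 0 (-1) + (U : ℂ) • interactionW (FermionTorus 2 L) :=
  hamiltonianWith_eq_add_interaction _ 1 U (-1)

omit [NeZero L] hq in
theorem card_fermionTorus : (Fintype.card (FermionTorus 2 L) : ℝ) = (L : ℝ) ^ 2 := by
  simp [FermionTorus, Fintype.card_lex]

omit hq in
/-- Floor of the interacting torus: `H_U ≥ E_F` for `U ≥ 0`. -/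
theorem interacting_floor (hL : 3 ≤ L) {U : ℝ} (hU : 0 ≤ U) (y : Fock (Orb (FermionTorus 2 L))) :
    seaEnergy L * (star y ⬝ᵥ y).re ≤ (star y ⬝ᵥ (hubbardTorusWith 2 L 1 U (-1) *ᵥ y)).re := by
  rw [hubbardTorusWith_eq_free_add, add_mulVec, dotProduct_add, Complex.add_re, smul_mulVec,
    dotProduct_smul, smul_eq_mul, Complex.re_ofReal_mul]
  have h1 := free_floor L hL y
  have h2 := re_interactionW_nonneg (Λ := FermionTorus 2 L) y
  nlinarith

/-- Energy of the normalised shell state in the interacting model: `Re⟨v, H_U v⟩ ≤ E_F + U L²`. -/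
theorem re_star_seaV_hubbard_seaV_le (hL : 3 ≤ L) {U : ℝ} (hU : 0 ≤ U) :
    (star (seaV L q) ⬝ᵥ (hubbardTorusWith 2 L 1 U (-1) *ᵥ seaV L q)).re ≤ seaEnergy L + U * (L : ℝ) ^ 2 := by
  rw [star_seaV_mulVec_seaV, hubbardTorusWith_eq_free_add, add_mulVec, dotProduct_add, smul_mulVec,
    dotProduct_smul, smul_eq_mul, star_seaW_free_seaW hq hL, Complex.re_ofReal_mul, Complex.add_re,
    Complex.re_ofReal_mul]
  have h := re_interactionW_le (Λ := FermionTorus 2 L) (seaW L q)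
  rw [card_fermionTorus, star_seaW_seaW hq] at h
  have h2 : (2 * ((seaEnergy L : ℝ) : ℂ)).re = 2 * seaEnergy L := by simp
  rw [h2]
  norm_num at h ⊢
  nlinarith

end FermiSea

/-! ## §D.11 LOAD-BEARING (stronger form): no finite-size threshold `L₀` works uniformly in `β`

`TwSourcedInertnessUniformL0` is the crux with the threshold chosen BEFORE `U, β, μ`
(`∃ U₀ a C L₀ ∀ U β μ ∀ L ≥ L₀ ∀ h`). It is FALSE: given `L₀` take `L = 3·max(L₀,1)`; the free
`L`-torus has the level `ε = −1` through `q = (L/3, 0)` (`cos(2π/3) = −1/2`), and the Fermi-sea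
shell state of §D.10 has pair amplitude `3√2` and energy within `U L²` of the floor `E_F`; choosing
`β = (C·log 4·L⁴ + 1)²` and then `U = min(U₀, a/log β, 2/(L⁴C(1+log β)))` contradicts the bound.
MESSAGE TO PROVERS: `L₀(β, μ) → ∞` as `β → ∞` is forced (for `μ = −1`, `L₀(β,−1) ≳ (β/C)^{1/4}`). -/

section UniformThreshold

open scoped Matrix.Norms.L2Operator ComplexOrder

set_option maxHeartbeats 400000 in
/-- The contradiction at one torus carrying a level at `−1`: no `(U₀, a, C)` can serve the crux's
bound on that FIXED torus for all admissible `(U, β)`. -/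
theorem no_bound_on_torus_with_level (L : ℕ) [NeZero L] (hL3 : 3 ≤ L) (q : TorusSite 2 L)
    (hq : torusBand L q = -1) (hg : dWaveGap q = -3 / 2) {U₀ a C : ℝ} (hU₀ : 0 < U₀) (ha : 0 < a)
    (hC : 0 < C)
    (hmain : ∀ U : ℝ, 0 < U → U ≤ U₀ → ∀ β : ℝ, 1 ≤ β → β ≤ Real.exp (a / U) → ∀ h : ℝ,
      sourcedPressure L β U (-1) h - sourcedPressure L β U (-1) 0 ≤ C * (1 + Real.log β) * h ^ 2) :
    False := by
  have hΛpos : 0 < Real.log 4 := Real.log_pos (by norm_num)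
  set Λ : ℝ := Real.log 4 with hΛ
  have hLpos : (0 : ℝ) < (L : ℝ) := by exact_mod_cast Nat.pos_of_ne_zero (NeZero.ne L)
  set M : ℝ := (L : ℝ) ^ 4 with hM
  have hMpos : 0 < M := by positivity
  set s : ℝ := C * Λ * M + 1 with hs
  have hCΛM : 0 < C * Λ * M := by positivity
  have hs1 : 1 < s := by linarith
  have hs0 : 0 < s := by linarith
  set β : ℝ := s ^ 2 with hβdef
  have hβ1 : 1 < β := by nlinarith
  have hβpos : 0 < β := by linarith
  have hlogβ : Real.log β = 2 * Real.log s := by rw [hβdef, Real.log_pow]; norm_num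
  have hlogs : Real.log s ≤ s - 1 := Real.log_le_sub_one_of_pos hs0
  have hlogs0 : 0 < Real.log s := Real.log_pos hs1
  have hlogβpos : 0 < Real.log β := by rw [hlogβ]; linarith
  set K : ℝ := C * (1 + Real.log β) with hKdef
  have hKpos : 0 < K := by positivity
  have hK_le : K ≤ 2 * C * s := by rw [hKdef, hlogβ]; nlinarith
  set U : ℝ := min U₀ (min (a / Real.log β) (2 / (M * K))) with hUdef
  have hUpos : 0 < U := lt_min hU₀ (lt_min (div_pos ha hlogβpos) (by positivity))
  have hUU₀ : U ≤ U₀ := min_le_left _ _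
  have hUa : U ≤ a / Real.log β := (min_le_right _ _).trans (min_le_left _ _)
  have hUK : U ≤ 2 / (M * K) := (min_le_right _ _).trans (min_le_right _ _)
  have hβexp : β ≤ Real.exp (a / U) := by
    have h1 : Real.log β ≤ a / U := by
      rw [le_div_iff₀ hUpos]
      have := (le_div_iff₀ hlogβpos).mp hUa
      linarith
    calc β = Real.exp (Real.log β) := (Real.exp_log hβpos).symm
      _ ≤ Real.exp (a / U) := Real.exp_le_exp.mpr h1
  have hcrux : ∀ h : ℝ, sourcedPressure L β U (-1) h - sourcedPressure L β U (-1) 0 ≤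
      C * (1 + Real.log β) * h ^ 2 := fun h => hmain U hUpos hUU₀ β hβ1.le hβexp h
  have hgain := gain_le_of_crux L hβpos hcrux
  have hK9 : 0 < C * (1 + Real.log β) * (L : ℝ) ^ 2 := by positivity
  have key := sq_le_of_gain_le_quadratic' (isHermitian_hubbardTorusWith L U (-1))
    (isHermitian_pairSource L) hβpos hK9 hgain (E := seaEnergy L)
    (fun x => interacting_floor hL3 hUpos.le x) (star_seaV_seaV (q := q) hq)
  rw [log_card_fock L] at key
  have hm : (star (seaV L q) ⬝ᵥ pairSource L *ᵥ seaV L q).re ^ 2 = 18 :=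
    re_star_seaV_pairSource_seaV_sq hq hg
  have hR := re_star_seaV_hubbard_seaV_le (q := q) hq hL3 hUpos.le
  rw [hm, ← hKdef] at key
  -- bookkeeping: 18 ≤ 4 K M (U + Λ/β) < 18
  have hKU : K * U ≤ 2 / M := by
    calc K * U ≤ K * (2 / (M * K)) := by gcongr
      _ = 2 / M := by field_simp
  have hKΛ : K * Λ / β ≤ 2 * C * Λ / s := by
    rw [hβdef, div_le_div_iff₀ (by positivity) hs0]
    have := mul_le_mul_of_nonneg_right hK_le (show 0 ≤ Λ * s by positivity)
    nlinarith
  have hCΛs : 2 * C * Λ / s < 2 / M := by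
    rw [div_lt_div_iff₀ hs0 hMpos]
    nlinarith
  have hL2M : (L : ℝ) ^ 2 * (L : ℝ) ^ 2 = M := by rw [hM]; ring
  have hexpand : 4 * (K * (L : ℝ) ^ 2) *
      ((star (seaV L q) ⬝ᵥ hubbardTorusWith 2 L 1 U (-1) *ᵥ seaV L q).re - seaEnergy L +
        (L : ℝ) ^ 2 * Λ / β) =
      4 * K * (L : ℝ) ^ 2 * ((star (seaV L q) ⬝ᵥ hubbardTorusWith 2 L 1 U (-1) *ᵥ seaV L q).re
        - seaEnergy L) + 4 * M * (K * Λ / β) := by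
    rw [← hL2M]; ring
  rw [hexpand] at key
  have hRE : (star (seaV L q) ⬝ᵥ hubbardTorusWith 2 L 1 U (-1) *ᵥ seaV L q).re - seaEnergy L ≤
      U * (L : ℝ) ^ 2 := by linarith
  have h4KL : 0 ≤ 4 * K * (L : ℝ) ^ 2 := by positivity
  have hA : 4 * K * (L : ℝ) ^ 2 *
      ((star (seaV L q) ⬝ᵥ hubbardTorusWith 2 L 1 U (-1) *ᵥ seaV L q).re - seaEnergy L) ≤
      4 * (K * U) * M := by
    have := mul_le_mul_of_nonneg_left hRE h4KL
    calc _ ≤ 4 * K * (L : ℝ) ^ 2 * (U * (L : ℝ) ^ 2) := this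
      _ = 4 * (K * U) * M := by rw [← hL2M]; ring
  have hB : 4 * (K * U) * M ≤ 8 := by
    calc 4 * (K * U) * M ≤ 4 * (2 / M) * M := by gcongr
      _ = 8 := by field_simp; ring
  have hC' : 4 * M * (K * Λ / β) < 8 := by
    have h3 : 4 * M * (K * Λ / β) < 4 * M * (2 / M) := by
      have := hKΛ.trans_lt hCΛs
      gcongr
    have h4 : 4 * M * (2 / M) = 8 := by field_simp; ring
    linarith
  linarith

/-- The shell momentum `q = (j, 0)` of the `3j`-torus. -/
def qOn (j : ℕ) : TorusSite 2 (3 * j) := ![((j : ℕ) : ZMod (3 * j)), 0]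

theorem val_qOn_zero {j : ℕ} (hj : 1 ≤ j) : ((qOn j) 0).val = j := by
  rw [qOn, Matrix.cons_val_zero, ZMod.val_natCast]
  exact Nat.mod_eq_of_lt (by omega)

theorem qOn_one (j : ℕ) : (qOn j) 1 = 0 := by
  simp [qOn]

theorem cos_latticeMomentum_qOn_zero {j : ℕ} (hj : 1 ≤ j) :
    Real.cos (latticeMomentum (3 * j) (qOn j) 0) = -1 / 2 := by
  unfold latticeMomentum
  rw [val_qOn_zero hj]
  have hj0 : (j : ℝ) ≠ 0 := by exact_mod_cast (show j ≠ 0 by omega)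
  rw [show (2 * Real.pi * (j : ℝ) / ((3 * j : ℕ) : ℝ)) = 2 * Real.pi * 1 / 3 by push_cast; field_simp]
  exact cos_two_pi_div_three

theorem cos_latticeMomentum_qOn_one (j : ℕ) :
    Real.cos (latticeMomentum (3 * j) (qOn j) 1) = 1 := by
  unfold latticeMomentum
  rw [qOn_one, ZMod.val_zero]
  simp

theorem torusBand_qOn {j : ℕ} (hj : 1 ≤ j) : torusBand (3 * j) (qOn j) = -1 := by
  rw [torusBand, Fin.sum_univ_two, cos_latticeMomentum_qOn_zero hj, cos_latticeMomentum_qOn_one]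
  norm_num

theorem dWaveGap_qOn {j : ℕ} (hj : 1 ≤ j) : dWaveGap (qOn j) = -3 / 2 := by
  rw [dWaveGap, cos_latticeMomentum_qOn_zero hj, cos_latticeMomentum_qOn_one]
  norm_num

/-- The crux with the finite-size threshold `L₀` chosen uniformly in `(U, β, μ)`. -/
def TwSourcedInertnessUniformL0 : Prop :=
  ∀ μ₁ μ₂ : ℝ, -4 < μ₁ → μ₁ ≤ μ₂ → μ₂ < 0 → ∃ U₀ a C : ℝ, 0 < U₀ ∧ 0 < a ∧ 0 < C ∧ ∃ L₀ : ℕ,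
    ∀ U : ℝ, 0 < U → U ≤ U₀ → ∀ β : ℝ, 1 ≤ β → β ≤ Real.exp (a / U) → ∀ μ ∈ Set.Icc μ₁ μ₂,
      ∀ (L : ℕ) [NeZero L], L₀ ≤ L → ∀ h : ℝ,
        (Real.log (Matrix.partitionFn β (dWaveSourceTorus L U μ h)).re / (β * (L : ℝ) ^ 2)) -
          (Real.log (Matrix.partitionFn β (dWaveSourceTorus L U μ 0)).re / (β * (L : ℝ) ^ 2)) ≤
          C * (1 + Real.log β) * h ^ 2

/-- `TwSourcedInertnessUniformL0 → TwSourcedInertness` (orientation: the uniform version is the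
stronger one). -/
theorem twSourcedInertness_of_uniformL0 (H : TwSourcedInertnessUniformL0) :
    Summit.HubbardSuperconductivity.HubbardSuperconductivity.Theses.ThermalWedge.TwSourcedInertness := by
  intro μ₁ μ₂ h1 h2 h3
  obtain ⟨U₀, a, C, hU₀, ha, hC, L₀, hmain⟩ := H μ₁ μ₂ h1 h2 h3
  exact ⟨U₀, a, C, hU₀, ha, hC, fun U hU hUU₀ β hβ hβa μ hμ => ⟨L₀, fun L _ hL h =>
    hmain U hU hUU₀ β hβ hβa μ hμ L hL h⟩⟩

/-- **No finite-size threshold is uniform in `β`: `¬ TwSourcedInertnessUniformL0`.** -/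
theorem tw1696_false_uniform_threshold : ¬ TwSourcedInertnessUniformL0 := by
  intro H
  obtain ⟨U₀, a, C, hU₀, ha, hC, L₀, hmain⟩ := H (-1) (-1) (by norm_num) le_rfl (by norm_num)
  set j : ℕ := max L₀ 1 with hjdef
  have hj : 1 ≤ j := le_max_right _ _
  have hjL : L₀ ≤ j := le_max_left _ _
  haveI : NeZero (3 * j) := ⟨by omega⟩
  have hL3 : 3 ≤ 3 * j := by omega
  have hL₀ : L₀ ≤ 3 * j := by omega
  exact no_bound_on_torus_with_level (3 * j) hL3 (qOn j) (torusBand_qOn hj) (dWaveGap_qOn hj) hU₀ ha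
    hC (fun U hU hUU β hβ hβa h => hmain U hU hUU β hβ hβa (-1) ⟨le_rfl, le_rfl⟩ (3 * j) hL₀ h)

end UniformThreshold

/-- **"Eventually in `L`" is load-bearing: `¬ TwSourcedInertnessAllL`** (§D.8's statement; since
cycle 2 a corollary of §D.11: `AllL → UniformL0` with `L₀ = 3`. The original `3 × 3` shell-state
proof of cycle 1 — explicit `v = (v_A + b_q† v_A)/√2`, amplitude `3√2`, `β = (72 C log 4 + 1)²` — is
superseded and was removed to respect the work-file size cap; see also §I for the two-line
zero-mode argument from the exact free formula). -/
theorem tw1696_false_without_eventually : ¬ TwSourcedInertnessAllL := fun H =>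
  tw1696_false_uniform_threshold fun μ₁ μ₂ h1 h2 h3 => by
    obtain ⟨U₀, a, C, hU₀, ha, hC, hmain⟩ := H μ₁ μ₂ h1 h2 h3
    exact ⟨U₀, a, C, hU₀, ha, hC, 3, hmain⟩

/-! ## §F Consequence II — the Kennedy–Lieb–Shastry trial state: inertness caps the `d`-wave
LRO of every GC-EXPOSED ground state (no approximating-Hamiltonian theorem, no ensemble equivalence)

Abstract step (`kls_trial_state`): if `ψ` is a unit global ground vector of `H` (`Hψ = Eψ`, `H ≥ E`)
and `A` lowers a conserved charge by a fixed amount (so that `⟨ψ,Aψ⟩ = ⟨ψ,A²ψ⟩ = ⟨Aψ,A²ψ⟩ = 0`), the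
state `v = (ψ + Aψ/‖Aψ‖)/√2` has pair amplitude `Re⟨v,(A+Aᴴ)v⟩² = ‖Aψ‖² = ⟨ψ,AᴴAψ⟩` and excess energy
`≤ ‖[Aᴴ,[H,A]]‖/(2‖Aψ‖²)`. With §C this turns the crux into a bound on `P = ⟨ψ, Δ_dᴴΔ_d ψ⟩` for every
`N`-particle global ground state of `hubbardTorusWith 2 L 1 U μ` (`gcLRO_bound_of_inertness`):
`P² ≤ 2C(1+log β)L²‖[Δ_dᴴ,[H,Δ_d]]‖ + 4C(1+log β)(L² log 4/β)·P`; since `‖[Δ_dᴴ,[H,Δ_d]]‖ = O(L²)`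
(graded locality, cf. `HubbardCommutatorBound`; not formalised here) this is the EXPONENTIAL CEILING
`limsup P/L⁴ ≤ 4C(1+a/U)·log 4·e^{−a/U}` for GC-exposed sectors — the route's `TwExponentialCeiling`
minus the `μ(δ)` bookkeeping, obtained WITHOUT `TwApproximatingHamiltonian`. -/

section KLS

open scoped Matrix.Norms.L2Operator ComplexOrder

variable {n : Type*} [Fintype n] [DecidableEq n]

omit [DecidableEq n] in
theorem star_dotProduct_comm' (x y : n → ℂ) : star x ⬝ᵥ y = star (star y ⬝ᵥ x) := by
  rw [← star_dotProduct_star, star_star]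

omit [DecidableEq n] in
theorem star_dotProduct_conjTranspose_mulVec' (A : Matrix n n ℂ) (x y : n → ℂ) :
    star x ⬝ᵥ (Aᴴ *ᵥ y) = star (star y ⬝ᵥ (A *ᵥ x)) := by
  rw [← star_mulVec_dotProduct, star_dotProduct_comm']

omit [DecidableEq n] in
/-- Expansion of a quadratic form on `c(x + d y)` for real `c, d`. -/
theorem quadForm_expand (M : Matrix n n ℂ) (x y : n → ℂ) (c d : ℝ) :
    star (((c : ℝ) : ℂ) • (x + ((d : ℝ) : ℂ) • y)) ⬝ᵥ (M *ᵥ (((c : ℝ) : ℂ) • (x + ((d : ℝ) : ℂ) • y))) =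
      ((c : ℝ) : ℂ) ^ 2 * (star x ⬝ᵥ (M *ᵥ x) + ((d : ℝ) : ℂ) * (star x ⬝ᵥ (M *ᵥ y)) +
        ((d : ℝ) : ℂ) * (star y ⬝ᵥ (M *ᵥ x)) + ((d : ℝ) : ℂ) ^ 2 * (star y ⬝ᵥ (M *ᵥ y))) := by
  simp only [mulVec_smul, mulVec_add, star_smul, star_add, smul_dotProduct, dotProduct_smul,
    add_dotProduct, dotProduct_add, smul_eq_mul, Complex.star_def, Complex.conj_ofReal]
  ring

theorem normForm_expand (x y : n → ℂ) (c d : ℝ) :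
    star (((c : ℝ) : ℂ) • (x + ((d : ℝ) : ℂ) • y)) ⬝ᵥ (((c : ℝ) : ℂ) • (x + ((d : ℝ) : ℂ) • y)) =
      ((c : ℝ) : ℂ) ^ 2 * (star x ⬝ᵥ x + ((d : ℝ) : ℂ) * (star x ⬝ᵥ y) +
        ((d : ℝ) : ℂ) * (star y ⬝ᵥ x) + ((d : ℝ) : ℂ) ^ 2 * (star y ⬝ᵥ y)) := by
  have h := quadForm_expand (1 : Matrix n n ℂ) x y c d
  simpa only [one_mulVec] using h

/-- `Re⟨ψ, D ψ⟩ ≤ ‖D‖` for a unit vector (operator norm `ℓ² → ℓ²`). -/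
theorem re_star_dotProduct_mulVec_le_norm (D : Matrix n n ℂ) {ψ : n → ℂ} (hψ : star ψ ⬝ᵥ ψ = 1) :
    (star ψ ⬝ᵥ (D *ᵥ ψ)).re ≤ ‖D‖ := by
  rw [← Matrix.l2_opNorm_toEuclideanCLM]
  exact re_star_dotProduct_mulVec_le_opNorm D hψ

/-- **Variational content of the double commutator**: for a unit global ground vector `ψ`
(`Hψ = Eψ`, `H ≥ E` as a quadratic form) and any `A`,
`Re⟨Aψ, H Aψ⟩ − E‖Aψ‖² ≤ ‖Aᴴ[H,A] − [H,A]Aᴴ‖`. -/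
theorem excess_energy_le_norm_double_commutator {H A : Matrix n n ℂ} (hH : H.IsHermitian) {E : ℝ}
    (hfloor : ∀ x : n → ℂ, E * (star x ⬝ᵥ x).re ≤ (star x ⬝ᵥ H *ᵥ x).re)
    {ψ : n → ℂ} (hψ : star ψ ⬝ᵥ ψ = 1) (hHψ : H *ᵥ ψ = (E : ℂ) • ψ) :
    (star (A *ᵥ ψ) ⬝ᵥ (H *ᵥ (A *ᵥ ψ))).re - E * (star (A *ᵥ ψ) ⬝ᵥ (A *ᵥ ψ)).re ≤
      ‖Aᴴ * (H * A - A * H) - (H * A - A * H) * Aᴴ‖ := by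
  set D := Aᴴ * (H * A - A * H) - (H * A - A * H) * Aᴴ with hDdef
  set φ := A *ᵥ ψ with hφ
  set χ := Aᴴ *ᵥ ψ with hχ
  have hbound := re_star_dotProduct_mulVec_le_norm D hψ
  have hHH : Hᴴ = H := hH.eq
  have hDψ : D *ᵥ ψ = Aᴴ *ᵥ (H *ᵥ φ) - (E : ℂ) • (Aᴴ *ᵥ φ) -
      (H *ᵥ (A *ᵥ χ) - A *ᵥ (H *ᵥ χ)) := by
    simp only [hDdef, hφ, hχ, sub_mulVec, mul_sub, ← mulVec_mulVec, hHψ, mulVec_smul]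
  have T1 : star ψ ⬝ᵥ (Aᴴ *ᵥ (H *ᵥ φ)) = star φ ⬝ᵥ (H *ᵥ φ) := by
    rw [hφ, star_mulVec_dotProduct]
  have T2 : star ψ ⬝ᵥ (Aᴴ *ᵥ φ) = star φ ⬝ᵥ φ := by
    rw [hφ, star_mulVec_dotProduct]
  have hAχ : star ψ ⬝ᵥ (A *ᵥ χ) = star χ ⬝ᵥ χ := by
    rw [hχ, star_mulVec_dotProduct, conjTranspose_conjTranspose]
  have T3 : star ψ ⬝ᵥ (H *ᵥ (A *ᵥ χ)) = (E : ℂ) * (star χ ⬝ᵥ χ) := by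
    have h1 : star ψ ⬝ᵥ (H *ᵥ (A *ᵥ χ)) = star (H *ᵥ ψ) ⬝ᵥ (A *ᵥ χ) := by
      rw [star_mulVec_dotProduct, hHH]
    rw [h1, hHψ, star_smul, smul_dotProduct, Complex.star_def, Complex.conj_ofReal, smul_eq_mul, hAχ]
  have T4 : star ψ ⬝ᵥ (A *ᵥ (H *ᵥ χ)) = star χ ⬝ᵥ (H *ᵥ χ) := by
    rw [hχ, star_mulVec_dotProduct, conjTranspose_conjTranspose]
  have hsum : star ψ ⬝ᵥ (D *ᵥ ψ) =
      (star φ ⬝ᵥ (H *ᵥ φ) - (E : ℂ) * (star φ ⬝ᵥ φ)) +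
        (star χ ⬝ᵥ (H *ᵥ χ) - (E : ℂ) * (star χ ⬝ᵥ χ)) := by
    rw [hDψ, dotProduct_sub, dotProduct_sub, dotProduct_sub, dotProduct_smul, T1, T2, T3, T4,
      smul_eq_mul]
    ring
  have hre : (star ψ ⬝ᵥ (D *ᵥ ψ)).re =
      ((star φ ⬝ᵥ (H *ᵥ φ)).re - E * (star φ ⬝ᵥ φ).re) +
        ((star χ ⬝ᵥ (H *ᵥ χ)).re - E * (star χ ⬝ᵥ χ).re) := by
    rw [hsum]
    simp only [Complex.add_re, Complex.sub_re, Complex.re_ofReal_mul]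
  have hχfloor := hfloor χ
  rw [hre] at hbound
  linarith

/-- **The Kennedy–Lieb–Shastry trial state.** For a unit global ground vector `ψ` of `H` and an
operator `A` with `⟨ψ,Aψ⟩ = ⟨ψ,A²ψ⟩ = ⟨Aψ,A²ψ⟩ = 0` (e.g. `A` lowers a conserved particle number by
two) and `P = ‖Aψ‖² > 0`, the unit vector `v = (ψ + Aψ/√P)/√2` has
`Re⟨v,(A+Aᴴ)v⟩² = P` and `Re⟨v,Hv⟩ − E ≤ ‖Aᴴ[H,A] − [H,A]Aᴴ‖ / (2P)`. -/
theorem kls_trial_state {H A : Matrix n n ℂ} (hH : H.IsHermitian) {E : ℝ}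
    (hfloor : ∀ x : n → ℂ, E * (star x ⬝ᵥ x).re ≤ (star x ⬝ᵥ H *ᵥ x).re)
    {ψ : n → ℂ} (hψ : star ψ ⬝ᵥ ψ = 1) (hHψ : H *ᵥ ψ = (E : ℂ) • ψ)
    (hO1 : star ψ ⬝ᵥ (A *ᵥ ψ) = 0) (hO2 : star ψ ⬝ᵥ (A *ᵥ (A *ᵥ ψ)) = 0)
    (hO3 : star (A *ᵥ ψ) ⬝ᵥ (A *ᵥ (A *ᵥ ψ)) = 0)
    (hP : 0 < (star (A *ᵥ ψ) ⬝ᵥ (A *ᵥ ψ)).re) :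
    ∃ v : n → ℂ, star v ⬝ᵥ v = 1 ∧
      (star v ⬝ᵥ ((A + Aᴴ) *ᵥ v)).re ^ 2 = (star (A *ᵥ ψ) ⬝ᵥ (A *ᵥ ψ)).re ∧
      (star v ⬝ᵥ (H *ᵥ v)).re - E ≤
        ‖Aᴴ * (H * A - A * H) - (H * A - A * H) * Aᴴ‖ / (2 * (star (A *ᵥ ψ) ⬝ᵥ (A *ᵥ ψ)).re) := by
  -- abbreviations (kept syntactically as `A *ᵥ ψ` to avoid `set` bookkeeping)
  have hPc : star (A *ᵥ ψ) ⬝ᵥ (A *ᵥ ψ) = (((star (A *ᵥ ψ) ⬝ᵥ (A *ᵥ ψ)).re : ℝ) : ℂ) := by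
    have h0 := dotProduct_star_self_nonneg (A *ᵥ ψ)
    obtain ⟨_, him⟩ := Complex.nonneg_iff.mp h0
    apply Complex.ext
    · simp
    · simp [← him]
  set P : ℝ := (star (A *ᵥ ψ) ⬝ᵥ (A *ᵥ ψ)).re with hPdef
  set d : ℝ := (Real.sqrt P)⁻¹ with hd
  set c : ℝ := (Real.sqrt 2)⁻¹ with hc
  have hsqrtP : 0 < Real.sqrt P := Real.sqrt_pos.mpr hP
  have hd2 : d ^ 2 * P = 1 := by
    rw [hd, inv_pow, Real.sq_sqrt hP.le, inv_mul_cancel₀ hP.ne']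
  have hdP : d * P = Real.sqrt P := by
    rw [hd, inv_mul_eq_div, div_eq_iff hsqrtP.ne', ← sq, Real.sq_sqrt hP.le]
  have hc2 : c ^ 2 = 1 / 2 := by rw [hc, inv_pow, Real.sq_sqrt zero_le_two, one_div]
  have hHH : Hᴴ = H := hH.eq
  -- scalar products entering the expansions
  have e_ψφ : star ψ ⬝ᵥ (A *ᵥ ψ) = 0 := hO1
  have e_φψ : star (A *ᵥ ψ) ⬝ᵥ ψ = 0 := by rw [star_dotProduct_comm', e_ψφ, star_zero]
  have e_ψAφ : star ψ ⬝ᵥ (A *ᵥ (A *ᵥ ψ)) = 0 := hO2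
  have e_ψAHφ : star ψ ⬝ᵥ (Aᴴ *ᵥ (A *ᵥ ψ)) = (P : ℂ) := by
    rw [← star_mulVec_dotProduct]; exact hPc
  have e_φAψ : star (A *ᵥ ψ) ⬝ᵥ (A *ᵥ ψ) = (P : ℂ) := hPc
  have e_φAHψ : star (A *ᵥ ψ) ⬝ᵥ (Aᴴ *ᵥ ψ) = 0 := by
    rw [star_dotProduct_conjTranspose_mulVec', e_ψAφ, star_zero]
  have e_φAφ : star (A *ᵥ ψ) ⬝ᵥ (A *ᵥ (A *ᵥ ψ)) = 0 := hO3
  have e_φAHφ : star (A *ᵥ ψ) ⬝ᵥ (Aᴴ *ᵥ (A *ᵥ ψ)) = 0 := by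
    rw [star_dotProduct_conjTranspose_mulVec', e_φAφ, star_zero]
  have e_ψAψ : star ψ ⬝ᵥ (Aᴴ *ᵥ ψ) = 0 := by
    rw [star_dotProduct_conjTranspose_mulVec', e_ψφ, star_zero]
  have e_ψHψ : star ψ ⬝ᵥ (H *ᵥ ψ) = (E : ℂ) := by
    rw [hHψ, dotProduct_smul, hψ, smul_eq_mul, mul_one]
  have e_φHψ : star (A *ᵥ ψ) ⬝ᵥ (H *ᵥ ψ) = 0 := by
    rw [hHψ, dotProduct_smul, e_φψ, smul_zero]
  have e_ψHφ : star ψ ⬝ᵥ (H *ᵥ (A *ᵥ ψ)) = 0 := by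
    rw [← hHH, star_dotProduct_conjTranspose_mulVec', e_φHψ, star_zero]
  refine ⟨((c : ℝ) : ℂ) • (ψ + ((d : ℝ) : ℂ) • (A *ᵥ ψ)), ?_, ?_, ?_⟩
  · -- normalisation
    rw [normForm_expand, hψ, e_ψφ, e_φψ, e_φAψ]
    have : ((c : ℝ) : ℂ) ^ 2 * (1 + ((d : ℝ) : ℂ) * 0 + ((d : ℝ) : ℂ) * 0 + ((d : ℝ) : ℂ) ^ 2 * (P : ℂ)) =
        (((c ^ 2 * (1 + d ^ 2 * P)) : ℝ) : ℂ) := by push_cast; ring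
    rw [this, hd2, hc2]
    norm_num
  · -- pair amplitude
    rw [quadForm_expand]
    simp only [add_mulVec, dotProduct_add, e_ψφ, e_ψAψ, e_ψAφ, e_ψAHφ, e_φAψ, e_φAHψ, e_φAφ, e_φAHφ]
    have : ((c : ℝ) : ℂ) ^ 2 * (0 + 0 + ((d : ℝ) : ℂ) * (0 + (P : ℂ)) + ((d : ℝ) : ℂ) * ((P : ℂ) + 0) +
        ((d : ℝ) : ℂ) ^ 2 * (0 + 0)) = (((c ^ 2 * (2 * (d * P))) : ℝ) : ℂ) := by push_cast; ring
    rw [this, Complex.ofReal_re, hdP, hc2, show (1 / 2 : ℝ) * (2 * Real.sqrt P) = Real.sqrt P by ring,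
      Real.sq_sqrt hP.le]
  · -- energy
    have hex := excess_energy_le_norm_double_commutator (A := A) hH hfloor hψ hHψ
    rw [quadForm_expand, e_ψHψ, e_ψHφ, e_φHψ]
    set X : ℝ := (star (A *ᵥ ψ) ⬝ᵥ (H *ᵥ (A *ᵥ ψ))).re with hX
    have hre : (((c : ℝ) : ℂ) ^ 2 * ((E : ℂ) + ((d : ℝ) : ℂ) * 0 + ((d : ℝ) : ℂ) * 0 +
        ((d : ℝ) : ℂ) ^ 2 * (star (A *ᵥ ψ) ⬝ᵥ (H *ᵥ (A *ᵥ ψ))))).re = c ^ 2 * (E + d ^ 2 * X) := by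
      have h1 : ((c : ℝ) : ℂ) ^ 2 * ((E : ℂ) + ((d : ℝ) : ℂ) * 0 + ((d : ℝ) : ℂ) * 0 +
          ((d : ℝ) : ℂ) ^ 2 * (star (A *ᵥ ψ) ⬝ᵥ (H *ᵥ (A *ᵥ ψ)))) =
          ((c ^ 2 : ℝ) : ℂ) * ((E : ℂ) + ((d ^ 2 : ℝ) : ℂ) * (star (A *ᵥ ψ) ⬝ᵥ (H *ᵥ (A *ᵥ ψ)))) := by
        push_cast; ring
      rw [h1, Complex.re_ofReal_mul, Complex.add_re, Complex.ofReal_re, Complex.re_ofReal_mul, ← hX]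
    rw [hre, hc2]
    have hd2' : d ^ 2 = 1 / P := by
      rw [eq_div_iff hP.ne']; exact hd2
    have hrw : 1 / 2 * (E + 1 / P * X) = E / 2 + X / (2 * P) := by
      field_simp
    rw [hd2', sub_le_iff_le_add, hrw]
    have h2P : (0 : ℝ) < 2 * P := by positivity
    have hXle : X / (2 * P) ≤ (‖Aᴴ * (H * A - A * H) - (H * A - A * H) * Aᴴ‖ + E * P) / (2 * P) := by
      apply div_le_div_of_nonneg_right _ h2P.le
      linarith
    have hsplit : (‖Aᴴ * (H * A - A * H) - (H * A - A * H) * Aᴴ‖ + E * P) / (2 * P) =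
        ‖Aᴴ * (H * A - A * H) - (H * A - A * H) * Aᴴ‖ / (2 * P) + E / 2 := by
      field_simp
    rw [hsplit] at hXle
    linarith

end KLS

section GCLRO

open scoped Matrix.Norms.L2Operator ComplexOrder

/-- The double commutator `[Δ_dᴴ, [H, Δ_d]]` of the `L`-torus (its norm is `O(L²)` by graded
locality; that estimate is NOT formalised here and enters the ceiling only through this norm). -/
def dWaveDoubleCommutator (L : ℕ) [NeZero L] (U μ : ℝ) :
    Matrix (Finset (Orb (FermionTorus 2 L))) (Finset (Orb (FermionTorus 2 L))) ℂ :=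
  (pairField dWaveFormFactor L)ᴴ *
      (hubbardTorusWith 2 L 1 U μ * pairField dWaveFormFactor L -
        pairField dWaveFormFactor L * hubbardTorusWith 2 L 1 U μ) -
    (hubbardTorusWith 2 L 1 U μ * pairField dWaveFormFactor L -
        pairField dWaveFormFactor L * hubbardTorusWith 2 L 1 U μ) * (pairField dWaveFormFactor L)ᴴ

/-- **GC-exposed LRO bound** (consequence of the crux): in the crux's regime, every `N`-particle
(`N ≥ 4`) unit GLOBAL ground vector `ψ` of `H = hubbardTorusWith 2 L 1 U μ` (`Hψ = Eψ`, `H ≥ E`)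
has `d`-wave order `P = ⟨ψ, Δ_dᴴΔ_d ψ⟩` obeying
`P² ≤ 2K‖[Δ_dᴴ,[H,Δ_d]]‖ + 4K(L² log 4/β)·P`, `K = C(1+log β)L²`. With `‖[Δ_dᴴ,[H,Δ_d]]‖ ≤ κ L²`
this reads `(P/L⁴)² ≤ 2C(1+log β)κ/L⁴ + 4C(1+log β)(log 4/β)(P/L⁴)`: an exponential ceiling
`e^{−a/U}` on GC-exposed ground-state `d`-wave LRO, from inertness ALONE. -/
def TwGcGroundStateLROBound : Prop :=
  ∀ μ₁ μ₂ : ℝ, -4 < μ₁ → μ₁ ≤ μ₂ → μ₂ < 0 → ∃ U₀ a C : ℝ, 0 < U₀ ∧ 0 < a ∧ 0 < C ∧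
    ∀ U : ℝ, 0 < U → U ≤ U₀ → ∀ β : ℝ, 1 ≤ β → β ≤ Real.exp (a / U) → ∀ μ ∈ Set.Icc μ₁ μ₂,
      ∃ L₀ : ℕ, ∀ (L : ℕ) [NeZero L], L₀ ≤ L →
        ∀ (M : ℕ) (E : ℝ) (ψ : Fock (Orb (FermionTorus 2 L))), star ψ ⬝ᵥ ψ = 1 →
          IsNParticle (M + 4) ψ → hubbardTorusWith 2 L 1 U μ *ᵥ ψ = (E : ℂ) • ψ →
          (∀ x, E * (star x ⬝ᵥ x).re ≤ (star x ⬝ᵥ hubbardTorusWith 2 L 1 U μ *ᵥ x).re) →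
          (star ψ ⬝ᵥ ((pairField dWaveFormFactor L)ᴴ * pairField dWaveFormFactor L) *ᵥ ψ).re ^ 2 ≤
            2 * (C * (1 + Real.log β) * (L : ℝ) ^ 2) * ‖dWaveDoubleCommutator L U μ‖ +
              4 * (C * (1 + Real.log β) * (L : ℝ) ^ 2) * ((L : ℝ) ^ 2 * Real.log 4 / β) *
                (star ψ ⬝ᵥ ((pairField dWaveFormFactor L)ᴴ * pairField dWaveFormFactor L) *ᵥ ψ).re

/-- **The crux implies the GC-exposed LRO bound** (KLS trial state + entropy sandwich). -/
theorem gcLRO_bound_of_inertness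
    (hI : Summit.HubbardSuperconductivity.HubbardSuperconductivity.Theses.ThermalWedge.TwSourcedInertness) :
    TwGcGroundStateLROBound := by
  intro μ₁ μ₂ h1 h2 h3
  obtain ⟨U₀, a, C, hU₀, ha, hC, hmain⟩ := hI μ₁ μ₂ h1 h2 h3
  refine ⟨U₀, a, C, hU₀, ha, hC, ?_⟩
  intro U hU hUU₀ β hβ hβa μ hμ
  obtain ⟨L₀, hL⟩ := hmain U hU hUU₀ β hβ hβa μ hμ
  refine ⟨L₀, fun L _ hLL M E ψ hψ hN hHψ hfloor => ?_⟩
  set Δ := pairField dWaveFormFactor L with hΔ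
  set H := hubbardTorusWith 2 L 1 U μ with hH
  have hβ0 : 0 < β := by linarith
  have hL2 : (0 : ℝ) < (L : ℝ) ^ 2 := by
    have : (0 : ℝ) < (L : ℝ) := by exact_mod_cast Nat.pos_of_ne_zero (NeZero.ne L)
    positivity
  have hlog : 0 < 1 + Real.log β := by have := Real.log_nonneg hβ; linarith
  have hK : 0 < C * (1 + Real.log β) * (L : ℝ) ^ 2 := by positivity
  set K := C * (1 + Real.log β) * (L : ℝ) ^ 2 with hKdef
  -- P = ‖Δψ‖² ≥ 0
  have hPeq : star ψ ⬝ᵥ ((Δᴴ * Δ) *ᵥ ψ) = star (Δ *ᵥ ψ) ⬝ᵥ (Δ *ᵥ ψ) := by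
    rw [← mulVec_mulVec, ← star_mulVec_dotProduct]
  set P : ℝ := (star ψ ⬝ᵥ ((Δᴴ * Δ) *ᵥ ψ)).re with hPdef
  have hP' : (star (Δ *ᵥ ψ) ⬝ᵥ (Δ *ᵥ ψ)).re = P := by rw [hPdef, hPeq]
  have hPnn : 0 ≤ P := by
    rw [← hP']
    exact (Complex.nonneg_iff.mp (dotProduct_star_self_nonneg (Δ *ᵥ ψ))).1
  have hnorm : 0 ≤ ‖dWaveDoubleCommutator L U μ‖ := norm_nonneg _
  have hΛ : 0 ≤ (L : ℝ) ^ 2 * Real.log 4 / β := by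
    have : 0 ≤ Real.log 4 := Real.log_nonneg (by norm_num)
    positivity
  rcases hPnn.eq_or_lt with hP0 | hPpos
  · -- P = 0: trivial
    rw [← hP0]
    nlinarith
  -- the KLS trial state
  have hO1 : star ψ ⬝ᵥ (Δ *ᵥ ψ) = 0 := star_dotProduct_pairField_mulVec_self_eq_zero hN
  have hΔψ : IsNParticle (M + 2) (Δ *ᵥ ψ) := isNParticle_pairField_dWave_mulVec hN
  have hΔΔψ : IsNParticle M (Δ *ᵥ (Δ *ᵥ ψ)) := isNParticle_pairField_dWave_mulVec hΔψ
  have hO2 : star ψ ⬝ᵥ (Δ *ᵥ (Δ *ᵥ ψ)) = 0 := IsNParticle.dotProduct_eq_zero hN hΔΔψ (by omega)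
  have hO3 : star (Δ *ᵥ ψ) ⬝ᵥ (Δ *ᵥ (Δ *ᵥ ψ)) = 0 :=
    IsNParticle.dotProduct_eq_zero hΔψ hΔΔψ (by omega)
  have hPpos' : 0 < (star (Δ *ᵥ ψ) ⬝ᵥ (Δ *ᵥ ψ)).re := by rw [hP']; exact hPpos
  obtain ⟨v, hv, hm, hE⟩ := kls_trial_state (isHermitian_hubbardTorusWith L U μ) hfloor hψ hHψ
    hO1 hO2 hO3 hPpos'
  rw [hP'] at hm hE
  -- the entropy sandwich for v
  have hcrux : ∀ h : ℝ, sourcedPressure L β U μ h - sourcedPressure L β U μ 0 ≤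
      C * (1 + Real.log β) * h ^ 2 := fun h => hL L hLL h
  have key := sq_le_of_gain_le_quadratic' (isHermitian_hubbardTorusWith L U μ)
    (isHermitian_pairSource L) hβ0 hK (gain_le_of_crux L hβ0 hcrux) hfloor hv
  rw [log_card_fock] at key
  have hm' : (star v ⬝ᵥ pairSource L *ᵥ v).re ^ 2 = P := hm
  rw [hm'] at key
  -- P ≤ 4K((R−E) + L²Λ/β) and R − E ≤ ‖D‖/(2P)  ⇒  P² ≤ 2K‖D‖ + 4K(L²Λ/β)P
  have hD : (star v ⬝ᵥ hubbardTorusWith 2 L 1 U μ *ᵥ v).re - E ≤ ‖dWaveDoubleCommutator L U μ‖ / (2 * P) :=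
    hE
  have h4K : 0 ≤ 4 * K := by positivity
  have step : P ≤ 4 * K * (‖dWaveDoubleCommutator L U μ‖ / (2 * P) + (L : ℝ) ^ 2 * Real.log 4 / β) := by
    calc P ≤ 4 * K * ((star v ⬝ᵥ hubbardTorusWith 2 L 1 U μ *ᵥ v).re - E + (L : ℝ) ^ 2 * Real.log 4 / β) :=
          key
      _ ≤ _ := by gcongr
  have hmul := mul_le_mul_of_nonneg_left step hPpos.le
  have hrhs : P * (4 * K * (‖dWaveDoubleCommutator L U μ‖ / (2 * P) + (L : ℝ) ^ 2 * Real.log 4 / β)) =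
      2 * K * ‖dWaveDoubleCommutator L U μ‖ + 4 * K * ((L : ℝ) ^ 2 * Real.log 4 / β) * P := by
    field_simp
    ring
  rw [hrhs] at hmul
  nlinarith


end GCLRO

/-! ## §G The double commutator `[Δ_dᴴ,[H,Δ_d]]` is `O(L²)` (graded locality) — makes §F explicit

All CAR-subalgebra memberships are proved GENERICALLY (over any finite `Λ`) and only instantiated on
the torus: at the concrete orbital type `Orb (FermionTorus 2 L)` the two `DecidableEq` instance paths
make `Subalgebra.*_mem _` elaboration time out (cf. the design note of `ReducedBCSTorus.lean`). -/

section CarGeneric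

variable {Λ : Type*} [LinearOrder Λ] [Fintype Λ]

/-- `orbSet` is monotone. -/
theorem orbSet_mono_local {X Y : Finset Λ} (h : X ⊆ Y) : orbSet X ⊆ orbSet Y :=
  fun k hk => by rw [mem_orbSet] at hk ⊢; exact h hk

/-- `c_i c_j` is even. -/
theorem annihilation_mul_annihilation_mem_carEvenSubalgebra' {S : Finset (Orb Λ)} {i j : Orb Λ}
    (hi : i ∈ S) (hj : j ∈ S) : annihilation i * annihilation j ∈ carEvenSubalgebra S :=
  Algebra.subset_adjoin ⟨(i, false), (j, false), hi, hj, rfl⟩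

/-- `c†_i c†_j` is even. -/
theorem creation_mul_creation_mem_carEvenSubalgebra' {S : Finset (Orb Λ)} {i j : Orb Λ}
    (hi : i ∈ S) (hj : j ∈ S) : creation i * creation j ∈ carEvenSubalgebra S :=
  Algebra.subset_adjoin ⟨(i, true), (j, true), hi, hj, rfl⟩

/-- A generic singlet-pair sum `Σ_e κ_e (c_{X↑} c_{Y_e↓} − c_{X↓} c_{Y_e↑})` is even on any site set
containing `X` and the `Y_e`. -/
theorem pairSum_mem_carEvenSubalgebra {τ : Type*} (T : Finset τ) (κ : τ → ℝ) (X : Λ) (Y : τ → Λ)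
    {S : Finset Λ} (hX : X ∈ S) (hY : ∀ e ∈ T, Y e ∈ S) :
    (∑ e ∈ T, ((κ e : ℝ) : ℂ) •
        (annihilation (orb X 0) * annihilation (orb (Y e) 1) -
          annihilation (orb X 1) * annihilation (orb (Y e) 0))) ∈ carEvenSubalgebra (orbSet S) := by
  refine Subalgebra.sum_mem _ fun e he => Subalgebra.smul_mem _ (Subalgebra.sub_mem _ ?_ ?_) _
  · exact annihilation_mul_annihilation_mem_carEvenSubalgebra' (orb_mem_orbSet hX _)
      (orb_mem_orbSet (hY e he) _)
  · exact annihilation_mul_annihilation_mem_carEvenSubalgebra' (orb_mem_orbSet hX _)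
      (orb_mem_orbSet (hY e he) _)

/-- … and so is its adjoint. -/
theorem pairSum_conjTranspose_mem_carEvenSubalgebra {τ : Type*} (T : Finset τ) (κ : τ → ℝ) (X : Λ)
    (Y : τ → Λ) {S : Finset Λ} (hX : X ∈ S) (hY : ∀ e ∈ T, Y e ∈ S) :
    (∑ e ∈ T, ((κ e : ℝ) : ℂ) •
        (annihilation (orb X 0) * annihilation (orb (Y e) 1) -
          annihilation (orb X 1) * annihilation (orb (Y e) 0)))ᴴ ∈ carEvenSubalgebra (orbSet S) := by
  rw [conjTranspose_sum]
  refine Subalgebra.sum_mem _ fun e he => ?_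
  rw [conjTranspose_smul, conjTranspose_sub, conjTranspose_mul, conjTranspose_mul,
    annihilation_conjTranspose, annihilation_conjTranspose, annihilation_conjTranspose,
    annihilation_conjTranspose]
  refine Subalgebra.smul_mem _ (Subalgebra.sub_mem _ ?_ ?_) _
  · exact creation_mul_creation_mem_carEvenSubalgebra' (orb_mem_orbSet (hY e he) _)
      (orb_mem_orbSet hX _)
  · exact creation_mul_creation_mem_carEvenSubalgebra' (orb_mem_orbSet (hY e he) _)
      (orb_mem_orbSet hX _)

variable (G : SimpleGraph Λ) [DecidableRel G.Adj]

/-- **`[H, A]` is localised in any set containing all term supports meeting the support of `A`.** -/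
theorem commutator_mem_carSubalgebra (t U μ : ℝ) {W N : Finset Λ} (hWN : W ⊆ N)
    (hN : ∀ Z : HubbardIdx G, ¬ Disjoint (hubbardTermSupp G Z) W → hubbardTermSupp G Z ⊆ N)
    {A : Matrix (Finset (Orb Λ)) (Finset (Orb Λ)) ℂ} (hA : A ∈ carSubalgebra (orbSet W)) :
    hamiltonianWith G t U μ * A - A * hamiltonianWith G t U μ ∈ carSubalgebra (orbSet N) := by
  have hA' : A ∈ carSubalgebra (orbSet N) := carSubalgebra_mono (orbSet_mono_local hWN) hA
  rw [← sum_hubbardTermOp G t U μ, finset_sum_commutator]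
  refine Subalgebra.sum_mem _ fun Z _ => ?_
  by_cases hZ : Disjoint (hubbardTermSupp G Z) W
  · rw [(commute_hubbardTermOp_of_disjoint G t U μ Z hA hZ).eq, sub_self]
    exact Subalgebra.zero_mem _
  · have hT : hubbardTermOp G t U μ Z ∈ carSubalgebra (orbSet N) :=
      carSubalgebra_mono (orbSet_mono_local (hN Z hZ))
        (carEvenSubalgebra_le_carSubalgebra _ (hubbardTermOp_mem_carEvenSubalgebra G t U μ Z))
    exact Subalgebra.sub_mem _ (Subalgebra.mul_mem _ hT hA') (Subalgebra.mul_mem _ hA' hT)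

end CarGeneric

section DoubleCommutator

variable (L : ℕ) [NeZero L]

/-- The site of the local pair `P_x` displaced by `e`. -/
def pairSite (x : TorusSite 2 L) (e : Site 2) : FermionTorus 2 L :=
  FermionTorus.ofTorusSite (x + Torus.proj L e)

/-- The (at most six) sites carrying the local `d`-wave pair operator `P_x`. -/
def pairSupp (x : TorusSite 2 L) : Finset (FermionTorus 2 L) :=
  insert (FermionTorus.ofTorusSite x) ((insert (0 : Site 2) unitSteps).image (pairSite L x))

theorem ofTorusSite_mem_pairSupp (x : TorusSite 2 L) : FermionTorus.ofTorusSite x ∈ pairSupp L x :=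
  Finset.mem_insert_self _ _

theorem pairSite_mem_pairSupp (x : TorusSite 2 L) {e : Site 2} (he : e ∈ insert (0 : Site 2) unitSteps) :
    pairSite L x e ∈ pairSupp L x :=
  Finset.mem_insert_of_mem (Finset.mem_image_of_mem _ he)

omit [NeZero L] in
theorem card_insert_zero_unitSteps_le : (insert (0 : Site 2) unitSteps).card ≤ 5 := by
  refine (Finset.card_insert_le _ _).trans ?_
  have : unitSteps.card ≤ 4 := by
    unfold unitSteps
    refine (Finset.card_insert_le _ _).trans ?_
    refine (Nat.succ_le_succ (Finset.card_insert_le _ _)).trans ?_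
    refine (Nat.succ_le_succ (Nat.succ_le_succ (Finset.card_insert_le _ _))).trans ?_
    rw [Finset.card_singleton]
  omega

theorem card_pairSupp_le (x : TorusSite 2 L) : (pairSupp L x).card ≤ 6 := by
  unfold pairSupp
  refine (Finset.card_insert_le _ _).trans ?_
  have h1 := Finset.card_image_le (f := pairSite L x) (s := insert (0 : Site 2) unitSteps)
  have h2 := card_insert_zero_unitSteps_le
  omega

/-- **`P_x` is an even element of the CAR algebra of its sites.** -/
theorem localPair_mem_carEvenSubalgebra (x : TorusSite 2 L) :
    localPair dWaveFormFactor L x ∈ carEvenSubalgebra (orbSet (pairSupp L x)) :=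
  pairSum_mem_carEvenSubalgebra (insert (0 : Site 2) unitSteps) (fun e => dWaveFormFactor e / Real.sqrt 2)
    (FermionTorus.ofTorusSite x) (pairSite L x) (ofTorusSite_mem_pairSupp L x)
    (fun _ he => pairSite_mem_pairSupp L x he)

/-- **`P_xᴴ` is an even element of the CAR algebra of its sites.** -/
theorem localPair_conjTranspose_mem_carEvenSubalgebra (x : TorusSite 2 L) :
    (localPair dWaveFormFactor L x)ᴴ ∈ carEvenSubalgebra (orbSet (pairSupp L x)) :=
  pairSum_conjTranspose_mem_carEvenSubalgebra (insert (0 : Site 2) unitSteps)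
    (fun e => dWaveFormFactor e / Real.sqrt 2) (FermionTorus.ofTorusSite x) (pairSite L x)
    (ofTorusSite_mem_pairSupp L x) (fun _ he => pairSite_mem_pairSupp L x he)

open Classical in
/-- The closed graph neighbourhood of the support of `P_x`. -/
def pairNbhd (x : TorusSite 2 L) : Finset (FermionTorus 2 L) :=
  Finset.univ.filter fun z => ∃ w ∈ pairSupp L x, z = w ∨ (fermionTorusGraph 2 L).Adj z w

theorem pairSupp_subset_pairNbhd (x : TorusSite 2 L) : pairSupp L x ⊆ pairNbhd L x := by
  intro w hw
  unfold pairNbhd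
  simp only [Finset.mem_filter, Finset.mem_univ, true_and]
  exact ⟨w, hw, Or.inl rfl⟩

/-- A Hubbard term meeting the support of `P_x` lives inside its closed neighbourhood. -/
theorem hubbardTermSupp_subset_pairNbhd {x : TorusSite 2 L} (Z : HubbardIdx (fermionTorusGraph 2 L))
    (hZ : ¬ Disjoint (hubbardTermSupp (fermionTorusGraph 2 L) Z) (pairSupp L x)) :
    hubbardTermSupp (fermionTorusGraph 2 L) Z ⊆ pairNbhd L x := by
  rw [Finset.not_disjoint_iff] at hZ
  obtain ⟨w, hwZ, hwS⟩ := hZ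
  intro z hz
  unfold pairNbhd
  simp only [Finset.mem_filter, Finset.mem_univ, true_and]
  exact ⟨w, hwS, eq_or_adj_of_mem_hubbardTermSupp (fermionTorusGraph 2 L) hz hwZ⟩

/-- **`[H, P_x]` lives in the CAR algebra of the closed neighbourhood of the support of `P_x`.** -/
theorem commutator_localPair_mem_carSubalgebra (U μ : ℝ) (x : TorusSite 2 L) :
    hubbardTorusWith 2 L 1 U μ * localPair dWaveFormFactor L x -
        localPair dWaveFormFactor L x * hubbardTorusWith 2 L 1 U μ ∈
      carSubalgebra (orbSet (pairNbhd L x)) :=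
  commutator_mem_carSubalgebra (fermionTorusGraph 2 L) 1 U μ (pairSupp_subset_pairNbhd L x)
    (fun Z hZ => hubbardTermSupp_subset_pairNbhd L Z hZ)
    (carEvenSubalgebra_le_carSubalgebra _ (localPair_mem_carEvenSubalgebra L x))

/-- Graded locality: `[P_yᴴ, [H, P_x]] = 0` unless the support of `P_y` meets the neighbourhood
of the support of `P_x`. -/
theorem double_commutator_term_eq_zero (U μ : ℝ) {x y : TorusSite 2 L}
    (h : Disjoint (pairSupp L y) (pairNbhd L x)) :
    (localPair dWaveFormFactor L y)ᴴ *
        (hubbardTorusWith 2 L 1 U μ * localPair dWaveFormFactor L x -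
          localPair dWaveFormFactor L x * hubbardTorusWith 2 L 1 U μ) -
      (hubbardTorusWith 2 L 1 U μ * localPair dWaveFormFactor L x -
          localPair dWaveFormFactor L x * hubbardTorusWith 2 L 1 U μ) *
        (localPair dWaveFormFactor L y)ᴴ = 0 :=
  sub_eq_zero.mpr (commute_of_mem_carEvenSubalgebra (localPair_conjTranspose_mem_carEvenSubalgebra L y)
    (commutator_localPair_mem_carSubalgebra L U μ x) (disjoint_orbSet h)).eq

/-! ### Counting the `y` whose pair support meets the neighbourhood of `P_x` -/

theorem toTorusSite_pairSite (x : TorusSite 2 L) (e : Site 2) :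
    (pairSite L x e).toTorusSite = x + Torus.proj L e := by
  simp [pairSite]

omit [NeZero L] in
theorem proj_zero : Torus.proj L (0 : Site 2) = 0 := by
  funext i; simp [Torus.proj]

/-- Torus positions of the support of `P_y`: `y + proj e`, `e ∈ {0, ±e₁, ±e₂}`. -/
theorem exists_of_mem_pairSupp {y : TorusSite 2 L} {w : FermionTorus 2 L} (hw : w ∈ pairSupp L y) :
    ∃ e ∈ insert (0 : Site 2) unitSteps, w.toTorusSite = y + Torus.proj L e := by
  unfold pairSupp at hw
  rcases Finset.mem_insert.mp hw with rfl | hw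
  · exact ⟨0, Finset.mem_insert_self _ _, by rw [proj_zero, add_zero]; simp⟩
  · obtain ⟨e, he, rfl⟩ := Finset.mem_image.mp hw
    exact ⟨e, he, toTorusSite_pairSite L y e⟩

/-- The unit displacements `0, ±eᵢ` of the torus. -/
def unitDisp : Finset (TorusSite 2 L) :=
  insert 0 ((Finset.univ : Finset (Fin 2 × Bool)).image fun p =>
    if p.2 then (Pi.single p.1 1 : TorusSite 2 L) else -Pi.single p.1 1)

omit [NeZero L] in
theorem card_unitDisp_le : (unitDisp L).card ≤ 5 := by
  unfold unitDisp
  refine (Finset.card_insert_le _ _).trans ?_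
  have := Finset.card_image_le (s := (Finset.univ : Finset (Fin 2 × Bool)))
    (f := fun p : Fin 2 × Bool => if p.2 then (Pi.single p.1 1 : TorusSite 2 L) else -Pi.single p.1 1)
  have hc : (Finset.univ : Finset (Fin 2 × Bool)).card = 4 := by simp
  omega

omit [NeZero L] in
/-- Two sites that coincide or are adjacent differ by a unit displacement. -/
theorem exists_unitDisp_of_eq_or_adj {z w : FermionTorus 2 L} (h : z = w ∨ (fermionTorusGraph 2 L).Adj z w) :
    ∃ δ ∈ unitDisp L, z.toTorusSite = w.toTorusSite + δ := by
  rcases h with rfl | h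
  · exact ⟨0, Finset.mem_insert_self _ _, by rw [add_zero]⟩
  · rw [fermionTorusGraph_adj, torusGraph_adj_iff] at h
    obtain ⟨-, ⟨i, hi⟩ | ⟨i, hi⟩⟩ := h
    · refine ⟨-Pi.single i 1, ?_, ?_⟩
      · exact Finset.mem_insert_of_mem (Finset.mem_image.mpr ⟨(i, false), Finset.mem_univ _, rfl⟩)
      · rw [hi]; abel
    · refine ⟨Pi.single i 1, ?_, hi⟩
      exact Finset.mem_insert_of_mem (Finset.mem_image.mpr ⟨(i, true), Finset.mem_univ _, rfl⟩)

/-- The candidate set containing every `y` whose pair support meets the neighbourhood of `P_x`. -/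
def badCandidates (x : TorusSite 2 L) : Finset (TorusSite 2 L) :=
  ((insert (0 : Site 2) unitSteps) ×ˢ unitDisp L ×ˢ (insert (0 : Site 2) unitSteps)).image
    fun t => x + Torus.proj L t.1 + t.2.1 - Torus.proj L t.2.2

omit [NeZero L] in
theorem card_badCandidates_le (x : TorusSite 2 L) : (badCandidates L x).card ≤ 125 := by
  unfold badCandidates
  refine (Finset.card_image_le).trans ?_
  rw [Finset.card_product, Finset.card_product]
  have h5 := card_insert_zero_unitSteps_le
  have hD := card_unitDisp_le L
  calc (insert (0 : Site 2) unitSteps).card * ((unitDisp L).card * (insert (0 : Site 2) unitSteps).card)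
      ≤ 5 * (5 * 5) := Nat.mul_le_mul h5 (Nat.mul_le_mul hD h5)
    _ = 125 := by norm_num

/-- If the support of `P_y` meets the neighbourhood of `P_x` then `y` is a candidate. -/
theorem mem_badCandidates {x y : TorusSite 2 L} (h : ¬ Disjoint (pairSupp L y) (pairNbhd L x)) :
    y ∈ badCandidates L x := by
  rw [Finset.not_disjoint_iff] at h
  obtain ⟨w, hwy, hwx⟩ := h
  obtain ⟨e, he, hwe⟩ := exists_of_mem_pairSupp L hwy
  unfold pairNbhd at hwx
  simp only [Finset.mem_filter, Finset.mem_univ, true_and] at hwx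
  obtain ⟨w', hw', hrel⟩ := hwx
  obtain ⟨e', he', hw'e⟩ := exists_of_mem_pairSupp L hw'
  obtain ⟨δ, hδ, hδe⟩ := exists_unitDisp_of_eq_or_adj L hrel
  unfold badCandidates
  refine Finset.mem_image.mpr ⟨(e', δ, e), ?_, ?_⟩
  · exact Finset.mem_product.mpr ⟨he', Finset.mem_product.mpr ⟨hδ, he⟩⟩
  · have : y + Torus.proj L e = x + Torus.proj L e' + δ := by rw [← hwe, hδe, hw'e]
    simp only
    rw [← this]
    abel

end DoubleCommutator

section DoubleCommutatorNorms
open scoped Matrix.Norms.L2Operator ComplexOrder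

variable (L : ℕ) [NeZero L]

/-- **`‖[H, P_x]‖ ≤ 54 · 2(2 + |U| + 2|μ|) · 4√2`**, uniformly in `L` and `x`. -/
theorem norm_commutator_localPair_le (U μ : ℝ) (x : TorusSite 2 L) :
    ‖hubbardTorusWith 2 L 1 U μ * localPair dWaveFormFactor L x -
        localPair dWaveFormFactor L x * hubbardTorusWith 2 L 1 U μ‖ ≤
      54 * (2 * (2 + |U| + 2 * |μ|) * (4 * Real.sqrt 2)) := by
  have hA : localPair dWaveFormFactor L x ∈ carSubalgebra (orbSet (pairSupp L x)) :=
    carEvenSubalgebra_le_carSubalgebra _ (localPair_mem_carEvenSubalgebra L x)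
  have h := norm_commutator_hamiltonianWith_le (fermionTorusGraph 2 L) (Δ := 4)
    (fun v => SourceGas.card_filter_fermionTorusGraph_adj_le v) 1 U μ hA
  rw [hubbardTorusWith]
  refine h.trans ?_
  have hcard : ((pairSupp L x).card * (2 * 4 + 1) : ℕ) ≤ 54 := by
    have := card_pairSupp_le L x
    omega
  have hP := norm_localPair_dWave_le L x
  have hnn : 0 ≤ 2 * (2 * |(1 : ℝ)| + |U| + 2 * |μ|) := by positivity
  calc (((pairSupp L x).card * (2 * 4 + 1) : ℕ) : ℝ) * (2 * (2 * |(1 : ℝ)| + |U| + 2 * |μ|) *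
        ‖localPair dWaveFormFactor L x‖)
      ≤ (54 : ℝ) * (2 * (2 * |(1 : ℝ)| + |U| + 2 * |μ|) * (4 * Real.sqrt 2)) := by
        apply mul_le_mul (by exact_mod_cast hcard) (mul_le_mul_of_nonneg_left hP hnn)
          (by positivity) (by norm_num)
    _ = 54 * (2 * (2 + |U| + 2 * |μ|) * (4 * Real.sqrt 2)) := by rw [abs_one]; ring

/-- The constant of the double-commutator bound: `κ(U,μ) = 125 · 2 · 4√2 · 54 · 2(2+|U|+2|μ|) · 4√2`. -/
def dcConst (U μ : ℝ) : ℝ :=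
  125 * (2 * (4 * Real.sqrt 2) * (54 * (2 * (2 + |U| + 2 * |μ|) * (4 * Real.sqrt 2))))

omit [NeZero L] in
theorem dcConst_nonneg (U μ : ℝ) : 0 ≤ dcConst U μ := by unfold dcConst; positivity

/-- One term of the double sum: `‖[P_yᴴ, [H, P_x]]‖ ≤ 2 ‖P_y‖ ‖[H,P_x]‖ ≤ 2 · 4√2 · (54 · …)`. -/
theorem norm_double_commutator_term_le (U μ : ℝ) (x y : TorusSite 2 L) :
    ‖(localPair dWaveFormFactor L y)ᴴ *
        (hubbardTorusWith 2 L 1 U μ * localPair dWaveFormFactor L x -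
          localPair dWaveFormFactor L x * hubbardTorusWith 2 L 1 U μ) -
      (hubbardTorusWith 2 L 1 U μ * localPair dWaveFormFactor L x -
          localPair dWaveFormFactor L x * hubbardTorusWith 2 L 1 U μ) *
        (localPair dWaveFormFactor L y)ᴴ‖ ≤
      2 * (4 * Real.sqrt 2) * (54 * (2 * (2 + |U| + 2 * |μ|) * (4 * Real.sqrt 2))) := by
  set P := (localPair dWaveFormFactor L y)ᴴ
  set C := hubbardTorusWith 2 L 1 U μ * localPair dWaveFormFactor L x -
          localPair dWaveFormFactor L x * hubbardTorusWith 2 L 1 U μ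
  have hP : ‖P‖ ≤ 4 * Real.sqrt 2 := by
    rw [Matrix.l2_opNorm_conjTranspose]; exact norm_localPair_dWave_le L y
  have hC : ‖C‖ ≤ 54 * (2 * (2 + |U| + 2 * |μ|) * (4 * Real.sqrt 2)) := norm_commutator_localPair_le L U μ x
  calc ‖P * C - C * P‖ ≤ ‖P * C‖ + ‖C * P‖ := norm_sub_le _ _
    _ ≤ ‖P‖ * ‖C‖ + ‖C‖ * ‖P‖ := add_le_add (norm_mul_le _ _) (norm_mul_le _ _)
    _ = 2 * ‖P‖ * ‖C‖ := by ring
    _ ≤ 2 * (4 * Real.sqrt 2) * (54 * (2 * (2 + |U| + 2 * |μ|) * (4 * Real.sqrt 2))) := by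
        gcongr

/-- The double commutator as a double sum of local terms. -/
theorem dWaveDoubleCommutator_eq_sum (U μ : ℝ) :
    dWaveDoubleCommutator L U μ = ∑ y : TorusSite 2 L, ∑ x : TorusSite 2 L,
      ((localPair dWaveFormFactor L y)ᴴ *
          (hubbardTorusWith 2 L 1 U μ * localPair dWaveFormFactor L x -
            localPair dWaveFormFactor L x * hubbardTorusWith 2 L 1 U μ) -
        (hubbardTorusWith 2 L 1 U μ * localPair dWaveFormFactor L x -
            localPair dWaveFormFactor L x * hubbardTorusWith 2 L 1 U μ) *
          (localPair dWaveFormFactor L y)ᴴ) := by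
  have hcomm : hubbardTorusWith 2 L 1 U μ * pairField dWaveFormFactor L -
      pairField dWaveFormFactor L * hubbardTorusWith 2 L 1 U μ =
      ∑ x : TorusSite 2 L, (hubbardTorusWith 2 L 1 U μ * localPair dWaveFormFactor L x -
        localPair dWaveFormFactor L x * hubbardTorusWith 2 L 1 U μ) := by
    rw [pairField, Finset.mul_sum, Finset.sum_mul, ← Finset.sum_sub_distrib]
  have hadj : (pairField dWaveFormFactor L)ᴴ = ∑ y : TorusSite 2 L, (localPair dWaveFormFactor L y)ᴴ := by
    rw [pairField, conjTranspose_sum]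
  rw [dWaveDoubleCommutator, hcomm, hadj, finset_sum_commutator]
  refine Finset.sum_congr rfl fun y _ => ?_
  rw [Finset.mul_sum, Finset.sum_mul, ← Finset.sum_sub_distrib]

/-- **The double commutator is `O(L²)`: `‖[Δ_dᴴ,[H,Δ_d]]‖ ≤ κ(U,μ) · L²`** (graded locality: for each
`x` only the `≤ 125` operators `P_y` whose support meets the neighbourhood of `P_x` contribute). -/
theorem norm_dWaveDoubleCommutator_le (U μ : ℝ) :
    ‖dWaveDoubleCommutator L U μ‖ ≤ dcConst U μ * (L : ℝ) ^ 2 := by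
  set B : ℝ := 2 * (4 * Real.sqrt 2) * (54 * (2 * (2 + |U| + 2 * |μ|) * (4 * Real.sqrt 2))) with hB
  have hBnn : 0 ≤ B := by positivity
  set T : TorusSite 2 L → TorusSite 2 L → Matrix (Finset (Orb (FermionTorus 2 L))) (Finset (Orb (FermionTorus 2 L))) ℂ :=
    fun y x => (localPair dWaveFormFactor L y)ᴴ *
          (hubbardTorusWith 2 L 1 U μ * localPair dWaveFormFactor L x -
            localPair dWaveFormFactor L x * hubbardTorusWith 2 L 1 U μ) -
        (hubbardTorusWith 2 L 1 U μ * localPair dWaveFormFactor L x -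
            localPair dWaveFormFactor L x * hubbardTorusWith 2 L 1 U μ) *
          (localPair dWaveFormFactor L y)ᴴ with hT
  have hsum : dWaveDoubleCommutator L U μ = ∑ y : TorusSite 2 L, ∑ x : TorusSite 2 L, T y x :=
    dWaveDoubleCommutator_eq_sum L U μ
  -- per-x bound on the y-sum
  have hx : ∀ x : TorusSite 2 L, ∑ y : TorusSite 2 L, ‖T y x‖ ≤ 125 * B := by
    intro x
    classical
    have hterm : ∀ y : TorusSite 2 L, ‖T y x‖ ≤ if Disjoint (pairSupp L y) (pairNbhd L x) then 0 else B := by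
      intro y
      by_cases h : Disjoint (pairSupp L y) (pairNbhd L x)
      · rw [if_pos h, show T y x = 0 from double_commutator_term_eq_zero L U μ h, norm_zero]
      · rw [if_neg h]
        exact norm_double_commutator_term_le L U μ x y
    calc ∑ y : TorusSite 2 L, ‖T y x‖
        ≤ ∑ y : TorusSite 2 L, (if Disjoint (pairSupp L y) (pairNbhd L x) then 0 else B) :=
          Finset.sum_le_sum fun y _ => hterm y
      _ = B * ((Finset.univ.filter fun y : TorusSite 2 L => ¬ Disjoint (pairSupp L y) (pairNbhd L x)).card) := by
          rw [Finset.sum_ite, Finset.sum_const_zero, zero_add, Finset.sum_const, nsmul_eq_mul, mul_comm]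
      _ ≤ B * 125 := by
          gcongr
          have hsub : (Finset.univ.filter fun y : TorusSite 2 L => ¬ Disjoint (pairSupp L y) (pairNbhd L x)) ⊆
              badCandidates L x := fun y hy => mem_badCandidates L (Finset.mem_filter.mp hy).2
          exact_mod_cast (Finset.card_le_card hsub).trans (card_badCandidates_le L x)
      _ = 125 * B := mul_comm _ _
  calc ‖dWaveDoubleCommutator L U μ‖ = ‖∑ y : TorusSite 2 L, ∑ x : TorusSite 2 L, T y x‖ := by rw [hsum]
    _ ≤ ∑ y : TorusSite 2 L, ‖∑ x : TorusSite 2 L, T y x‖ := norm_sum_le _ _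
    _ ≤ ∑ y : TorusSite 2 L, ∑ x : TorusSite 2 L, ‖T y x‖ := Finset.sum_le_sum fun y _ => norm_sum_le _ _
    _ = ∑ x : TorusSite 2 L, ∑ y : TorusSite 2 L, ‖T y x‖ := Finset.sum_comm
    _ ≤ ∑ _x : TorusSite 2 L, 125 * B := Finset.sum_le_sum fun x _ => hx x
    _ = 125 * B * (L : ℝ) ^ 2 := by rw [Finset.sum_const, card_univ, nsmul_eq_mul, card_torusSite]; ring
    _ = dcConst U μ * (L : ℝ) ^ 2 := by rw [dcConst, hB]

/-- **EXPLICIT GC-EXPOSED CEILING** (consequence of the crux, fully proved): in the crux's regime,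
every `N ≥ 4`-particle unit global ground vector of `H = hubbardTorusWith 2 L 1 U μ` has
`P² ≤ 2K·κ(U,μ)L² + 4K(L² log 4/β)·P`, `P = ⟨ψ, Δ_dᴴΔ_dψ⟩`, `K = C(1+log β)L²` — i.e.
`(P/L⁴)² ≤ 2C(1+log β)κ(U,μ)/L⁴ + 4C(1+log β)(log 4/β)(P/L⁴)`, an `e^{−a/U}` ceiling as `L → ∞`. -/
def TwGcExplicitCeiling : Prop :=
  ∀ μ₁ μ₂ : ℝ, -4 < μ₁ → μ₁ ≤ μ₂ → μ₂ < 0 → ∃ U₀ a C : ℝ, 0 < U₀ ∧ 0 < a ∧ 0 < C ∧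
    ∀ U : ℝ, 0 < U → U ≤ U₀ → ∀ β : ℝ, 1 ≤ β → β ≤ Real.exp (a / U) → ∀ μ ∈ Set.Icc μ₁ μ₂,
      ∃ L₀ : ℕ, ∀ (L : ℕ) [NeZero L], L₀ ≤ L →
        ∀ (M : ℕ) (E : ℝ) (ψ : Fock (Orb (FermionTorus 2 L))), star ψ ⬝ᵥ ψ = 1 →
          IsNParticle (M + 4) ψ → hubbardTorusWith 2 L 1 U μ *ᵥ ψ = (E : ℂ) • ψ →
          (∀ x, E * (star x ⬝ᵥ x).re ≤ (star x ⬝ᵥ hubbardTorusWith 2 L 1 U μ *ᵥ x).re) →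
          (star ψ ⬝ᵥ ((pairField dWaveFormFactor L)ᴴ * pairField dWaveFormFactor L) *ᵥ ψ).re ^ 2 ≤
            2 * (C * (1 + Real.log β) * (L : ℝ) ^ 2) * (dcConst U μ * (L : ℝ) ^ 2) +
              4 * (C * (1 + Real.log β) * (L : ℝ) ^ 2) * ((L : ℝ) ^ 2 * Real.log 4 / β) *
                (star ψ ⬝ᵥ ((pairField dWaveFormFactor L)ᴴ * pairField dWaveFormFactor L) *ᵥ ψ).re

/-- **The crux implies the explicit GC-exposed exponential ceiling.** -/
theorem gcExplicitCeiling_of_inertness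
    (hI : Summit.HubbardSuperconductivity.HubbardSuperconductivity.Theses.ThermalWedge.TwSourcedInertness) :
    TwGcExplicitCeiling := by
  intro μ₁ μ₂ h1 h2 h3
  obtain ⟨U₀, a, C, hU₀, ha, hC, hmain⟩ := gcLRO_bound_of_inertness hI μ₁ μ₂ h1 h2 h3
  refine ⟨U₀, a, C, hU₀, ha, hC, ?_⟩
  intro U hU hUU₀ β hβ hβa μ hμ
  obtain ⟨L₀, hL⟩ := hmain U hU hUU₀ β hβ hβa μ hμ
  refine ⟨L₀, fun L _ hLL M E ψ hψ hN hHψ hfloor => ?_⟩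
  have key := hL L hLL M E ψ hψ hN hHψ hfloor
  have hD := norm_dWaveDoubleCommutator_le L U μ
  have hlog : 0 < 1 + Real.log β := by have := Real.log_nonneg hβ; linarith
  have hK : 0 ≤ 2 * (C * (1 + Real.log β) * (L : ℝ) ^ 2) := by positivity
  have := mul_le_mul_of_nonneg_left hD hK
  linarith

end DoubleCommutatorNorms

/-! ## §H The exact free gain (BdG formula for `U = 0`, tree `DWaveSourceFreePressure`)

Since 2026-08-15T23:37Z the tree PROVES the closed form of the `U = 0` sourced pressure
(`log_partitionFn_dWaveSourceTorus_zero_sub`, `L ≥ 3`):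
`log Z_L(β,μ,0,s) − log Z_L(β,μ,0,0) = Σ_k [F(βE_k(s)) − F(βξ_k)]`, `F(y) = log((1+cosh y)/2)`,
`ξ_k = ε_L(k) − μ`, `E_k(s)² = ξ_k² + 8 s² ĝ_d(k)²`. Combined with `|p̃(U) − p̃(0)| ≤ |U|`
(`abs_sourcedPressure_interacting_sub_free_le`, Theorems file of the route) every LOWER bound on
the free gain transfers to the interacting gain up to `2|U|`. This section packages the per-mode
gain `modeGain` and its elementary bounds; §I and §J use it. -/

section FreeGain

/-- The BdG level profile `F(y) = log((1 + cosh y)/2) = 2 log cosh(y/2)`. -/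
def bdgF (y : ℝ) : ℝ := Real.log ((1 + Real.cosh y) / 2)

theorem one_le_bdgF_arg (y : ℝ) : 1 ≤ (1 + Real.cosh y) / 2 := by
  have := Real.one_le_cosh y; linarith

theorem bdgF_arg_pos (y : ℝ) : 0 < (1 + Real.cosh y) / 2 :=
  lt_of_lt_of_le one_pos (one_le_bdgF_arg y)

@[simp] theorem bdgF_zero : bdgF 0 = 0 := by simp [bdgF]

theorem bdgF_nonneg (y : ℝ) : 0 ≤ bdgF y := Real.log_nonneg (one_le_bdgF_arg y)

theorem bdgF_neg (y : ℝ) : bdgF (-y) = bdgF y := by simp [bdgF, Real.cosh_neg]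

theorem bdgF_abs (y : ℝ) : bdgF |y| = bdgF y := by
  rcases abs_choice y with h | h
  · rw [h]
  · rw [h, bdgF_neg]

/-- `F` is monotone in `|y|`. -/
theorem bdgF_le_bdgF_of_abs_le {x y : ℝ} (hxy : |x| ≤ |y|) : bdgF x ≤ bdgF y := by
  unfold bdgF
  refine Real.log_le_log (bdgF_arg_pos x) ?_
  have := Real.cosh_le_cosh.mpr hxy
  linarith

/-- Quadratic lower bound `1 + y²/8 ≤ (1 + cosh y)/2` (from `e^t ≥ 1 + t + t²/2`, `e^{-t} ≥ 1 − t`). -/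
theorem one_add_sq_div_eight_le (y : ℝ) : 1 + y ^ 2 / 8 ≤ (1 + Real.cosh y) / 2 := by
  wlog hy : 0 ≤ y generalizing y
  · have h := this (-y) (by linarith)
    rwa [neg_sq, Real.cosh_neg] at h
  have h1 := Real.quadratic_le_exp_of_nonneg hy
  have h2 := Real.add_one_le_exp (-y)
  rw [Real.cosh_eq]
  linarith

/-- The witness value: `1 ≤ F(3√2)` (`(1 + cosh 3√2)/2 ≥ 1 + 18/8 = 13/4 > e`). -/
theorem one_le_bdgF_three_sqrt_two : 1 ≤ bdgF (3 * Real.sqrt 2) := by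
  unfold bdgF
  rw [Real.le_log_iff_exp_le (bdgF_arg_pos _)]
  have h := one_add_sq_div_eight_le (3 * Real.sqrt 2)
  have hsq : (3 * Real.sqrt 2) ^ 2 = 18 := by
    rw [mul_pow, Real.sq_sqrt (by norm_num : (0:ℝ) ≤ 2)]; norm_num
  rw [hsq] at h
  have he := Real.exp_one_lt_d9
  linarith

/-- Doubling inequality `F(2y) ≤ 2F(y) + 2 log 2` (`(1 + cosh 2y)/2 = cosh² y ≤ (1 + cosh y)²`). -/
theorem bdgF_two_mul_le (y : ℝ) : bdgF (2 * y) ≤ 2 * bdgF y + 2 * Real.log 2 := by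
  unfold bdgF
  set A : ℝ := (1 + Real.cosh y) / 2 with hA
  have hApos : 0 < A := bdgF_arg_pos y
  have hrhs : 2 * Real.log A + 2 * Real.log 2 = Real.log (A ^ 2 * 4) := by
    rw [Real.log_mul (pow_ne_zero 2 hApos.ne') (by norm_num), Real.log_pow,
      show (4 : ℝ) = 2 ^ 2 by norm_num, Real.log_pow]
    push_cast
    ring
  rw [hrhs]
  refine Real.log_le_log (bdgF_arg_pos (2 * y)) ?_
  rw [Real.cosh_two_mul]
  have hc := Real.one_le_cosh y
  have hs : Real.sinh y ^ 2 = Real.cosh y ^ 2 - 1 := by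
    have := Real.cosh_sq y; linarith
  rw [hs, hA]
  nlinarith

variable (L : ℕ) [NeZero L]

/-- The per-mode free gain `F(βE_k(s)) − F(βξ_k)` of momentum `k` (notation of
`log_partitionFn_dWaveSourceTorus_zero_sub`). -/
def modeGain (β μ s : ℝ) (k : TorusSite 2 L) : ℝ :=
  bdgF (β * Real.sqrt ((torusBand L k - μ) ^ 2 + (2 * Real.sqrt 2 * s * dWaveGap k) ^ 2)) -
    bdgF (β * (torusBand L k - μ))

/-- **The exact free gain** (`L ≥ 3`):
`p̃_L(β,μ,0,s) − p̃_L(β,μ,0,0) = (βL²)⁻¹ Σ_k modeGain`. -/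
theorem free_gain_eq (hL : 3 ≤ L) (β μ s : ℝ) :
    sourcedPressure L β 0 μ s - sourcedPressure L β 0 μ 0 =
      (∑ k : TorusSite 2 L, modeGain L β μ s k) / (β * (L : ℝ) ^ 2) := by
  rw [sourcedPressure, sourcedPressure, ← sub_div, log_partitionFn_dWaveSourceTorus_zero_sub hL]
  rfl

omit [NeZero L] in
/-- Each mode gains: `modeGain ≥ 0` for `β ≥ 0` (`E_k(s) ≥ |ξ_k|`, `F` monotone in `|y|`). -/
theorem modeGain_nonneg {β : ℝ} (hβ : 0 ≤ β) (μ s : ℝ) (k : TorusSite 2 L) :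
    0 ≤ modeGain L β μ s k := by
  unfold modeGain
  rw [sub_nonneg]
  refine bdgF_le_bdgF_of_abs_le ?_
  rw [abs_mul, abs_mul, abs_of_nonneg hβ, abs_of_nonneg (Real.sqrt_nonneg _)]
  refine mul_le_mul_of_nonneg_left ?_ hβ
  rw [← Real.sqrt_sq_eq_abs]
  exact Real.sqrt_le_sqrt (by nlinarith)

omit [NeZero L] in
/-- A zero mode (`ε_L(k) = μ`) gains `F(β·2√2|s ĝ_d(k)|)`. -/
theorem modeGain_of_level {β μ s : ℝ} {k : TorusSite 2 L} (hk : torusBand L k = μ) :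
    modeGain L β μ s k = bdgF (β * |2 * Real.sqrt 2 * s * dWaveGap k|) := by
  unfold modeGain
  rw [hk, sub_self, mul_zero, bdgF_zero, sub_zero]
  congr 1
  rw [show (0 : ℝ) ^ 2 = 0 by norm_num, zero_add, Real.sqrt_sq_eq_abs]

/-- **One-mode lower bound on the free gain** (`β > 0`, `L ≥ 3`): for every momentum `k₀`,
`modeGain k₀ /(βL²) ≤ p̃_L(β,μ,0,s) − p̃_L(β,μ,0,0)`. -/
theorem modeGain_div_le_free_gain (hL : 3 ≤ L) {β : ℝ} (hβ : 0 < β) (μ s : ℝ) (k₀ : TorusSite 2 L) :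
    modeGain L β μ s k₀ / (β * (L : ℝ) ^ 2) ≤
      sourcedPressure L β 0 μ s - sourcedPressure L β 0 μ 0 := by
  rw [free_gain_eq L hL]
  have hβL : 0 < β * (L : ℝ) ^ 2 := mul_pos hβ (cast_sq_pos_of_neZero L)
  rw [div_le_div_iff_of_pos_right hβL]
  exact Finset.single_le_sum (f := fun k => modeGain L β μ s k)
    (fun k _ => modeGain_nonneg L hβ.le μ s k) (Finset.mem_univ k₀)

/-- **Free-to-interacting transfer**: `G_U(h) ≥ G_0(h) − 2|U|` (all `L`, `β > 0`). -/
theorem free_gain_sub_le_gain (U μ h : ℝ) {β : ℝ} (hβ : 0 < β) :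
    sourcedPressure L β 0 μ h - sourcedPressure L β 0 μ 0 - 2 * |U| ≤
      sourcedPressure L β U μ h - sourcedPressure L β U μ 0 := by
  have h1 := Summit.HubbardSuperconductivity.HubbardSuperconductivity.Theorems.abs_sourcedPressure_interacting_sub_free_le L U μ h hβ
  have h2 := Summit.HubbardSuperconductivity.HubbardSuperconductivity.Theorems.abs_sourcedPressure_interacting_sub_free_le L U μ 0 hβ
  unfold sourcedPressure
  rw [abs_le] at h1 h2
  linarith [h1.1, h2.2]

/-- **The zero-mode witness bound**: on a torus with a level at `μ` through `q`, for `β > 0` and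
every `U`, `F(β·2√2|h ĝ_d(q)|)/(βL²) − 2|U| ≤ G_U(h)`. -/
theorem level_gain_lower_bound (hL : 3 ≤ L) {β : ℝ} (hβ : 0 < β) {μ : ℝ} {q : TorusSite 2 L}
    (hq : torusBand L q = μ) (U h : ℝ) :
    bdgF (β * |2 * Real.sqrt 2 * h * dWaveGap q|) / (β * (L : ℝ) ^ 2) - 2 * |U| ≤
      sourcedPressure L β U μ h - sourcedPressure L β U μ 0 := by
  have h1 := modeGain_div_le_free_gain L hL hβ μ h q
  rw [modeGain_of_level L hq] at h1
  have h2 := free_gain_sub_le_gain L U μ h hβ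
  linarith

end FreeGain

/-! ## §I TARGETS — the lead's registered stubs (skeleton `e54a28ee`, prover-…-ThermalWedge-2)

* `stub_thermalDisc`     = the crux restricted to the thermal disc `|h| ≤ 1/β` (linear-response
  regime); together with `stub_entropyDensity` it implies the crux by the temperature-for-source
  staircase (`Theorems/ThermalWedgeTwSourcedInertnessLadder.lean`).
* `stub_entropyDensity`  = `S_L(β) := log Z + β⟨H⟩ ≤ C L²/β` (entropy density `≤ C·T`) for
  `H = hubbardTorusWith 2 L 1 U μ`, `1 ≤ β ≤ e^{a/U}`, eventually in `L`.

VERDICT: both stubs SURVIVE as stated (they carry `∃ L₀(U,β,μ)`, i.e. they are thermodynamic-limit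
Fermi-liquid statements: `χ_d ≲ ρ_d log β`, `s ≲ γT`). What is proved below is that in BOTH the
threshold `L₀` is load-bearing and must grow with `β` — exactly as for the crux (§D), but now by a
two-line argument from the exact free formula (§H) instead of the shell trial states:
`stub_thermalDisc_false_uniformL0`, `stub_entropyDensity_false_uniformL0` (and the `∀ L ≥ 3`
corollaries). Quantitatively, at `μ = −1` on the `3j`-tori: the thermal-disc bound needs
`L₀(β)² ≳ β/(C(1+log β))` (zero-mode Curie term `F(3√2)/(βL²)` at `h = 1/β`), the entropy bound
needs `L₀(β)² ≳ β/C` (each exact zero mode carries entropy `2 log 2` down to `T = 0`). -/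

section Targets

variable (L : ℕ) [NeZero L]

/-! ### I.1 `stub_thermalDisc` -/

/-- The registered stub `stub_thermalDisc` (verbatim signature). -/
def StubThermalDisc : Prop :=
  ∀ μ₁ μ₂ : ℝ, -4 < μ₁ → μ₁ ≤ μ₂ → μ₂ < 0 → ∃ U₀ a C : ℝ, 0 < U₀ ∧ 0 < a ∧ 0 < C ∧ ∀ U : ℝ, 0 < U →
    U ≤ U₀ → ∀ β : ℝ, 1 ≤ β → β ≤ Real.exp (a / U) → ∀ μ ∈ Set.Icc μ₁ μ₂, ∃ L₀ : ℕ,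
      ∀ (L : ℕ) [NeZero L], L₀ ≤ L → ∀ h : ℝ, |h| ≤ 1 / β →
        (Real.log (Matrix.partitionFn β (dWaveSourceTorus L U μ h)).re / (β * (L : ℝ) ^ 2)) -
          (Real.log (Matrix.partitionFn β (dWaveSourceTorus L U μ 0)).re / (β * (L : ℝ) ^ 2)) ≤
          C * (1 + Real.log β) * h ^ 2

/-- Orientation: the crux implies the stub (restriction to the disc). -/
theorem stubThermalDisc_of_crux
    (H : Summit.HubbardSuperconductivity.HubbardSuperconductivity.Theses.ThermalWedge.TwSourcedInertness) :
    StubThermalDisc := by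
  intro μ₁ μ₂ h1 h2 h3
  obtain ⟨U₀, a, C, hU₀, ha, hC, hmain⟩ := H μ₁ μ₂ h1 h2 h3
  refine ⟨U₀, a, C, hU₀, ha, hC, fun U hU hUU₀ β hβ hβa μ hμ => ?_⟩
  obtain ⟨L₀, hL₀⟩ := hmain U hU hUU₀ β hβ hβa μ hμ
  exact ⟨L₀, fun L _ hL h _ => hL₀ L hL h⟩

/-- `stub_thermalDisc` with the threshold `L₀` chosen BEFORE `(U, β, μ)`. -/
def StubThermalDiscUniformL0 : Prop :=
  ∀ μ₁ μ₂ : ℝ, -4 < μ₁ → μ₁ ≤ μ₂ → μ₂ < 0 → ∃ U₀ a C : ℝ, 0 < U₀ ∧ 0 < a ∧ 0 < C ∧ ∃ L₀ : ℕ,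
    ∀ U : ℝ, 0 < U → U ≤ U₀ → ∀ β : ℝ, 1 ≤ β → β ≤ Real.exp (a / U) → ∀ μ ∈ Set.Icc μ₁ μ₂,
      ∀ (L : ℕ) [NeZero L], L₀ ≤ L → ∀ h : ℝ, |h| ≤ 1 / β →
        (Real.log (Matrix.partitionFn β (dWaveSourceTorus L U μ h)).re / (β * (L : ℝ) ^ 2)) -
          (Real.log (Matrix.partitionFn β (dWaveSourceTorus L U μ 0)).re / (β * (L : ℝ) ^ 2)) ≤
          C * (1 + Real.log β) * h ^ 2

/-- `stub_thermalDisc` with `∃ L₀` replaced by `∀ L ≥ 3`. -/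
def StubThermalDiscAllL : Prop :=
  ∀ μ₁ μ₂ : ℝ, -4 < μ₁ → μ₁ ≤ μ₂ → μ₂ < 0 → ∃ U₀ a C : ℝ, 0 < U₀ ∧ 0 < a ∧ 0 < C ∧
    ∀ U : ℝ, 0 < U → U ≤ U₀ → ∀ β : ℝ, 1 ≤ β → β ≤ Real.exp (a / U) → ∀ μ ∈ Set.Icc μ₁ μ₂,
      ∀ (L : ℕ) [NeZero L], 3 ≤ L → ∀ h : ℝ, |h| ≤ 1 / β →
        (Real.log (Matrix.partitionFn β (dWaveSourceTorus L U μ h)).re / (β * (L : ℝ) ^ 2)) -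
          (Real.log (Matrix.partitionFn β (dWaveSourceTorus L U μ 0)).re / (β * (L : ℝ) ^ 2)) ≤
          C * (1 + Real.log β) * h ^ 2

theorem stubThermalDiscUniformL0_of_allL (H : StubThermalDiscAllL) : StubThermalDiscUniformL0 := by
  intro μ₁ μ₂ h1 h2 h3
  obtain ⟨U₀, a, C, hU₀, ha, hC, hmain⟩ := H μ₁ μ₂ h1 h2 h3
  exact ⟨U₀, a, C, hU₀, ha, hC, 3, hmain⟩

/-- Elementary: `log β ≤ 2(√β − 1)` hence `1 + log (t²) ≤ 2t` for `t ≥ 1`. -/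
theorem one_add_log_sq_le {t : ℝ} (ht : 1 ≤ t) : 1 + Real.log (t ^ 2) ≤ 2 * t := by
  have ht0 : 0 < t := by linarith
  rw [Real.log_pow]
  have := Real.log_le_sub_one_of_pos ht0
  push_cast
  linarith

/-- `β ≤ exp(a/U)` from `U ≤ a/(1 + log β)`. -/
theorem le_exp_div_of_le {a U β : ℝ} (hU : 0 < U) (hβ : 1 ≤ β)
    (hUa : U ≤ a / (1 + Real.log β)) : β ≤ Real.exp (a / U) := by
  have hlog : 0 ≤ Real.log β := Real.log_nonneg hβ
  have h1 : U * (1 + Real.log β) ≤ a := by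
    rwa [le_div_iff₀ (by linarith)] at hUa
  have h2 : Real.log β ≤ a / U := by
    rw [le_div_iff₀ hU]; nlinarith
  calc β = Real.exp (Real.log β) := (Real.exp_log (by linarith)).symm
    _ ≤ Real.exp (a / U) := Real.exp_le_exp.mpr h2

/-- **The thermal-disc contradiction on one torus carrying the level `−1`.** -/
theorem no_disc_bound_on_torus_with_level (hL3 : 3 ≤ L) (q : TorusSite 2 L)
    (hq : torusBand L q = -1) (hg : dWaveGap q = -3 / 2) {U₀ a C : ℝ} (hU₀ : 0 < U₀) (ha : 0 < a)
    (hC : 0 < C)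
    (hmain : ∀ U : ℝ, 0 < U → U ≤ U₀ → ∀ β : ℝ, 1 ≤ β → β ≤ Real.exp (a / U) → ∀ h : ℝ,
      |h| ≤ 1 / β →
      sourcedPressure L β U (-1) h - sourcedPressure L β U (-1) 0 ≤ C * (1 + Real.log β) * h ^ 2) :
    False := by
  have hLpos : (0 : ℝ) < (L : ℝ) := by exact_mod_cast Nat.pos_of_ne_zero (NeZero.ne L)
  set M : ℝ := (L : ℝ) ^ 2 with hM
  have hMpos : 0 < M := by positivity
  -- β = t², t = 4 C L² + 1
  have h4CM : 0 < 4 * C * M := by positivity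
  set t : ℝ := 4 * C * M + 1 with ht
  have ht1 : 1 ≤ t := by linarith
  have ht0 : 0 < t := by linarith
  set β : ℝ := t ^ 2 with hβdef
  have hβ1 : 1 ≤ β := by rw [hβdef]; nlinarith
  have hβpos : 0 < β := by linarith
  have hlog0 : 0 ≤ Real.log β := Real.log_nonneg hβ1
  have hlog : 1 + Real.log β ≤ 2 * t := one_add_log_sq_le ht1
  -- U
  set U : ℝ := min U₀ (min (a / (1 + Real.log β)) (1 / (4 * β * M))) with hUdef
  have hUpos : 0 < U := lt_min hU₀ (lt_min (div_pos ha (by linarith)) (by positivity))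
  have hUU₀ : U ≤ U₀ := min_le_left _ _
  have hUa : U ≤ a / (1 + Real.log β) := (min_le_right _ _).trans (min_le_left _ _)
  have hUq : U ≤ 1 / (4 * β * M) := (min_le_right _ _).trans (min_le_right _ _)
  have hβexp : β ≤ Real.exp (a / U) := le_exp_div_of_le hUpos hβ1 hUa
  -- the stub at h = 1/β
  have hh : |1 / β| ≤ 1 / β := by rw [abs_of_pos (by positivity)]
  have hup := hmain U hUpos hUU₀ β hβ1 hβexp (1 / β) hh
  -- the zero-mode lower bound
  have hlow := level_gain_lower_bound L hL3 hβpos hq U (1 / β)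
  have harg : β * |2 * Real.sqrt 2 * (1 / β) * dWaveGap q| = 3 * Real.sqrt 2 := by
    rw [hg, show 2 * Real.sqrt 2 * (1 / β) * (-3 / 2 : ℝ) = -(3 * Real.sqrt 2 / β) by ring, abs_neg,
      abs_of_pos (by positivity)]
    field_simp
  rw [harg, abs_of_pos hUpos] at hlow
  have hF := one_le_bdgF_three_sqrt_two
  -- 1/(βM) - 2U ≤ C (1 + log β)/β²
  have hβM : 0 < β * M := by positivity
  have h1 : 1 / (β * M) ≤ bdgF (3 * Real.sqrt 2) / (β * M) :=
    div_le_div_of_nonneg_right hF hβM.le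
  have h2U : 2 * U ≤ 1 / (2 * (β * M)) := by
    calc 2 * U ≤ 2 * (1 / (4 * β * M)) := by linarith
      _ = 1 / (2 * (β * M)) := by field_simp; ring
  have hchain : 1 / (2 * (β * M)) ≤ C * (1 + Real.log β) * (1 / β) ^ 2 := by
    have : 1 / (β * M) - 1 / (2 * (β * M)) = 1 / (2 * (β * M)) := by field_simp; ring
    linarith
  -- hence β ≤ 2 C M (1 + log β) ≤ 4 C M t < t² = β
  have hineq : β ≤ 2 * C * M * (1 + Real.log β) := by
    rw [div_le_iff₀ (by positivity)] at hchain
    have e : C * (1 + Real.log β) * (1 / β) ^ 2 * (2 * (β * M)) =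
        2 * C * M * (1 + Real.log β) / β := by field_simp
    rw [e, le_div_iff₀ hβpos] at hchain
    nlinarith
  have hlt : 2 * C * M * (1 + Real.log β) < β := by
    calc 2 * C * M * (1 + Real.log β) ≤ 2 * C * M * (2 * t) := by gcongr
      _ = (4 * C * M) * t := by ring
      _ < t * t := by apply mul_lt_mul_of_pos_right _ ht0; linarith
      _ = β := by rw [hβdef, sq]
  linarith

/-- **TARGET `stub_thermalDisc`: no finite-size threshold uniform in `β`.**
`¬ StubThermalDiscUniformL0` — witness `μ₁ = μ₂ = −1`, `L = 3·max(L₀,1)`, the exact zero mode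
`q = (L/3, 0)` (`ε = −1`, `ĝ_d = −3/2`), `h = 1/β`, `β = (4CL² + 1)²`,
`U = min(U₀, a/(1+log β), 1/(4βL²))`: the free zero-mode gain `F(3√2)/(βL²) ≥ 1/(βL²)` beats
`C(1+log β)/β² + 2U`. MESSAGE: in the linear-response regime too, `L₀(β, −1)² ≳ β/(C(1+log β))`. -/
theorem stub_thermalDisc_false_uniformL0 : ¬ StubThermalDiscUniformL0 := by
  intro H
  obtain ⟨U₀, a, C, hU₀, ha, hC, L₀, hmain⟩ := H (-1) (-1) (by norm_num) le_rfl (by norm_num)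
  set j : ℕ := max L₀ 1 with hjdef
  have hj : 1 ≤ j := le_max_right _ _
  have hjL : L₀ ≤ j := le_max_left _ _
  haveI : NeZero (3 * j) := ⟨by omega⟩
  have hL3 : 3 ≤ 3 * j := by omega
  have hL₀ : L₀ ≤ 3 * j := by omega
  exact no_disc_bound_on_torus_with_level (3 * j) hL3 (qOn j) (torusBand_qOn hj) (dWaveGap_qOn hj)
    hU₀ ha hC (fun U hU hUU β hβ hβa h hh => hmain U hU hUU β hβ hβa (-1) ⟨le_rfl, le_rfl⟩ (3 * j)
      hL₀ h hh)

/-- Corollary: `¬ StubThermalDiscAllL`. -/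
theorem stub_thermalDisc_false_allL : ¬ StubThermalDiscAllL :=
  fun H => stub_thermalDisc_false_uniformL0 (stubThermalDiscUniformL0_of_allL H)

/-! ### I.2 `stub_entropyDensity` -/

/-- The registered stub `stub_entropyDensity` (verbatim signature): entropy `S_L(β) ≤ C L²/β`. -/
def StubEntropyDensity : Prop :=
  ∀ μ₁ μ₂ : ℝ, -4 < μ₁ → μ₁ ≤ μ₂ → μ₂ < 0 → ∃ U₀ a C : ℝ, 0 < U₀ ∧ 0 < a ∧ 0 < C ∧ ∀ U : ℝ, 0 < U →
    U ≤ U₀ → ∀ β : ℝ, 1 ≤ β → β ≤ Real.exp (a / U) → ∀ μ ∈ Set.Icc μ₁ μ₂, ∃ L₀ : ℕ,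
      ∀ (L : ℕ) [NeZero L], L₀ ≤ L →
        Real.log (Matrix.partitionFn β (hubbardTorusWith 2 L 1 U μ)).re +
          β * (Matrix.gibbsState β (hubbardTorusWith 2 L 1 U μ) (hubbardTorusWith 2 L 1 U μ)).re ≤
          C * (L : ℝ) ^ 2 / β

omit [NeZero L] in
/-- The stub's left-hand side is the tree's `Matrix.gibbsEntropy`. -/
theorem stubEntropyDensity_lhs_eq (β U μ : ℝ) :
    Real.log (Matrix.partitionFn β (hubbardTorusWith 2 L 1 U μ)).re +
        β * (Matrix.gibbsState β (hubbardTorusWith 2 L 1 U μ) (hubbardTorusWith 2 L 1 U μ)).re =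
      gibbsEntropy β (hubbardTorusWith 2 L 1 U μ) := rfl

/-- `stub_entropyDensity` with the threshold `L₀` chosen BEFORE `(U, β, μ)`. -/
def StubEntropyDensityUniformL0 : Prop :=
  ∀ μ₁ μ₂ : ℝ, -4 < μ₁ → μ₁ ≤ μ₂ → μ₂ < 0 → ∃ U₀ a C : ℝ, 0 < U₀ ∧ 0 < a ∧ 0 < C ∧ ∃ L₀ : ℕ,
    ∀ U : ℝ, 0 < U → U ≤ U₀ → ∀ β : ℝ, 1 ≤ β → β ≤ Real.exp (a / U) → ∀ μ ∈ Set.Icc μ₁ μ₂,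
      ∀ (L : ℕ) [NeZero L], L₀ ≤ L →
        Real.log (Matrix.partitionFn β (hubbardTorusWith 2 L 1 U μ)).re +
          β * (Matrix.gibbsState β (hubbardTorusWith 2 L 1 U μ) (hubbardTorusWith 2 L 1 U μ)).re ≤
          C * (L : ℝ) ^ 2 / β

/-- `stub_entropyDensity` with `∃ L₀` replaced by `∀ L ≥ 3`. -/
def StubEntropyDensityAllL : Prop :=
  ∀ μ₁ μ₂ : ℝ, -4 < μ₁ → μ₁ ≤ μ₂ → μ₂ < 0 → ∃ U₀ a C : ℝ, 0 < U₀ ∧ 0 < a ∧ 0 < C ∧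
    ∀ U : ℝ, 0 < U → U ≤ U₀ → ∀ β : ℝ, 1 ≤ β → β ≤ Real.exp (a / U) → ∀ μ ∈ Set.Icc μ₁ μ₂,
      ∀ (L : ℕ) [NeZero L], 3 ≤ L →
        Real.log (Matrix.partitionFn β (hubbardTorusWith 2 L 1 U μ)).re +
          β * (Matrix.gibbsState β (hubbardTorusWith 2 L 1 U μ) (hubbardTorusWith 2 L 1 U μ)).re ≤
          C * (L : ℝ) ^ 2 / β

theorem stubEntropyDensityUniformL0_of_allL (H : StubEntropyDensityAllL) :
    StubEntropyDensityUniformL0 := by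
  intro μ₁ μ₂ h1 h2 h3
  obtain ⟨U₀, a, C, hU₀, ha, hC, hmain⟩ := H μ₁ μ₂ h1 h2 h3
  exact ⟨U₀, a, C, hU₀, ha, hC, 3, hmain⟩

/-- The per-mode factor of the unsourced free partition function:
`log(e^{−βξ}(1 + cosh(β√(ξ² + 0)))/2) = −βξ + F(βξ)`. -/
theorem bdgF_eq_of_abs_eq {x y : ℝ} (h : |x| = |y|) : bdgF x = bdgF y := by
  rw [← bdgF_abs x, h, bdgF_abs]

omit [NeZero L] in
theorem log_freeModeFactor (β ξ : ℝ) (k : TorusSite 2 L) :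
    Real.log (Real.exp (-(β * ξ)) *
        ((1 + Real.cosh (β * Real.sqrt (ξ ^ 2 + (2 * Real.sqrt 2 * 0 * dWaveGap k) ^ 2))) / 2)) =
      -(β * ξ) + bdgF (β * ξ) := by
  rw [Real.log_mul (Real.exp_pos _).ne' (bdgF_arg_pos _).ne', Real.log_exp]
  congr 1
  rw [mul_zero, zero_mul, show (0:ℝ) ^ 2 = 0 by norm_num, add_zero, Real.sqrt_sq_eq_abs, ← bdgF]
  refine bdgF_eq_of_abs_eq ?_
  rw [abs_mul, abs_abs, abs_mul]

/-- **The exact unsourced free partition function** (`L ≥ 3`):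
`log Z_L(β, μ, U=0) = 2L² log 2 + Σ_k [−βξ_k + F(βξ_k)]`. -/
theorem log_partitionFn_free (hL : 3 ≤ L) (β μ : ℝ) :
    Real.log (partitionFn β (hubbardTorusWith 2 L 1 0 μ)).re =
      2 * (L : ℝ) ^ 2 * Real.log 2 +
        ∑ k : TorusSite 2 L, (-(β * (torusBand L k - μ)) + bdgF (β * (torusBand L k - μ))) := by
  rw [← dWaveSourceTorus_zero (L := L) 0 μ, partitionFn_dWaveSourceTorus_zero_re hL β μ 0]
  have hpos : ∀ k : TorusSite 2 L, 0 < Real.exp (-(β * (torusBand L k - μ))) *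
      ((1 + Real.cosh (β * Real.sqrt ((torusBand L k - μ) ^ 2 +
        (2 * Real.sqrt 2 * 0 * dWaveGap k) ^ 2))) / 2) := fun k => bdgModeFactor_pos β _ _
  rw [Real.log_mul (by positivity) (Finset.prod_ne_zero_iff.2 fun k _ => (hpos k).ne'),
    Real.log_prod (s := Finset.univ) (hf := fun k _ => (hpos k).ne'), Real.log_pow, card_orb_fermionTorus_two]
  congr 1
  · push_cast; ring
  · exact Finset.sum_congr rfl fun k _ => log_freeModeFactor L β _ k

/-- **Dyadic entropy witness of the free gas**: `2 log Z₀(β) − log Z₀(2β) ≥ 2 log 2` on a torus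
with a level at `μ` (`L ≥ 3`; every exact zero mode keeps entropy `2 log 2` at all temperatures). -/
theorem two_log_two_le_dyadic_free (hL : 3 ≤ L) (β μ : ℝ) {q : TorusSite 2 L}
    (hq : torusBand L q = μ) :
    2 * Real.log 2 ≤ 2 * Real.log (partitionFn β (hubbardTorusWith 2 L 1 0 μ)).re -
      Real.log (partitionFn (2 * β) (hubbardTorusWith 2 L 1 0 μ)).re := by
  rw [log_partitionFn_free L hL, log_partitionFn_free L hL]
  have hcard : (Fintype.card (TorusSite 2 L) : ℝ) = (L : ℝ) ^ 2 := by
    rw [card_torusSite_two]; push_cast; ring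
  -- rewrite as a sum of non-negative terms
  set A : ℝ := 2 * (L : ℝ) ^ 2 * Real.log 2 with hA
  set S₁ : ℝ := ∑ k : TorusSite 2 L, (-(β * (torusBand L k - μ)) + bdgF (β * (torusBand L k - μ)))
    with hS₁
  set S₂ : ℝ := ∑ k : TorusSite 2 L, (-(2 * β * (torusBand L k - μ)) + bdgF (2 * β * (torusBand L k - μ)))
    with hS₂
  have hconst : ∑ _k : TorusSite 2 L, (2 * Real.log 2) = A := by
    rw [Finset.sum_const, nsmul_eq_mul, Finset.card_univ, hcard, hA]; ring
  have key : 2 * (A + S₁) - (A + S₂) =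
      ∑ k : TorusSite 2 L, (2 * bdgF (β * (torusBand L k - μ)) + 2 * Real.log 2 -
        bdgF (2 * (β * (torusBand L k - μ)))) := by
    have e1 : 2 * (A + S₁) - (A + S₂) = A + (2 * S₁ - S₂) := by ring
    rw [e1, ← hconst, hS₁, hS₂, Finset.mul_sum, ← Finset.sum_sub_distrib, ← Finset.sum_add_distrib]
    refine Finset.sum_congr rfl fun k _ => ?_
    rw [show 2 * β * (torusBand L k - μ) = 2 * (β * (torusBand L k - μ)) by ring]
    ring
  rw [key]
  have hterm : ∀ k : TorusSite 2 L, 0 ≤ 2 * bdgF (β * (torusBand L k - μ)) + 2 * Real.log 2 -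
      bdgF (2 * (β * (torusBand L k - μ))) := fun k => by
    have := bdgF_two_mul_le (β * (torusBand L k - μ)); linarith
  have hq' : 2 * bdgF (β * (torusBand L q - μ)) + 2 * Real.log 2 - bdgF (2 * (β * (torusBand L q - μ))) =
      2 * Real.log 2 := by
    rw [hq, sub_self, mul_zero, mul_zero, bdgF_zero]; ring
  calc 2 * Real.log 2 = 2 * bdgF (β * (torusBand L q - μ)) + 2 * Real.log 2 -
      bdgF (2 * (β * (torusBand L q - μ))) := hq'.symm
    _ ≤ _ := Finset.single_le_sum (f := fun k => 2 * bdgF (β * (torusBand L k - μ)) + 2 * Real.log 2 -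
        bdgF (2 * (β * (torusBand L k - μ)))) (fun k _ => hterm k) (Finset.mem_univ q)

/-- `|log Z(β, H_U) − log Z(β, H_0)| ≤ β |U| L²` for the unsourced torus (`β ≥ 0`). -/
theorem abs_log_partitionFn_interacting_sub_free_le (U μ : ℝ) {β : ℝ} (hβ : 0 ≤ β) :
    |Real.log (partitionFn β (hubbardTorusWith 2 L 1 U μ)).re -
        Real.log (partitionFn β (hubbardTorusWith 2 L 1 0 μ)).re| ≤ β * (|U| * (L : ℝ) ^ 2) := by
  have key := abs_log_partitionFn_sub_log_partitionFn_le (Literature.MathematicalPhysics.QuantumLattice.isHermitian_hubbardTorusWith L 1 U μ)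
    (Literature.MathematicalPhysics.QuantumLattice.isHermitian_hubbardTorusWith L 1 0 μ) hβ
  refine key.trans ?_
  gcongr
  have h := Summit.HubbardSuperconductivity.HubbardSuperconductivity.Theorems.norm_dWaveSourceTorus_sub_free_le L U μ 0
  rwa [dWaveSourceTorus_zero, dWaveSourceTorus_zero] at h

/-- **Entropy of the interacting torus with a level: `S_L(β) ≥ 2 log 2 − 4β|U|L²`** (`L ≥ 3`,
`β > 0`): dyadic sandwich `S(β) ≥ 2 log Z(β) − log Z(2β)` + free formula + `‖U W‖ ≤ |U|L²`. -/
theorem entropy_lower_bound_of_level (hL : 3 ≤ L) {β : ℝ} (hβ : 0 < β) {μ : ℝ} {q : TorusSite 2 L}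
    (hq : torusBand L q = μ) (U : ℝ) :
    2 * Real.log 2 - 4 * β * (|U| * (L : ℝ) ^ 2) ≤ gibbsEntropy β (hubbardTorusWith 2 L 1 U μ) := by
  have hH := Literature.MathematicalPhysics.QuantumLattice.isHermitian_hubbardTorusWith L 1 U μ
  have hsand := hH.two_mul_log_partitionFn_half_sub_le_gibbsEntropy_half (β := 2 * β) (by positivity)
  rw [show 2 * β / 2 = β by ring] at hsand
  have h1 := abs_log_partitionFn_interacting_sub_free_le L U μ hβ.le
  have h2 := abs_log_partitionFn_interacting_sub_free_le L U μ (β := 2 * β) (by positivity)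
  have hfree := two_log_two_le_dyadic_free L hL β μ hq
  rw [abs_le] at h1 h2
  linarith [h1.1, h2.2]

/-- **The entropy contradiction on one torus carrying the level `−1`.** -/
theorem no_entropy_bound_on_torus_with_level (hL3 : 3 ≤ L) (q : TorusSite 2 L)
    (hq : torusBand L q = -1) {U₀ a C : ℝ} (hU₀ : 0 < U₀) (ha : 0 < a) (hC : 0 < C)
    (hmain : ∀ U : ℝ, 0 < U → U ≤ U₀ → ∀ β : ℝ, 1 ≤ β → β ≤ Real.exp (a / U) →
      gibbsEntropy β (hubbardTorusWith 2 L 1 U (-1)) ≤ C * (L : ℝ) ^ 2 / β) :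
    False := by
  have hLpos : (0 : ℝ) < (L : ℝ) := by exact_mod_cast Nat.pos_of_ne_zero (NeZero.ne L)
  set M : ℝ := (L : ℝ) ^ 2 with hM
  have hMpos : 0 < M := by positivity
  set β : ℝ := 2 * C * M + 2 with hβdef
  have hCM : 0 < C * M := by positivity
  have hβ1 : 1 ≤ β := by linarith
  have hβpos : 0 < β := by linarith
  have hlog0 : 0 ≤ Real.log β := Real.log_nonneg hβ1
  have hl2 := Real.log_two_gt_d9
  set U : ℝ := min U₀ (min (a / (1 + Real.log β)) (Real.log 2 / (4 * β * M))) with hUdef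
  have hUpos : 0 < U := lt_min hU₀ (lt_min (div_pos ha (by linarith)) (by positivity))
  have hUU₀ : U ≤ U₀ := min_le_left _ _
  have hUa : U ≤ a / (1 + Real.log β) := (min_le_right _ _).trans (min_le_left _ _)
  have hUq : U ≤ Real.log 2 / (4 * β * M) := (min_le_right _ _).trans (min_le_right _ _)
  have hβexp : β ≤ Real.exp (a / U) := le_exp_div_of_le hUpos hβ1 hUa
  have hup := hmain U hUpos hUU₀ β hβ1 hβexp
  have hlow := entropy_lower_bound_of_level L hL3 hβpos hq U
  rw [abs_of_pos hUpos] at hlow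
  have h4 : 4 * β * (U * M) ≤ Real.log 2 := by
    calc 4 * β * (U * M) ≤ 4 * β * (Real.log 2 / (4 * β * M) * M) := by gcongr
      _ = Real.log 2 := by field_simp
  have hrhs : C * M / β < 1 / 2 := by
    rw [div_lt_iff₀ hβpos, hβdef]; nlinarith
  linarith

/-- **TARGET `stub_entropyDensity`: no finite-size threshold uniform in `β`.**
`¬ StubEntropyDensityUniformL0` — witness `μ₁ = μ₂ = −1`, `L = 3·max(L₀,1)`, `β = 2CL² + 2`,
`U = min(U₀, a/(1+log β), log 2/(4βL²))`: the exact zero mode keeps `S_L(β) ≥ log 2 > CL²/β`.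
MESSAGE: `L₀(β, −1)² ≳ β/C` — the entropy-density law `s ≤ C T` is a statement about `L ≫ √(β/C)`. -/
theorem stub_entropyDensity_false_uniformL0 : ¬ StubEntropyDensityUniformL0 := by
  intro H
  obtain ⟨U₀, a, C, hU₀, ha, hC, L₀, hmain⟩ := H (-1) (-1) (by norm_num) le_rfl (by norm_num)
  set j : ℕ := max L₀ 1 with hjdef
  have hj : 1 ≤ j := le_max_right _ _
  have hjL : L₀ ≤ j := le_max_left _ _
  haveI : NeZero (3 * j) := ⟨by omega⟩
  have hL3 : 3 ≤ 3 * j := by omega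
  have hL₀ : L₀ ≤ 3 * j := by omega
  exact no_entropy_bound_on_torus_with_level (3 * j) hL3 (qOn j) (torusBand_qOn hj) hU₀ ha hC
    (fun U hU hUU β hβ hβa => hmain U hU hUU β hβ hβa (-1) ⟨le_rfl, le_rfl⟩ (3 * j) hL₀)

/-- Corollary: `¬ StubEntropyDensityAllL`. -/
theorem stub_entropyDensity_false_allL : ¬ StubEntropyDensityAllL :=
  fun H => stub_entropyDensity_false_uniformL0 (stubEntropyDensityUniformL0_of_allL H)

end Targets


/-! ## §J LOAD-BEARING: the `log β` cannot be dropped (thermodynamic regime `L ≫ β`)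

`TwSourcedInertnessNoLog` is the crux with the bound `C·h²` in place of `C(1+log β)h²` (a STRONGER
statement). It is FALSE, and so is its restriction to the thermal disc `|h| ≤ 1/β`
(`tw1696_false_without_log_disc`): at `μ = −2`, `h = 1/β`, on every torus with `L ≥ 2β` (and
`L ≥ 400`) the FREE gain is at least `(log β − log 128)/(2736π β²)` — the Cooper logarithm with the
temperature (not the level spacing) as infrared cutoff, obtained from the tree's row walk
(`exists_cooperRow_crossing`, `cooperRow_walk_bounds`) restricted to energies `ξ ≥ 1/β` on the
`≥ L/9` rows `cos k₂ ≥ 3/4` (where `|ĝ_d| ≥ 1/2` on the whole positive-`ξ` side), and the per-level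
convexity bound `F(βE) − F(βξ) ≥ ĝ_d²/(19β|ξ|)` for `|ξ| ≥ 1/β`; the interacting gain follows up to
`2U`. MESSAGE TO PROVERS: the `β`-dependence `log β` of the crux's constant is SHARP (tight up to the
value of `C`); any proof must produce the Cooper logarithm, and the thermal-disc stub inherits it. -/

section LogLoadBearing

open Real in
/-- `x/(1+x) ≤ log(1+x)` for `x ≥ 0`. -/
theorem div_one_add_le_log_one_add {x : ℝ} (hx : 0 ≤ x) : x / (1 + x) ≤ Real.log (1 + x) := by
  have h1 : 0 < 1 + x := by linarith
  have h := Real.log_le_sub_one_of_pos (inv_pos.mpr h1)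
  rw [Real.log_inv] at h
  have e : (1 + x)⁻¹ - 1 = -(x / (1 + x)) := by field_simp; ring
  linarith

/-- Supporting line of `cosh`: `(b − a) sinh a ≤ cosh b − cosh a` for `a ≤ b`. -/
theorem sub_mul_sinh_le_cosh_sub_cosh {a b : ℝ} (hab : a ≤ b) :
    (b - a) * Real.sinh a ≤ Real.cosh b - Real.cosh a := by
  have hd0 : 0 ≤ b - a := by linarith
  have hb : b = a + (b - a) := by ring
  have h1 : (b - a) + 1 ≤ Real.exp (b - a) := Real.add_one_le_exp _
  have h2 : -(b - a) + 1 ≤ Real.exp (-(b - a)) := Real.add_one_le_exp _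
  have hea : 0 < Real.exp a := Real.exp_pos a
  have hena : 0 < Real.exp (-a) := Real.exp_pos (-a)
  have hexpb : Real.exp b = Real.exp a * Real.exp (b - a) := by rw [← Real.exp_add]; ring_nf
  have hexpnb : Real.exp (-b) = Real.exp (-a) * Real.exp (-(b - a)) := by
    rw [← Real.exp_add]; ring_nf
  rw [Real.sinh_eq, Real.cosh_eq, Real.cosh_eq, hexpb, hexpnb]
  have k1 := mul_le_mul_of_nonneg_left h1 hea.le
  have k2 := mul_le_mul_of_nonneg_left h2 hena.le
  nlinarith

/-- For `a ≥ 1`: `1/3 ≤ sinh a/(1 + cosh a)` (`cosh a − sinh a = e^{−a} ≤ 1`, `sinh a ≥ a ≥ 1`). -/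
theorem third_le_sinh_div_one_add_cosh {a : ℝ} (ha : 1 ≤ a) :
    1 / 3 ≤ Real.sinh a / (1 + Real.cosh a) := by
  have hc := Real.one_le_cosh a
  have hs : a ≤ Real.sinh a := Real.self_le_sinh_iff.mpr (by linarith)
  have hcs : Real.cosh a - Real.sinh a = Real.exp (-a) := Real.cosh_sub_sinh a
  have he : Real.exp (-a) ≤ 1 := by rw [Real.exp_le_one_iff]; linarith
  rw [div_le_div_iff₀ (by norm_num) (by linarith)]
  linarith

/-- **Per-level convexity bound**: `(b − a)/19 ≤ F(b) − F(a)` for `1 ≤ a ≤ b`, `b − a ≤ 16`. -/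
theorem sub_div_le_bdgF_sub {a b : ℝ} (ha : 1 ≤ a) (hab : a ≤ b) (hba : b - a ≤ 16) :
    (b - a) / 19 ≤ bdgF b - bdgF a := by
  have hApos := bdgF_arg_pos a
  have hBpos := bdgF_arg_pos b
  have hca : 0 < 1 + Real.cosh a := by have := Real.one_le_cosh a; linarith
  unfold bdgF
  rw [← Real.log_div hBpos.ne' hApos.ne']
  have e : (1 + Real.cosh b) / 2 / ((1 + Real.cosh a) / 2) = (1 + Real.cosh b) / (1 + Real.cosh a) := by
    field_simp
  rw [e]
  set x : ℝ := (b - a) / 3 with hx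
  have hx0 : 0 ≤ x := by rw [hx]; linarith
  have hx16 : x ≤ 16 / 3 := by rw [hx]; linarith
  have hratio : 1 + x ≤ (1 + Real.cosh b) / (1 + Real.cosh a) := by
    rw [le_div_iff₀ hca]
    have h1 := sub_mul_sinh_le_cosh_sub_cosh hab
    have h2 := third_le_sinh_div_one_add_cosh ha
    rw [div_le_div_iff₀ (by norm_num) hca] at h2
    have hd0 : 0 ≤ b - a := by linarith
    have h3 : (b - a) * (1 * (1 + Real.cosh a)) ≤ (b - a) * (Real.sinh a * 3) :=
      mul_le_mul_of_nonneg_left h2 hd0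
    rw [hx]
    nlinarith
  have hlog1 : Real.log (1 + x) ≤ Real.log ((1 + Real.cosh b) / (1 + Real.cosh a)) :=
    Real.log_le_log (by linarith) hratio
  have hlog2 := div_one_add_le_log_one_add hx0
  have hlow : x / (19 / 3) ≤ x / (1 + x) :=
    div_le_div_of_nonneg_left hx0 (by linarith) (by linarith)
  have e2 : x / (19 / 3) = (b - a) / 19 := by rw [hx]; ring
  linarith

/-- `|ĝ_d(k)| ≤ 2`. -/
theorem abs_dWaveGap_le_two {L : ℕ} (k : TorusSite 2 L) : |dWaveGap k| ≤ 2 := by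
  unfold dWaveGap
  have h1 := Real.abs_cos_le_one (latticeMomentum L k 0)
  have h2 := Real.abs_cos_le_one (latticeMomentum L k 1)
  calc |Real.cos (latticeMomentum L k 0) - Real.cos (latticeMomentum L k 1)|
      ≤ |Real.cos (latticeMomentum L k 0)| + |Real.cos (latticeMomentum L k 1)| := abs_sub _ _
    _ ≤ 2 := by linarith

/-- **Per-mode thermal bound**: for `β ≥ 1`, `h = 1/β` and a level with `|ξ_k| ≥ 1/β`,
`ĝ_d(k)²/(19β|ξ_k|) ≤ modeGain`. -/
theorem modeGain_thermal_lower_bound {L : ℕ} [NeZero L] {β : ℝ} (hβ : 1 ≤ β) (μ : ℝ) (k : TorusSite 2 L)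
    (hξ : 1 / β ≤ |torusBand L k - μ|) :
    dWaveGap k ^ 2 / (19 * β * |torusBand L k - μ|) ≤ modeGain L β μ (1 / β) k := by
  have hβ0 : 0 < β := by linarith
  set ξ : ℝ := torusBand L k - μ with hξdef
  set x : ℝ := |ξ| with hxdef
  set gk : ℝ := dWaveGap k with hgk
  have hx0 : 0 < x := lt_of_lt_of_le (by positivity) hξ
  have hβx : 1 ≤ β * x := by
    have := mul_le_mul_of_nonneg_left hξ hβ0.le
    rwa [mul_one_div_cancel hβ0.ne'] at this
  set D : ℝ := 2 * Real.sqrt 2 * (1 / β) * gk with hD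
  have hD2 : D ^ 2 = 8 * gk ^ 2 / β ^ 2 := by
    rw [hD, mul_pow, mul_pow, mul_pow, Real.sq_sqrt (by norm_num : (0:ℝ) ≤ 2)]
    field_simp
    ring
  have hg2 : gk ^ 2 ≤ 4 := by
    have := abs_dWaveGap_le_two k
    rw [← hgk] at this
    nlinarith [abs_nonneg gk, sq_abs gk]
  have hD2le : D ^ 2 ≤ 32 * x ^ 2 := by
    rw [hD2]
    have h1 : 1 / β ^ 2 ≤ x ^ 2 := by
      have := pow_le_pow_left₀ (by positivity) hξ 2
      rwa [_root_.one_div_pow] at this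
    calc 8 * gk ^ 2 / β ^ 2 = 8 * gk ^ 2 * (1 / β ^ 2) := by ring
      _ ≤ 8 * 4 * x ^ 2 := by
          have := mul_le_mul (mul_le_mul_of_nonneg_left hg2 (by norm_num : (0:ℝ) ≤ 8)) h1
            (by positivity) (by positivity)
          linarith
      _ = 32 * x ^ 2 := by ring
  set E : ℝ := Real.sqrt (ξ ^ 2 + D ^ 2) with hE
  have hE0 : 0 ≤ E := Real.sqrt_nonneg _
  have hEsq : E ^ 2 = ξ ^ 2 + D ^ 2 := Real.sq_sqrt (by positivity)
  have hx2 : x ^ 2 = ξ ^ 2 := sq_abs ξ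
  have hxE : x ≤ E := by
    rw [hxdef, ← Real.sqrt_sq_eq_abs, hE]
    exact Real.sqrt_le_sqrt (by nlinarith)
  have hE7 : E ≤ 7 * x := by
    have h49 : ξ ^ 2 + D ^ 2 ≤ (7 * x) ^ 2 := by nlinarith
    calc E = Real.sqrt (ξ ^ 2 + D ^ 2) := hE
      _ ≤ Real.sqrt ((7 * x) ^ 2) := Real.sqrt_le_sqrt h49
      _ = 7 * x := Real.sqrt_sq (by positivity)
  -- `E − x` two-sided
  have hprod : (E - x) * (E + x) = D ^ 2 := by nlinarith
  have hlow : D ^ 2 / (8 * x) ≤ E - x := by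
    rw [div_le_iff₀ (by positivity)]
    nlinarith
  have hup : E - x ≤ 16 / (β ^ 2 * x) := by
    rw [le_div_iff₀ (by positivity)]
    have : (E - x) * (2 * x) ≤ D ^ 2 := by nlinarith
    have hD32 : D ^ 2 ≤ 32 / β ^ 2 := by
      rw [hD2, div_le_div_iff_of_pos_right (by positivity)]; linarith
    rw [le_div_iff₀ (by positivity)] at hD32
    nlinarith
  -- apply the per-level bound with `a = βx`, `b = βE`
  have hab : β * x ≤ β * E := mul_le_mul_of_nonneg_left hxE hβ0.le
  have hba : β * E - β * x ≤ 16 := by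
    rw [← mul_sub]
    calc β * (E - x) ≤ β * (16 / (β ^ 2 * x)) := by gcongr
      _ = 16 / (β * x) := by field_simp
      _ ≤ 16 / 1 := div_le_div_of_nonneg_left (by norm_num) one_pos hβx
      _ = 16 := by norm_num
  have key := sub_div_le_bdgF_sub hβx hab hba
  have hmg : modeGain L β μ (1 / β) k = bdgF (β * E) - bdgF (β * x) := by
    unfold modeGain
    rw [← hξdef, ← hgk, ← hD, ← hE]
    congr 1
    exact bdgF_eq_of_abs_eq (by rw [abs_mul, abs_mul, hxdef, abs_abs])
  rw [hmg]
  refine le_trans ?_ key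
  -- `gk²/(19βx) ≤ β(E − x)/19`
  rw [← mul_sub]
  have h1 : gk ^ 2 / (19 * β * x) = β * (D ^ 2 / (8 * x)) / 19 := by
    rw [hD2]; field_simp
  rw [h1]
  gcongr


/-! ### J.2 The harmonic walk along one row with a thermal cutoff -/

/-- **One row, thermal cutoff.** For `|c| ≤ 3/2`, `L ≥ 400`, `β ≥ 128`, `L ≥ 2β`, the row energies
`g(n) = −2cos(2πn/L) + c` satisfy `Σ_{n < L : 1/β ≤ g(n)} 1/g(n) ≥ (L/(4π))(log β − log 128)`
(tree: `exists_cooperRow_crossing`, `cooperRow_walk_bounds`; the walk `j ∈ [⌈L/β⌉, ⌊L/64⌋]`). -/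
theorem cooperRow_thermal_sum_ge {L : ℕ} {c β : ℝ} (g : ℕ → ℝ)
    (hg : ∀ n : ℕ, g n = -2 * Real.cos (2 * Real.pi * (n : ℝ) / L) + c) (hc : |c| ≤ 3 / 2)
    (hL : (400 : ℝ) ≤ L) (hβ : 128 ≤ β) (hLβ : 2 * β ≤ L) :
    (L : ℝ) / (4 * Real.pi) * (Real.log β - Real.log 128) ≤
      ∑ n ∈ (Finset.range L).filter (fun n : ℕ => 1 / β ≤ g n), 1 / g n := by
  have hπ := Real.pi_pos
  have hβ0 : 0 < β := by linarith
  have hLr : (0 : ℝ) < L := by linarith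
  have hs : (0 : ℝ) < 1 := one_pos
  have hc' : |c| ≤ 2 - (1 : ℝ) ^ 2 / 2 := by norm_num; linarith
  have hL' : 400 / (1 : ℝ) ^ 2 ≤ (L : ℝ) := by rw [one_pow, div_one]; exact hL
  obtain ⟨n₀, _hn₀1, hn₀L, hg0, hg1, hcos⟩ := exists_cooperRow_crossing (c := c) hs le_rfl hc' hL'
  -- walk length and first index
  set R : ℕ := ⌊(L : ℝ) / 64⌋₊ with hR
  have hRle : (R : ℝ) ≤ (1 : ℝ) ^ 2 * L / 64 := by
    rw [one_pow, one_mul]; exact Nat.floor_le (by positivity)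
  have hRge : (L : ℝ) / 64 < R + 1 := Nat.lt_floor_add_one _
  set j₀ : ℕ := ⌈(L : ℝ) / β⌉₊ with hj₀
  have hj₀ge : (L : ℝ) / β ≤ j₀ := Nat.le_ceil _
  have hj₀lt : (j₀ : ℝ) < L / β + 1 := Nat.ceil_lt_add_one (by positivity)
  have hLβ' : 2 ≤ (L : ℝ) / β := by rw [le_div_iff₀ hβ0]; linarith
  have hLβ128 : (L : ℝ) / β ≤ L / 128 := div_le_div_of_nonneg_left hLr.le (by norm_num) hβ
  have hL128 : (1 : ℝ) ≤ L / 128 := by rw [le_div_iff₀ (by norm_num)]; linarith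
  have hj₀R : j₀ ≤ R := by
    have h1 : (j₀ : ℝ) < R + 1 := by
      have : (L : ℝ) / 64 = L / 128 + L / 128 := by ring
      linarith
    have h2 : j₀ < R + 1 := by exact_mod_cast h1
    omega
  -- along the walk: `1/β ≤ g ≤ 4π(j+1)/L`
  have hwalk : ∀ j ∈ Finset.Ico j₀ (R + 1),
      1 / β ≤ g (n₀ + j) ∧ g (n₀ + j) ≤ 4 * Real.pi * (j + 1) / L := by
    intro j hj
    rw [Finset.mem_Ico] at hj
    have hjR : j ≤ R := by omega
    obtain ⟨hb1, hb2⟩ := cooperRow_walk_bounds (c := c) hs le_rfl hL' hn₀L hcos hRle hg0 hg1 hjR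
    rw [← hg (n₀ + j)] at hb1 hb2
    refine ⟨?_, hb2⟩
    have hj1 : (j₀ : ℝ) ≤ j := by exact_mod_cast hj.1
    calc 1 / β = (L / β) / L := by field_simp
      _ ≤ (j₀ : ℝ) / L := by gcongr
      _ ≤ 1 * (j : ℝ) / L := by rw [one_mul]; gcongr
      _ ≤ g (n₀ + j) := hb1
  -- the walk lies in the summation range
  have hsub : (Finset.Ico j₀ (R + 1)).image (fun j => n₀ + j) ⊆
      (Finset.range L).filter (fun n : ℕ => 1 / β ≤ g n) := by
    intro n hn
    rw [Finset.mem_image] at hn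
    obtain ⟨j, hj, rfl⟩ := hn
    have hw := hwalk j hj
    rw [Finset.mem_Ico] at hj
    rw [Finset.mem_filter, Finset.mem_range]
    refine ⟨?_, hw.1⟩
    have hjR : (j : ℝ) ≤ L / 64 := by
      have : (j : ℝ) ≤ R := by exact_mod_cast (show j ≤ R by omega)
      rw [one_pow, one_mul] at hRle
      linarith
    have h2n : 2 * (n₀ : ℝ) ≤ L := by exact_mod_cast hn₀L
    have : (n₀ : ℝ) + j < L := by linarith
    exact_mod_cast this
  have hinj : Set.InjOn (fun j => n₀ + j) ↑(Finset.Ico j₀ (R + 1)) := fun a _ b _ h => by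
    simpa using h
  -- the harmonic sum
  have hharm : Real.log β - Real.log 128 ≤ ∑ j ∈ Finset.Ico j₀ (R + 1), 1 / ((j : ℝ) + 1) := by
    have h1 : 1 ≤ j₀ + 1 := by omega
    have h2 : j₀ + 1 ≤ R + 2 := by omega
    have key := log_sub_log_le_sum_Ico_one_div h1 h2
    have hre : ∑ i ∈ Finset.Ico (j₀ + 1) (R + 2), (1 : ℝ) / i =
        ∑ j ∈ Finset.Ico j₀ (R + 1), 1 / ((j : ℝ) + 1) := by
      rw [Finset.sum_Ico_eq_sum_range, Finset.sum_Ico_eq_sum_range,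
        show R + 2 - (j₀ + 1) = R + 1 - j₀ by omega]
      refine Finset.sum_congr rfl fun k _ => ?_
      push_cast
      ring
    rw [hre] at key
    -- `log β − log 128 = log(L/64) − log(2L/β) ≤ log(R+2) − log(j₀+1)`
    have hA : Real.log ((L : ℝ) / 64) ≤ Real.log ((R + 2 : ℕ) : ℝ) := by
      refine Real.log_le_log (by positivity) ?_
      push_cast; linarith
    have hB : Real.log ((j₀ + 1 : ℕ) : ℝ) ≤ Real.log (2 * L / β) := by
      refine Real.log_le_log (by positivity) ?_
      have e2 : (2 : ℝ) * L / β = L / β + L / β := by ring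
      push_cast; linarith
    have hC : Real.log ((L : ℝ) / 64) - Real.log (2 * L / β) = Real.log β - Real.log 128 := by
      rw [← Real.log_div (by positivity) (by positivity), ← Real.log_div hβ0.ne' (by norm_num)]
      congr 1
      field_simp
      ring
    linarith
  -- the chain
  calc (L : ℝ) / (4 * Real.pi) * (Real.log β - Real.log 128)
      ≤ (L : ℝ) / (4 * Real.pi) * ∑ j ∈ Finset.Ico j₀ (R + 1), 1 / ((j : ℝ) + 1) :=
        mul_le_mul_of_nonneg_left hharm (by positivity)
    _ = ∑ j ∈ Finset.Ico j₀ (R + 1), (L : ℝ) / (4 * Real.pi) * (1 / ((j : ℝ) + 1)) := by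
        rw [Finset.mul_sum]
    _ ≤ ∑ j ∈ Finset.Ico j₀ (R + 1), 1 / g (n₀ + j) := by
        refine Finset.sum_le_sum fun j hj => ?_
        obtain ⟨h1, h2⟩ := hwalk j hj
        have hgpos : 0 < g (n₀ + j) := lt_of_lt_of_le (by positivity) h1
        rw [show (L : ℝ) / (4 * Real.pi) * (1 / ((j : ℝ) + 1)) = 1 / (4 * Real.pi * (j + 1) / L) by
          field_simp]
        exact one_div_le_one_div_of_le hgpos h2
    _ = ∑ n ∈ (Finset.Ico j₀ (R + 1)).image (fun j => n₀ + j), 1 / g n := by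
        rw [Finset.sum_image hinj]
    _ ≤ ∑ n ∈ (Finset.range L).filter (fun n : ℕ => 1 / β ≤ g n), 1 / g n :=
        Finset.sum_le_sum_of_subset_of_nonneg hsub fun n hn _ => by
          rw [Finset.mem_filter] at hn
          have : 0 < g n := lt_of_lt_of_le (by positivity) hn.2
          positivity

/-! ### J.3 One good row of the torus at `μ = −2` -/

/-- **One good row** (`cos k₂ ≥ 3/4`) of the `L`-torus at `μ = −2`, `h = 1/β`:
`Σ_a modeGain(a, b) ≥ (L/(304πβ))(log β − log 128)` — on such a row `ĝ_d ≤ −1/2` wherever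
`ξ ≥ 0`, so the per-mode bound `ĝ_d²/(19βξ) ≥ 1/(76βξ)` feeds the thermal row walk. -/
theorem torusRow_modeGain_sum_ge {L : ℕ} [NeZero L] (hL : (400 : ℝ) ≤ L) {β : ℝ} (hβ : 128 ≤ β)
    (hLβ : 2 * β ≤ L) (b : ZMod L) (hb : 3 / 4 ≤ Real.cos (2 * Real.pi * (b.val : ℝ) / L)) :
    (L : ℝ) / (304 * Real.pi * β) * (Real.log β - Real.log 128) ≤
      ∑ a : ZMod L, modeGain L β (-2) (1 / β) ![a, b] := by
  have hπ := Real.pi_pos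
  have hβ1 : 1 ≤ β := by linarith
  have hβ0 : 0 < β := by linarith
  set t : ℝ := Real.cos (2 * Real.pi * (b.val : ℝ) / L) with ht
  have ht1 : t ≤ 1 := Real.cos_le_one _
  set c : ℝ := -2 * t + 2 with hc
  have hc' : |c| ≤ 3 / 2 := by
    rw [hc, abs_le]; constructor <;> linarith
  set g : ℕ → ℝ := fun n => -2 * Real.cos (2 * Real.pi * (n : ℝ) / L) + c with hg
  have key := cooperRow_thermal_sum_ge g (fun n => rfl) hc' hL hβ hLβ
  have hξ : ∀ a : ZMod L, torusBand L ![a, b] - (-2) = g a.val := by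
    intro a
    simp only [hg, hc, ht, torusBand, latticeMomentum, Fin.sum_univ_two, Matrix.cons_val_zero,
      Matrix.cons_val_one]
    ring
  have hgap : ∀ a : ZMod L, dWaveGap ![a, b] = Real.cos (2 * Real.pi * (a.val : ℝ) / L) - t := by
    intro a
    simp only [dWaveGap, latticeMomentum, Matrix.cons_val_zero, Matrix.cons_val_one, ht]
  have hcosa : ∀ a : ZMod L, Real.cos (2 * Real.pi * (a.val : ℝ) / L) = 1 - t - g a.val / 2 := by
    intro a
    simp only [hg, hc]
    ring
  -- per-mode lower bound by the thermal indicator function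
  have hpt : ∀ a : ZMod L, (if 1 / β ≤ g a.val then 1 / (76 * β * g a.val) else 0) ≤
      modeGain L β (-2) (1 / β) ![a, b] := by
    intro a
    split_ifs with h
    · have hgpos : 0 < g a.val := lt_of_lt_of_le (by positivity) h
      have habs : |torusBand L ![a, b] - (-2)| = g a.val := by rw [hξ a, abs_of_pos hgpos]
      have hm := modeGain_thermal_lower_bound hβ1 (-2) (![a, b]) (by rw [habs]; exact h)
      rw [habs] at hm
      refine le_trans ?_ hm
      have hgk : dWaveGap ![a, b] ≤ -(1 / 2) := by rw [hgap a, hcosa a]; linarith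
      have hgk2 : 1 / 4 ≤ dWaveGap ![a, b] ^ 2 := by nlinarith
      rw [div_le_div_iff₀ (by positivity) (by positivity)]
      have hβg : 0 ≤ 76 * β * g a.val := by positivity
      have := mul_le_mul_of_nonneg_right hgk2 hβg
      nlinarith
    · exact modeGain_nonneg L hβ0.le (-2) (1 / β) _
  -- the indicator sum equals the row sum of J.2
  have hsum : (1 / (76 * β)) * ∑ n ∈ (Finset.range L).filter (fun n : ℕ => 1 / β ≤ g n), 1 / g n =
      ∑ a : ZMod L, (if 1 / β ≤ g a.val then 1 / (76 * β * g a.val) else 0) := by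
    rw [Finset.mul_sum, Finset.sum_filter]
    refine Finset.sum_nbij (fun n : ℕ => (n : ZMod L)) (fun n _ => Finset.mem_univ _) ?_ ?_ ?_
    · intro n hn m hm h
      have hn' : n < L := by simpa using hn
      have hm' : m < L := by simpa using hm
      have := congrArg ZMod.val h
      rwa [ZMod.val_cast_of_lt hn', ZMod.val_cast_of_lt hm'] at this
    · intro a _
      exact ⟨a.val, by simpa using ZMod.val_lt a, ZMod.natCast_zmod_val a⟩
    · intro n hn
      have hn' : n < L := by simpa using hn
      simp only [ZMod.val_cast_of_lt hn']
      split_ifs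
      · rw [one_div_mul_one_div]
      · simp
  calc (L : ℝ) / (304 * Real.pi * β) * (Real.log β - Real.log 128)
      = (1 / (76 * β)) * ((L : ℝ) / (4 * Real.pi) * (Real.log β - Real.log 128)) := by
        field_simp; ring
    _ ≤ (1 / (76 * β)) * ∑ n ∈ (Finset.range L).filter (fun n : ℕ => 1 / β ≤ g n), 1 / g n :=
        mul_le_mul_of_nonneg_left key (by positivity)
    _ = ∑ a : ZMod L, (if 1 / β ≤ g a.val then 1 / (76 * β * g a.val) else 0) := hsum
    _ ≤ ∑ a : ZMod L, modeGain L β (-2) (1 / β) ![a, b] := Finset.sum_le_sum fun a _ => hpt a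

/-! ### J.4 The free gain at `μ = −2`, `h = 1/β`, `L ≥ 2β` carries the Cooper logarithm -/

/-- **Thermal Cooper logarithm of the free sourced torus**: for `L ≥ 400`, `β ≥ 128`, `L ≥ 2β`,
`p̃_L(β,−2,0,1/β) − p̃_L(β,−2,0,0) ≥ (log β − log 128)/(2736π β²)`. -/
theorem free_gain_thermal_lower_bound (L : ℕ) [NeZero L] (hL : (400 : ℝ) ≤ L) {β : ℝ} (hβ : 128 ≤ β)
    (hLβ : 2 * β ≤ L) :
    (Real.log β - Real.log 128) / (2736 * Real.pi * β ^ 2) ≤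
      sourcedPressure L β 0 (-2) (1 / β) - sourcedPressure L β 0 (-2) 0 := by
  have hπ := Real.pi_pos
  have hβ0 : 0 < β := by linarith
  have hLr : (0 : ℝ) < L := by linarith
  have hL3 : 3 ≤ L := by exact_mod_cast (show (3 : ℝ) ≤ L by linarith)
  have hlog : 0 ≤ Real.log β - Real.log 128 := by
    have := Real.log_le_log (by norm_num) hβ; linarith
  rw [free_gain_eq L hL3, sum_torusSite_two_eq]
  -- the good rows `b = 0, 1, …, ⌊L/9⌋`
  have hGlt : ∀ n ∈ Finset.range (L / 9 + 1), n < L := by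
    intro n hn
    rw [Finset.mem_range] at hn
    have : L / 9 < L := Nat.div_lt_self (Nat.pos_of_ne_zero (NeZero.ne L)) (by norm_num)
    omega
  have hinj : Set.InjOn (fun n : ℕ => (n : ZMod L)) ↑(Finset.range (L / 9 + 1)) := by
    intro n hn m hm h
    have := congrArg ZMod.val h
    rwa [ZMod.val_cast_of_lt (hGlt n hn), ZMod.val_cast_of_lt (hGlt m hm)] at this
  set GB : Finset (ZMod L) := (Finset.range (L / 9 + 1)).image (fun n : ℕ => (n : ZMod L)) with hGB
  have hGBcard : (L : ℝ) / 9 ≤ (GB.card : ℝ) := by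
    rw [hGB, Finset.card_image_of_injOn hinj, Finset.card_range]
    have h9 := Nat.lt_div_mul_add (show 0 < 9 by norm_num) (a := L)
    have h9r : (L : ℝ) < (L / 9 : ℕ) * 9 + 9 := by exact_mod_cast h9
    rw [div_le_iff₀ (by norm_num : (0 : ℝ) < 9)]
    push_cast
    linarith
  have hcos : ∀ b ∈ GB, 3 / 4 ≤ Real.cos (2 * Real.pi * (b.val : ℝ) / L) := by
    intro b hb
    rw [hGB, Finset.mem_image] at hb
    obtain ⟨n, hn, rfl⟩ := hb
    rw [ZMod.val_cast_of_lt (hGlt n hn)]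
    rw [Finset.mem_range] at hn
    have hn9 : (n : ℝ) ≤ L / 9 := by
      have h1 : ((L / 9 : ℕ) : ℝ) ≤ L / 9 := Nat.cast_div_le
      exact le_trans (by exact_mod_cast (show n ≤ L / 9 by omega)) h1
    set x : ℝ := 2 * Real.pi * (n : ℝ) / L with hx
    have hxle : x ≤ 0.7 := by
      rw [hx, div_le_iff₀ hLr]
      have := Real.pi_lt_d2
      nlinarith
    have hx0 : 0 ≤ x := by positivity
    have hcx := Real.one_sub_sq_div_two_le_cos (x := x)
    nlinarith
  have hrow : ∀ b ∈ GB, (L : ℝ) / (304 * Real.pi * β) * (Real.log β - Real.log 128) ≤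
      ∑ a : ZMod L, modeGain L β (-2) (1 / β) ![a, b] := fun b hb =>
    torusRow_modeGain_sum_ge hL hβ hLβ b (hcos b hb)
  have hX : 0 ≤ (L : ℝ) / (304 * Real.pi * β) * (Real.log β - Real.log 128) := by positivity
  have htotal : (L : ℝ) ^ 2 * (Real.log β - Real.log 128) / (2736 * Real.pi * β) ≤
      ∑ b : ZMod L, ∑ a : ZMod L, modeGain L β (-2) (1 / β) ![a, b] := by
    calc (L : ℝ) ^ 2 * (Real.log β - Real.log 128) / (2736 * Real.pi * β)
        = (L : ℝ) / 9 * ((L : ℝ) / (304 * Real.pi * β) * (Real.log β - Real.log 128)) := by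
          field_simp; ring
      _ ≤ (GB.card : ℝ) * ((L : ℝ) / (304 * Real.pi * β) * (Real.log β - Real.log 128)) :=
          mul_le_mul_of_nonneg_right hGBcard hX
      _ = ∑ _b ∈ GB, (L : ℝ) / (304 * Real.pi * β) * (Real.log β - Real.log 128) := by
          rw [Finset.sum_const, nsmul_eq_mul]
      _ ≤ ∑ b ∈ GB, ∑ a : ZMod L, modeGain L β (-2) (1 / β) ![a, b] := Finset.sum_le_sum hrow
      _ ≤ ∑ b : ZMod L, ∑ a : ZMod L, modeGain L β (-2) (1 / β) ![a, b] :=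
          Finset.sum_le_sum_of_subset_of_nonneg (Finset.subset_univ _) fun b _ _ =>
            Finset.sum_nonneg fun a _ => modeGain_nonneg L hβ0.le _ _ _
  have hβL : 0 < β * (L : ℝ) ^ 2 := by positivity
  rw [le_div_iff₀ hβL]
  calc (Real.log β - Real.log 128) / (2736 * Real.pi * β ^ 2) * (β * (L : ℝ) ^ 2)
      = (L : ℝ) ^ 2 * (Real.log β - Real.log 128) / (2736 * Real.pi * β) := by
        field_simp
    _ ≤ _ := htotal

/-! ### J.5 The refutations -/

/-- The crux with the bound `C·h²` (no `log β`). -/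
def TwSourcedInertnessNoLog : Prop :=
  ∀ μ₁ μ₂ : ℝ, -4 < μ₁ → μ₁ ≤ μ₂ → μ₂ < 0 → ∃ U₀ a C : ℝ, 0 < U₀ ∧ 0 < a ∧ 0 < C ∧ ∀ U : ℝ, 0 < U →
    U ≤ U₀ → ∀ β : ℝ, 1 ≤ β → β ≤ Real.exp (a / U) → ∀ μ ∈ Set.Icc μ₁ μ₂, ∃ L₀ : ℕ,
      ∀ (L : ℕ) [NeZero L], L₀ ≤ L → ∀ h : ℝ,
        (Real.log (Matrix.partitionFn β (dWaveSourceTorus L U μ h)).re / (β * (L : ℝ) ^ 2)) -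
          (Real.log (Matrix.partitionFn β (dWaveSourceTorus L U μ 0)).re / (β * (L : ℝ) ^ 2)) ≤
          C * h ^ 2

/-- The thermal-disc stub with the bound `C·h²` (no `log β`). -/
def TwThermalDiscNoLog : Prop :=
  ∀ μ₁ μ₂ : ℝ, -4 < μ₁ → μ₁ ≤ μ₂ → μ₂ < 0 → ∃ U₀ a C : ℝ, 0 < U₀ ∧ 0 < a ∧ 0 < C ∧ ∀ U : ℝ, 0 < U →
    U ≤ U₀ → ∀ β : ℝ, 1 ≤ β → β ≤ Real.exp (a / U) → ∀ μ ∈ Set.Icc μ₁ μ₂, ∃ L₀ : ℕ,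
      ∀ (L : ℕ) [NeZero L], L₀ ≤ L → ∀ h : ℝ, |h| ≤ 1 / β →
        (Real.log (Matrix.partitionFn β (dWaveSourceTorus L U μ h)).re / (β * (L : ℝ) ^ 2)) -
          (Real.log (Matrix.partitionFn β (dWaveSourceTorus L U μ 0)).re / (β * (L : ℝ) ^ 2)) ≤
          C * h ^ 2

theorem twThermalDiscNoLog_of_noLog (H : TwSourcedInertnessNoLog) : TwThermalDiscNoLog := by
  intro μ₁ μ₂ h1 h2 h3
  obtain ⟨U₀, a, C, hU₀, ha, hC, hmain⟩ := H μ₁ μ₂ h1 h2 h3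
  refine ⟨U₀, a, C, hU₀, ha, hC, fun U hU hUU₀ β hβ hβa μ hμ => ?_⟩
  obtain ⟨L₀, hL₀⟩ := hmain U hU hUU₀ β hβ hβa μ hμ
  exact ⟨L₀, fun L _ hL h _ => hL₀ L hL h⟩

/-- Orientation: `NoLog` is STRONGER than the crux (`C h² ≤ C(1 + log β)h²` for `β ≥ 1`). -/
theorem twSourcedInertness_of_noLog (H : TwSourcedInertnessNoLog) :
    Summit.HubbardSuperconductivity.HubbardSuperconductivity.Theses.ThermalWedge.TwSourcedInertness := by
  intro μ₁ μ₂ h1 h2 h3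
  obtain ⟨U₀, a, C, hU₀, ha, hC, hmain⟩ := H μ₁ μ₂ h1 h2 h3
  refine ⟨U₀, a, C, hU₀, ha, hC, fun U hU hUU₀ β hβ hβa μ hμ => ?_⟩
  obtain ⟨L₀, hL₀⟩ := hmain U hU hUU₀ β hβ hβa μ hμ
  refine ⟨L₀, fun L _ hL h => (hL₀ L hL h).trans ?_⟩
  have hlog : 0 ≤ Real.log β := Real.log_nonneg hβ
  have : C * h ^ 2 * 1 ≤ C * h ^ 2 * (1 + Real.log β) :=
    mul_le_mul_of_nonneg_left (by linarith) (by positivity)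
  linarith

/-- **`¬ TwThermalDiscNoLog`: even in the thermal disc the `log β` cannot be dropped.** Witness:
`μ₁ = μ₂ = −2`, `β = 128·exp(2736π(C+2))`, `U = min(U₀, a/(1+log β), 1/(2β²))`,
`L = max(L₀, 400, ⌈2β⌉)`, `h = 1/β`: the free thermal Cooper logarithm (J.4) gives
`G_U(1/β) ≥ (C+2)/β² − 2U ≥ (C+1)/β² > C/β²`. -/
theorem tw1696_false_without_log_disc : ¬ TwThermalDiscNoLog := by
  intro H
  obtain ⟨U₀, a, C, hU₀, ha, hC, hmain⟩ := H (-2) (-2) (by norm_num) le_rfl (by norm_num)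
  have hπ := Real.pi_pos
  set K : ℝ := 2736 * Real.pi with hK
  have hKpos : 0 < K := by positivity
  set β : ℝ := 128 * Real.exp (K * (C + 2)) with hβdef
  have hexp1 : 1 ≤ Real.exp (K * (C + 2)) := Real.one_le_exp (by positivity)
  have hβ128 : 128 ≤ β := by rw [hβdef]; nlinarith
  have hβ1 : 1 ≤ β := by linarith
  have hβ0 : 0 < β := by linarith
  have hlogβ : Real.log β = Real.log 128 + K * (C + 2) := by
    rw [hβdef, Real.log_mul (by norm_num) (Real.exp_pos _).ne', Real.log_exp]
  have hlog0 : 0 ≤ Real.log β := Real.log_nonneg hβ1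
  set U : ℝ := min U₀ (min (a / (1 + Real.log β)) (1 / (2 * β ^ 2))) with hUdef
  have hUpos : 0 < U := lt_min hU₀ (lt_min (div_pos ha (by linarith)) (by positivity))
  have hUU₀ : U ≤ U₀ := min_le_left _ _
  have hUa : U ≤ a / (1 + Real.log β) := (min_le_right _ _).trans (min_le_left _ _)
  have hUq : U ≤ 1 / (2 * β ^ 2) := (min_le_right _ _).trans (min_le_right _ _)
  have hβexp : β ≤ Real.exp (a / U) := le_exp_div_of_le hUpos hβ1 hUa
  obtain ⟨L₀, hL₀⟩ := hmain U hUpos hUU₀ β hβ1 hβexp (-2) ⟨le_rfl, le_rfl⟩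
  set L : ℕ := max L₀ (max 400 ⌈2 * β⌉₊) with hLdef
  have hLL₀ : L₀ ≤ L := le_max_left _ _
  have hL400 : 400 ≤ L := (le_max_left _ _).trans (le_max_right _ _)
  have hLceil : ⌈2 * β⌉₊ ≤ L := (le_max_right _ _).trans (le_max_right _ _)
  have hLβ : 2 * β ≤ L := (Nat.le_ceil _).trans (by exact_mod_cast hLceil)
  haveI : NeZero L := ⟨by omega⟩
  have hL400r : (400 : ℝ) ≤ L := by exact_mod_cast hL400
  have hh : |1 / β| ≤ 1 / β := by rw [abs_of_pos (by positivity)]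
  have hup : sourcedPressure L β U (-2) (1 / β) - sourcedPressure L β U (-2) 0 ≤ C * (1 / β) ^ 2 :=
    hL₀ L hLL₀ (1 / β) hh
  have hfree := free_gain_thermal_lower_bound L hL400r hβ128 hLβ
  have htrans := free_gain_sub_le_gain L U (-2) (1 / β) hβ0
  rw [abs_of_pos hUpos] at htrans
  have hval : (Real.log β - Real.log 128) / (2736 * Real.pi * β ^ 2) = (C + 2) / β ^ 2 := by
    rw [hlogβ, ← hK]; field_simp; ring
  rw [hval] at hfree
  have h2U : 2 * U ≤ 1 / β ^ 2 := by
    calc 2 * U ≤ 2 * (1 / (2 * β ^ 2)) := by linarith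
      _ = 1 / β ^ 2 := by field_simp
  have hfin : (C + 2) / β ^ 2 - 1 / β ^ 2 ≤ C * (1 / β) ^ 2 := by linarith
  rw [div_sub_div_same, show C * (1 / β) ^ 2 = C / β ^ 2 by field_simp,
    div_le_div_iff_of_pos_right (by positivity)] at hfin
  linarith

/-- **`¬ TwSourcedInertnessNoLog`: the `log β` of the crux is load-bearing.** -/
theorem tw1696_false_without_log : ¬ TwSourcedInertnessNoLog :=
  fun H => tw1696_false_without_log_disc (twThermalDiscNoLog_of_noLog H)

end LogLoadBearing

/-! ## §E WHY THE CRUX RESISTS — attempts, near-misses, open attack lines (prose; no theorems)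

ATTEMPTS (cycle 1) and outcomes:
1. Readback / typing: `Real.log ((partitionFn β H).re)` with `Z > 0` (Hermitian `H`, nonempty index
   type) — no junk; `β ≥ 1`, `L ≥ 1`; quantifier order `∃L₀(U,β,μ) ∀L ∀h` faithful to the informal
   claim; large `h` automatic (§B). NOTHING to exploit.
2. Vacuity: hypotheses trivially satisfiable (`U = U₀`, `β = 1`, `μ = μ₁`). Triviality: no (the `U → 0`,
   `L → ∞` free susceptibility `χ̃_∞(β,μ) ~ A(μ) log β` is unbounded in `β`, so no `β`-free bound and
   `simp`-type closure is impossible; numerics job j005055).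
3. Physics kill at `h → 0` (thermodynamic limit): the refuter controls `(U, β)` only inside
   `U · log β ≤ a` with `a` the PROVER's constant. There every ladder is perturbative: `d`-wave
   (Kohn–Luttinger, first attractive coupling `O(U²)`): `U² log β ≤ aU → 0`; particle–hole channels at
   `μ₂ < 0` have bounded bubbles (nesting cut off by `|μ|`), `U χ_ph ≤ U₀(μ-window)·O(log²(1/|μ₂|))`.
   Free part: `χ̃_∞ = A(μ) log β + B(μ)` with `A(μ) → ∞` only as `μ → 0⁻` (van Hove × Cooper gives
   `log² β` exactly at `μ = 0`, excluded by `μ₂ < 0`). BKT / KL superconductivity live at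
   `T ~ e^{−c/U²} ≪ e^{−a/U}`: below the floor. ⇒ NO MECHANISM for super-`log β` growth at admissible
   `(U, β, μ)`; the crux is the expected Fermi-liquid statement. Its difficulty is purely constructive
   (BGM 2006 Thm 1.1 is proved only for density < 1/4; Nambu source + general filling unwritten).
4. Finite-`h` regime: `f_L(h)/h²` need not be monotone for `U > 0`, but `sup_h` is attained in
   `|h| < 8√2/(C(1+log β))` (§B) where the sourced free gas has `f₀'' ≤ f₀''(0)`; no amplification
   mechanism at `|h| ≫ T` (the source gaps the Fermi surface except at 4 nodes). No kill.
5. Finite-size kill: shell degeneracy (§D) — kills only the variants without `L₀(β,μ)`. PROVED for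
   the all-`L` variant; the crux itself escapes by `L₀ ≫ β`.
6. `T = 0` shadow (§C): would need a low-energy GC state with pair amplitude `≫ e^{−a/(2U)}`; physics
   gives `e^{−c/U²}`. No kill; but §C is a cheap positive by-product for the planner (ceiling on the
   GC tower without AHM / ensemble equivalence).

ATTEMPTS (cycle 2) and outcomes:
7. Re-audit of the only non-automatic regime, the window `h²(1+log β) ≲ κU` isolated by the route's
   reduction (Theorems/ThermalWedgeTwSourcedInertnessReduction: outside it `G_U ≤ G_0 + 2U` settles
   the crux from the free bound): the first-order vertex correction to `χ_d` vanishes identically on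
   the square torus (`Σ_k ĝ_d(k) Π(k) = 0` for every `k_x ↔ k_y`-symmetric `Π`, B1g vs A1g), the
   Hartree shift moves `μ` by `O(U)` inside the compact, and the `d`-wave ladder parameter is
   `α ρ_d U² log β ≤ α ρ_d a U → 0`: no instability for ANY `a` — the ceiling `e^{a/U}` is dictated by
   proof technology (convergence of the repulsive `s`-wave ladder series, `ρ_s a < 1`), not by truth;
   the statement should even hold up to `β ≤ e^{c/U²}`, `c < 1/(αρ_d)` (Kohn–Luttinger scale). NO KILL.
8. The exact `U = 0` formula (§H) makes every finite-size statement two lines long but CANNOT kill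
   the crux: at fixed `(U, β, μ)` the zero-mode Curie term `F(3√2β|h|)/(βL²)` (linear in `|h|` for
   `β|h| ≫ 1`, slope `3√2·#zero-modes/L²`) is absorbed by `L₀(U,β,μ)` (`L₀² ≳ β/(C(1+log β))` from
   the small-`h` end, `L₀⁴ ≳ 1/(U C(1+log β))` from the linear end via the `2U` slack). Even at
   `U = 0` exactly the statement survives with `L₀(β)`. NO KILL; quantitative thresholds recorded (§I).
9. TARGETS (§I): the lead's stubs `stub_thermalDisc`, `stub_entropyDensity` are true thermodynamic
   statements (`χ_d ≲ ρ_d log β`, `s ≲ γT`); only their `L₀`-uniform variants die (proved).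

NEAR-MISSES (not formalised; what is missing):
* (DONE in §D.11, no longer a near-miss) `¬ TwSourcedInertnessUniformL0`.
* TIGHTNESS of `log β` / of the window: `∃ c(μ) > 0`: any admissible `C` has `C ≥ c(μ₂)` with
  `c(μ₂) ~ A(μ₂) → ∞` as `μ₂ → 0⁻`; and `¬(bound C h²)`. Needs the free BdG pressure
  `p̃₀,L(h) − p̃₀,L(0) = (2/βL²) Σ_k [log cosh(βE_k/2) − log cosh(βξ_k/2)]`, `E_k² = ξ_k² + 8h²ĝ_k²`
  (Bogoliubov transformation of `dWaveSourceTorus L 0 μ h`; the tree has `FermionQuasiFree` but no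
  BdG/Nambu diagonalisation) plus a Riemann-sum lower bound of Cooper type with the `d`-wave weight
  (cf. `TorusCooperSumLogBound`). Numerically (j005055): table of `χ̃(β, μ, L)` and `Cmin(μ)`.

10. `log β` LOAD-BEARING (§J): PROVED `¬ TwSourcedInertnessNoLog` and its thermal-disc form — the
   first theorem of this file about the thermodynamic regime `L ≫ β` rather than a fixed torus.

OPEN ATTACK LINES for later cycles: (i) tightness of the `μ`-window (`log² β` at `μ₂ = 0`, van Hove
× Cooper: `¬` crux-on-`[μ₁, 0]`) needs a row estimate at TANGENTIAL crossings (`v_F → 0` near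
`(π, 0)`), not in the tree (the transversal walk of `TorusCooperSumRowWalk` gives one log only);
(i') the constant: `C ≥ c·ρ_d(μ₂)` with `ρ_d → ∞` as `μ₂ → 0⁻` (same missing estimate); (ii) DONE (§F–§G):
the KLS ceiling for GC-exposed ground states is fully proved; what remains between it and the
route's `TwExponentialCeiling` is GC-exposure of the canonical sector `N_L = 2⌊(1−δ)L²/2⌋`
(convexity of `N ↦ E₀(N)` / `TwPureThermalBound`); (iii) watch the lead's stuck stubs (none yet).
-/

end Summit.HubbardSuperconductivity.HubbardSuperconductivity.Cruxes.TwSourcedInertness.Disproof
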